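import Literature.MathematicalPhysics.QuantumFieldTheory.Balaban1983to89.B16Exp198
import Literature.MathematicalPhysics.QuantumFieldTheory.Balaban1983to89.B16Ineq197
import Literature.MathematicalPhysics.QuantumFieldTheory.Balaban1983to89.B13MayerDecoupling

/-!
# `Balaban1983to89.B16Eq190Resummation` — the Mayer step and the component resummation (1.90)–(1.91) of
T. Bałaban, *Large field renormalization. II. Localization, exponentiation, and bounds for the 𝐑 operation*,
Commun. Math. Phys. **122**, 355–392 (1989) [Balaban1989LargeFieldII] (cell paper B16), pp. 387–388 [PDF 33–34]

statement-level skeleton of published theorems with citation tags; proofs where landed; nothing here is a claim about the Yang–Mills mass gap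

PDF held: `paper:balaban1989-cmp122-large-field-ii` (journal page = PDF page + 354); pp. 379, 387, 388 read this
session as images (`…/b2b-balaban-ref1/pages/1989-cmp122-large-field-II/…-p025-x2.png`, `-p033-x2.png`, `-p034-x2.png`);
v1.1 (Part E): pp. 389–390 (`-p035-x2.png`, `-p036-x2.png`); v1.2 (Part F): pp. 378–379, 387 re-read; v1.3 (Part G): p. 390;
v1.4 (Part H): pp. 377, 380, 388–390 re-read as text (`lit read paper:balaban1989-cmp122-large-field-ii`, PDF pp. 23, 26,
34–36); v1.5 (Part I): pp. 377, 379 (PDF pp. 23, 25) re-read as text.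

WHAT IS REPRODUCED = SKELETON rows **B16.Eq1.90** (the polymer expansion) and **B16.Eq1.91** (the activities, a
definition row: here its index set *"{X_{j₁},…,X_{j_q}} and 𝐃 such that the connected localization domain they determine
is equal to X′"* receives a BODY), unit `lit-balaban-p24` (Phase-2 proof seat p24, gen 3; HOME
`run/shared/lean/pub/lit-balaban/`); v1.4 (gen 4, Part H) adds rows **B16.Eq1.92** and **B16.Eq1.97** FOR THIS GAS (model
instance: the Mayer terms of Part D under sup-norm bounds of the operations) and the knitting of (1.98)/(1.99) with (1.97)
discharged; v1.5 (Part I) the same for CONFIGURATION-DEPENDENT localization terms (pp. 377/379), under which the second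
selector of p. 389 is a theorem.  The sibling `B16Exp198` (the exponentiation (1.97) ⇒ (1.98)–(1.99)) lists exactly
this edge as *"NOT TYPED HERE: the Mayer step (1.90)–(1.91)"*; there the curly bracket `{⋯}` IS the polymer partition
function `polymerPartitionFunction ι F adm`.  This file PROVES that identification from the printed recipe.

THE PASSAGE, p. 387 bottom – p. 388 top, verbatim: *"The next step is a construction of an exponentiated cluster expansion
for the expression in the curly bracket in (1.72). The first operation is the Mayer expansion of the exponential, the same
as in (7.1) [I]. We obtain a sum of terms over {X₁,…,X_n} and subfamilies 𝐃 ⊂ 𝐃_k. Each term determines the localization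
domain X′₀ = ⋃_{Y∈𝐃} Y ∪ ⋃_{j=1}^n X_j. This domain is decomposed into components, but now we define them in a different
way. At first we take components of X′₀∖⋃_{i=1}^m Y_i, and we consider two such components as connected, if they are
contained in one localization domain Y of a term in the product. This means that each component has a correct tree graph
decay factor, controlling summations over components. Thus we write X′₀ = ⋃_{p=1}^r X′_p, and the expression
corresponding to X′₀ factorizes in the components. For the fixed decomposition we resum all the expressions determining
the same components. We obtain the following polymer expansion*
  `{⋯} = 1 + Σ_{r≥1} Σ_{{X′₁,…,X′_r}} Π_{p=1}^r F(X′_p),`                                                    (1.90)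
*where the activities F(X′) are defined by*
  `F(X′) = Σ_q Σ′_{{X_{j₁},…,X_{j_q}}} Σ′_𝐃 Π_{Y∈𝐃} ∫₀¹dt(Y) Π_{h=1}^q 𝐓′_k(X_{j_h}) Π_{Y∈𝐃} V(Y) exp Σ_{Y∈𝐃} t(Y)V(Y).` (1.91)
*Here the summation is over {X_{j₁},…,X_{j_q}} and 𝐃 such that the connected localization domain they determine is equal
to X′."*  The curly bracket of (1.72) p. 379 is `{Σ_{n≥0} Σ_{{X₁,…,X_n}} Π_{j=1}^n 𝐓′_k(X_j) exp Σ_Y V(Y, U_k)}`.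

HOW IT IS TYPED (abstract finite catalogues, as in `B13Factor210` / `B13Resummation` / `B16Exp198`; cell DIVERGENCE
D-b02.14: cube geometry abstracted).  ITEMS of a term = the chosen operations X_j (a finite type `LF`) and the chosen
domains Y ∈ 𝐃 (a finite type `DomY`); each item has a footprint of M-cubes (`locX`, `locY`), `Yfix` = the cubes of the
FIXED regions ⋃_{i=1}^m Y_i, `adjC` = "equal or sharing a wall" on cubes.  Print's modified connectedness, made an
item-level relation: two items are LINKED iff their parts OUTSIDE ⋃Y_i touch (`olink`) — an ordinary step inside
X′₀∖⋃Y_i joins the outside parts of two items, and the pieces of one item's outside part are glued through that item, so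
the glued components of X′₀∖⋃Y_i are exactly the unions of outside parts of the link-components (`Touch` distributes over
unions, `pinc_fp_iff`).  A term `({X_j}, 𝐃)` is ONE polymer iff its items form one link-component (`IsConnTerm` — the BODY
of (1.91)'s index condition), its polymer is the localization domain `locDom S 𝐃 = ⋃_{X∈S} X ∪ ⋃_{Y∈𝐃} Y`, and two polymers
are incompatible iff their outside parts touch (`pinc` = the `ι` of `B16Exp198.Geometry`: *"polymers attached to the same
FIXED Y_i are compatible"*).  The printed clause *"the expression corresponding to X′₀ factorizes in the components"* is
the HYPOTHESIS `TermMul` (`B13Factor210.ActMul` shape: the term of a disjoint union of two mutually unlinked terms is the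
product of the terms) — it is the locality of the integral operations 𝐓′_k of (1.71); Part F (v1.2) DERIVES it
(`termMul_mayerTerm`) from locality hypotheses on the operations (`LocalOps`) and on the `V(Y)` (`DepOn`) over a
configuration space `Var → Sv`; "every item owns a cube outside ⋃Y_i" is `B16Exp198.Geometry.out_nonempty`.

WHAT IS PROVED (complete kernel-checked proofs, standard axioms; finite combinatorics):
* Part A (components): `lcomps T` the link-components of a finite item family; `prod_lcomps` — the factorization of a
  `LinkMul` weight over the components; `sum_eq_sum_compFamilies` — the bijection `T ↦ {components}`, inverse `⋃`,
  as a re-indexing of `Σ_T W(T)` over the families of pairwise unlinked connected item sets.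
* Part B (footprints): `pinc_fp_iff` (two item families are unlinked iff their localization domains are compatible);
  **`sum_eq_polymerPartitionFunction`**: `Σ_T W(T) = Ξ(F)` = tree `polymerPartitionFunction pinc F polys` with
  `F(X′) = Σ_{T one component, locDom T = X′} W(T)` — *"for the fixed decomposition we resum all the expressions
  determining the same components"*.
* Part C (the printed two-sorted reading): `IsConnTerm`, `locDom`, **`F191`** ((1.91): the outer sums as a definition from
  the term functional), **`eq190`**: `Σ_{{X_j}} Σ_𝐃 term({X_j}, 𝐃) = Ξ(F191)`, and `polymerPartitionFunction_eq_one_add` (the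
  printed shape `1 + Σ_{r≥1} Σ_{{X′₁,…,X′_r}} Π F(X′_p)`).
* Part D (the Mayer step (7.1) [I], tree `B13MayerDecoupling.mayer_expansion_21`): for additive operations `Op {X_j}` (the
  product Π_j 𝐓′_k(X_j) as ONE additive map on functions of the fields) the curly bracket `Σ_{{X_j}} Op{X_j}[exp Σ_Y V(Y)]`
  equals `Σ_{{X_j}} Σ_𝐃 Op{X_j}[Π_{Y∈𝐃} ∫₀¹dt e^{tV(Y)} V(Y)]` (`bracket_eq_sum_mayerTerm`; the t-integrals are kept inside
  the operations — print writes them outside, an exchange with the 𝐓′_k-integrals that is not asserted here), hence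
  **`eq190_bracket`**: `{⋯} = Ξ(F191)` under `TermMul` of these terms.
* Part E (v1.1; (1.98) p. 390 *"The estimate (1.97) is sufficient for convergence of the exponentiated cluster expansion,
  and we have {⋯} = exp 𝐑′^{(k)} = exp Σ_X 𝐑′^{(k)}(X)"*): the composition with the sibling `B16Exp198.exp_sum_locR_eq_Z`
  FOR THIS GAS — **`eq190_exp`** / **`bracket_eq_exp_sum_locR`**: `{⋯} = exp Σ_X 𝐑′^{(k)}(X)` with
  `𝐑′^{(k)}(X) = B16Exp198.locR pinc polys190 …` under the (1.97)-shaped activity bound `|F(X′)| ≤ c₁e^{−R d(X′)}`, the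
  relative leaves (1.26)_rel / volume bound on the outside footprints `X′∖⋃Y_i` of the catalogue, footprint-local adjacency
  (`nbr`, at most `ν` cubes) and the Kotecký–Preiss constants `κ₀ + τc_v ≤ R`, `c₁e^{τc_v}K₀ν ≤ τ` (all hypotheses, verbatim
  those of `B16Exp198`); bookkeeping via the reflexive closure `pincR` (= `pinc` on the catalogue; relabeling invariance of
  `ClusterExpansion`).
* Part F (v1.2; p. 388 *"the expression corresponding to X′₀ factorizes in the components"* DERIVED): over a configuration
  space `Var → Sv` (variables at cubes `site v`), `DepOn f A` = f depends only on the variables in `A ∪ ⋃Y_i`; the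
  hypothesis structure **`LocalOps`** on `Op {X_j} = Π_j 𝐓′_k(X_j)` (identity on ∅; composition over disjoint families;
  pull-out `Op S (f·g) = Op S f · g` of factors `g` localized where the outside parts do not touch those of ⋃_{j∈S} X_j;
  localization of `Op S f` in `⋃_{j∈S} X_j ∪ A`; consistent: `localOps_id`, non-identity model `localOps_reset` (v1.3));
  **`termMul_mayerTerm`**: `LocalOps` + every
  `V(Y)` localized in `Y` ⇒ `TermMul` of the Mayer terms; hence **`eq190_bracket_of_localOps`** and
  **`bracket_eq_exp_sum_locR_of_localOps`** — (1.90) and (1.98) for the curly bracket with the factorization clause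
  replaced by the locality of (1.71)'s operations.
* Part G (v1.3; (1.99) p. 390 *"|𝐑′^{(k)}(X,(𝐔,𝐉))| ≤ O(1)c₁ exp(−(1+½β)κd_{k,∪Y_i}(X))"*): **`norm_locR190_le`** = the
  sibling's kernel form `B16Exp198.norm_locR_le_of_small` FOR THIS GAS (`|𝐑′^{(k)}(X)| ≤ (eνc_vK₀²)·c₁·e^{−r₁ dX}` under the
  (1.97)-shaped bound inside X, the relative leaves, `RelSubadd pinc polys190 id d X dX c`, `r₁c ≤ b`, `r₁ + 2κ₀ + 2 ≤ R`,
  `c₁e^{b+1}K₀νc_v ≤ 1`, an outside cube `q₀ ∈ X∖⋃Y_i`); clusters / `RelSubadd` insensitive to `pinc ↦ pincR`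
  (`isPolymerCluster_pincR_iff`, `relSubadd_pincR_iff`).
* Part H (v1.4; (1.92) p. 388 *"Using (1.68), (1.73), (1.89), we obtain (1.92)"* and (1.97) pp. 389–390 FOR THIS GAS):
  `OpBound Op θ` = the sup-norm bound of the operations that (1.73)–(1.75)·(1.89) give (`‖Op{X_j} f‖ ≤ Π_j θ_j · sup‖f‖`;
  from single-operation bounds by the composition law of `LocalOps`: `opBound_of_single`/`opBound_of_localOps`; model
  `opBound_resetOp`); `adm191`/`polymer191` = the one-polymer catalogue of the sibling `B16Ineq197` induced by the connected
  terms of `F191` (sizes `Sizes`); **`major192_mayerTerm`** = (1.92) (`B16Ineq197.Polymer.Major192`) DERIVED for the Mayer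
  terms from `OpBound` + `‖V(Y)‖ ≤ a(d(Y))` via `‖∫₀¹e^{tV}V dt‖ ≤ |V|e^{|V|}` (`norm_integral_exp_mul_le`); the p. 389
  selector «X′ ∩ ⋃Y_i ≠ ∅ ⇒ 𝐃 ≠ ∅» PROVED (`snd_nonempty_of_meets`, X_j ∩ ⋃Y_i = ∅); the selector-free (1.97) with
  `c₁ = e^{−p₀(g_k)} + α^{1/3}` for every polymer (`norm_sum_adm_le_of_nonempty` over any `B16Ineq197.Polymer` whose admissible
  pairs are nonempty; **`norm_F191_mayerTerm_le`**), the printed two cases (`norm_F191_mayerTerm_le_of_meets`: c₁ = α^{1/3};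
  `norm_F191_mayerTerm_le_of_not_meets`: c₁ = e^{−p₀(g_k)} under the second selector `hsel` as printed), unit b02's leaf
  `B16.Ineq197` INHABITED by this gas (**`ineq197_gas`**), and Parts E/G re-stated with `h197` DISCHARGED
  (**`bracket_eq_exp_sum_locR_of_leaves`**: (1.72) ⇒ (1.98); `norm_locR190_le_of_leaves`: (1.99)).
* Part I (v1.5; p. 379 *"the terms V(Y, U_k) depend on the sequence {Ω_j^c, Z_j} restricted to the components of Z
  contained in Y"*, p. 377 *"the summation is over domains Y ∈ 𝐃_k satisfying the property that the intersection Y ∩ Z^~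
  is a union of components of Z^~, containing at least one component"*): configuration-dependent localization terms
  `V S Y` (`bracketS`, `mayerTermS`), the locality `VLocal` (dependence on S only through the X_j ⊆ Y) and the index
  condition `VSupp A` (vanishing unless Y contains an X_j of the family or meets the anchor cubes A); the Mayer step and
  the factorization (**`termMul_mayerTermS`**: an X_j inside a Y is linked to it), (1.90)/(1.98) for this bracket
  (`eq190_bracketS_of_localOps`, `bracketS_eq_exp_sum_locR_of_localOps`), (1.92) (`major192_mayerTermS`), the SECOND
  selector of p. 389 as a THEOREM (**`mayerTermS_eq_zero_of_empty`**: a term without operation domains whose domain misses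
  the anchors vanishes), (1.97) with no selector hypothesis (**`norm_F191_mayerTermS_le_of_not_meets`** c₁ = e^{−p₀(g_k)}
  off the anchors, `…_of_meets` α^{1/3} on ⋃Y_i, `norm_F191_mayerTermS_le` selector-free), **`ineq197_gasS`** (`B16.Ineq197`
  inhabited with the fixed regions as anchors), **`bracketS_eq_exp_sum_locR_of_leaves`**, and the consistency model
  `switchOn` of `VLocal` ∧ `VSupp`.
NOT ASSERTED: anything analytic (the construction (1.71) of the 𝐓′_k — their locality enters Part F as the `LocalOps`
hypotheses, their positivity/normalization (1.73)–(1.75) with (1.89) enters Part H as `OpBound`, (1.68) as the bound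
`‖V(Y)‖ ≤ a(d(Y))`; the geometric leaves (1.93)–(1.96) of the sibling `B16Ineq197` and those of `B16Exp198` stay hypotheses —
their lattice discharges are the siblings `B16Ineq197RelGlue`/`RelCubes`/`XBudget`/`Window`, `B16Count196Packing`; the second
selector of p. 389 is the hypothesis `hsel`); no new `Prop` fact (D-0026): `LinkMul`/`TermMul`/`IsConnTerm`/`pincR`/`DepOn`/
`LocalOps`/`OpBound`/`VLocal`/`VSupp` are definitions of properties of / relations on the abstract data, `Sizes`/`adm191`/
`polymer191`/`restrictAdm`/`bracketS`/`mayerTermS`/`switchOn` are data.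
-/

namespace Literature.MathematicalPhysics.QuantumFieldTheory.Balaban1983to89.B16Eq190Resummation

open Finset
open Literature.Probability.LatticeModels (IsCompatible polymerPartitionFunction polymerPartitionFunction_eq_sum_filter)

/-! ## Part A. Link-components of a finite family of items («this domain is decomposed into components») -/

section Components

variable {I : Type*} {link : I → I → Prop}

variable (link) in
/-- Chains of linked items inside the family `T` (print p. 388: components *"connected, if …"* — the transitive closure
of the elementary link relation, restricted to the items of the term). [cite: Balaban1989LargeFieldII, (1.90) p.388] -/
def LReach (T : Finset I) : I → I → Prop :=
  Relation.ReflTransGen fun x y => link x y ∧ x ∈ T ∧ y ∈ T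

variable (link) in
/-- A family of items determines ONE component (*"the connected localization domain they determine"*, (1.91) p. 388):
non-empty and any two of its items are joined by a chain of links inside it. [cite: Balaban1989LargeFieldII, (1.91) p.388] -/
def IsLConn (C : Finset I) : Prop := C.Nonempty ∧ ∀ a ∈ C, ∀ b ∈ C, LReach link C a b

variable (link) in
open Classical in
/-- The component of the item `a` in the family `T`. [cite: Balaban1989LargeFieldII, (1.90) p.388] -/
noncomputable def lcomp (T : Finset I) (a : I) : Finset I := T.filter (LReach link T a)

variable (link) in
/-- The components `X′₁, …, X′_r` of a term, as the finite family of the link-components of its items (*"Thus we write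
X′₀ = ⋃_{p=1}^r X′_p"*). [cite: Balaban1989LargeFieldII, (1.90) p.388] -/
noncomputable def lcomps [DecidableEq I] (T : Finset I) : Finset (Finset I) := T.image (lcomp link T)

/-- Chains inside a larger family. [cite: Balaban1989LargeFieldII, (1.90) p.388] -/
theorem LReach.mono {T T' : Finset I} (h : T ⊆ T') {a b : I} (hab : LReach link T a b) : LReach link T' a b := by
  induction hab with
  | refl => exact Relation.ReflTransGen.refl
  | tail _ hxy ih => exact ih.tail ⟨hxy.1, h hxy.2.1, h hxy.2.2⟩

/-- The end of a non-trivial chain lies in the family. [cite: Balaban1989LargeFieldII, (1.90) p.388] -/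
theorem LReach.mem_or_eq {T : Finset I} {a b : I} (hab : LReach link T a b) : b ∈ T ∨ b = a := by
  induction hab with
  | refl => exact Or.inr rfl
  | tail _ h _ => exact Or.inl h.2.2

/-- The end of a chain from an item of the family lies in the family. [cite: Balaban1989LargeFieldII, (1.90) p.388] -/
theorem LReach.mem {T : Finset I} {a b : I} (hab : LReach link T a b) (ha : a ∈ T) : b ∈ T := by
  rcases hab.mem_or_eq with h | rfl
  · exact h
  · exact ha

/-- Concatenation of chains. [cite: Balaban1989LargeFieldII, (1.90) p.388] -/
theorem LReach.trans {T : Finset I} {a b c : I} (hab : LReach link T a b) (hbc : LReach link T b c) :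
    LReach link T a c :=
  Relation.ReflTransGen.trans hab hbc

/-- One link is a chain. [cite: Balaban1989LargeFieldII, (1.90) p.388] -/
theorem LReach.single {T : Finset I} {a b : I} (ha : a ∈ T) (hb : b ∈ T) (h : link a b) : LReach link T a b :=
  Relation.ReflTransGen.single ⟨h, ha, hb⟩

/-- Chains can be reversed when the link relation is symmetric. [cite: Balaban1989LargeFieldII, (1.90) p.388] -/
theorem LReach.symm (hsymm : ∀ x y, link x y → link y x) {T : Finset I} {a b : I} (hab : LReach link T a b) :
    LReach link T b a := by
  induction hab with
  | refl => exact Relation.ReflTransGen.refl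
  | tail _ h ih => exact (Relation.ReflTransGen.single ⟨hsymm _ _ h.1, h.2.2, h.2.1⟩).trans ih

/-- Membership in a component. [cite: Balaban1989LargeFieldII, (1.90) p.388] -/
theorem mem_lcomp {T : Finset I} {a b : I} : b ∈ lcomp link T a ↔ b ∈ T ∧ LReach link T a b := by
  classical
  exact Finset.mem_filter

/-- A component is a sub-family. [cite: Balaban1989LargeFieldII, (1.90) p.388] -/
theorem lcomp_subset (T : Finset I) (a : I) : lcomp link T a ⊆ T := fun _ hb => (mem_lcomp.1 hb).1

/-- An item lies in its component. [cite: Balaban1989LargeFieldII, (1.90) p.388] -/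
theorem mem_lcomp_self {T : Finset I} {a : I} (ha : a ∈ T) : a ∈ lcomp link T a :=
  mem_lcomp.2 ⟨ha, Relation.ReflTransGen.refl⟩

/-- A chain from `a` stays inside the component of `a`. [cite: Balaban1989LargeFieldII, (1.90) p.388] -/
theorem LReach.lcomp {T : Finset I} {a b : I} (hab : LReach link T a b) : LReach link (lcomp link T a) a b := by
  induction hab with
  | refl => exact Relation.ReflTransGen.refl
  | tail hac hcd ih => exact ih.tail ⟨hcd.1, mem_lcomp.2 ⟨hcd.2.1, hac⟩, mem_lcomp.2 ⟨hcd.2.2, hac.tail hcd⟩⟩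

/-- Linked items of the family have the same component (symmetric links). [cite: Balaban1989LargeFieldII, (1.90) p.388] -/
theorem lcomp_eq_of_mem (hsymm : ∀ x y, link x y → link y x) {T : Finset I} {a b : I} (hb : b ∈ lcomp link T a) :
    lcomp link T b = lcomp link T a := by
  obtain ⟨-, hab⟩ := mem_lcomp.1 hb
  ext c
  simp only [mem_lcomp]
  exact ⟨fun h => ⟨h.1, hab.trans h.2⟩, fun h => ⟨h.1, (hab.symm hsymm).trans h.2⟩⟩

/-- The component of an item of the family is ONE component. [cite: Balaban1989LargeFieldII, (1.91) p.388] -/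
theorem isLConn_lcomp (hsymm : ∀ x y, link x y → link y x) {T : Finset I} {a : I} (ha : a ∈ T) :
    IsLConn link (lcomp link T a) := by
  refine ⟨⟨a, mem_lcomp_self ha⟩, fun b hb c hc => ?_⟩
  exact ((mem_lcomp.1 hb).2.lcomp.symm hsymm).trans (mem_lcomp.1 hc).2.lcomp

/-- Membership in the family of components. [cite: Balaban1989LargeFieldII, (1.90) p.388] -/
theorem mem_lcomps [DecidableEq I] {T : Finset I} {C : Finset I} :
    C ∈ lcomps link T ↔ ∃ a ∈ T, lcomp link T a = C :=
  Finset.mem_image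

/-- The empty term has no components (print: the term `1` of (1.90)). [cite: Balaban1989LargeFieldII, (1.90) p.388] -/
theorem lcomps_empty [DecidableEq I] : lcomps link (∅ : Finset I) = ∅ := by
  simp [lcomps]

/-- The components cover the family: `X′₀ = ⋃_p X′_p` at item level. [cite: Balaban1989LargeFieldII, (1.90) p.388] -/
theorem biUnion_lcomps [DecidableEq I] (T : Finset I) : (lcomps link T).biUnion id = T := by
  ext b
  simp only [Finset.mem_biUnion, id, mem_lcomps]
  constructor
  · rintro ⟨C, ⟨a, -, rfl⟩, hb⟩
    exact lcomp_subset T a hb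
  · intro hb
    exact ⟨_, ⟨b, hb, rfl⟩, mem_lcomp_self hb⟩

variable (link) in
/-- **The families of components** (*"{X′₁,…,X′_r}"* at item level): finite families of item sets each of which is ONE
component, with NO link between distinct members. [cite: Balaban1989LargeFieldII, (1.90) p.388] -/
def IsCompFamily (Ps : Finset (Finset I)) : Prop :=
  (∀ C ∈ Ps, IsLConn link C) ∧ ∀ C ∈ Ps, ∀ C' ∈ Ps, C ≠ C' → ∀ u ∈ C, ∀ v ∈ C', ¬ link u v

/-- Sub-families of families of components are families of components. [cite: Balaban1989LargeFieldII, (1.90) p.388] -/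
theorem IsCompFamily.subset {Ps Ps' : Finset (Finset I)} (h : IsCompFamily link Ps) (h' : Ps' ⊆ Ps) :
    IsCompFamily link Ps' :=
  ⟨fun C hC => h.1 C (h' hC), fun C hC C' hC' hne => h.2 C (h' hC) C' (h' hC') hne⟩

/-- The components of a term form a family of components (symmetric links). [cite: Balaban1989LargeFieldII, (1.90) p.388] -/
theorem isCompFamily_lcomps [DecidableEq I] (hsymm : ∀ x y, link x y → link y x) (T : Finset I) :
    IsCompFamily link (lcomps link T) := by
  refine ⟨fun C hC => ?_, fun C hC C' hC' hne u hu v hv huv => hne ?_⟩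
  · obtain ⟨a, ha, rfl⟩ := mem_lcomps.1 hC
    exact isLConn_lcomp hsymm ha
  · obtain ⟨a, -, rfl⟩ := mem_lcomps.1 hC
    obtain ⟨a', -, rfl⟩ := mem_lcomps.1 hC'
    have huT : u ∈ T := lcomp_subset T a hu
    have hvT : v ∈ T := lcomp_subset T a' hv
    have hv' : v ∈ lcomp link T u := mem_lcomp.2 ⟨hvT, LReach.single huT hvT huv⟩
    rw [← lcomp_eq_of_mem hsymm hu, ← lcomp_eq_of_mem hsymm hv, lcomp_eq_of_mem hsymm hv']

/-- In a family of components, the component (inside the union) of an item of a member is that member.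
[cite: Balaban1989LargeFieldII, (1.90) p.388] -/
theorem IsCompFamily.lcomp_biUnion_eq [DecidableEq I] {Ps : Finset (Finset I)} (h : IsCompFamily link Ps)
    {C : Finset I} (hC : C ∈ Ps) {a : I} (ha : a ∈ C) : lcomp link (Ps.biUnion id) a = C := by
  have hCT : C ⊆ Ps.biUnion id := Finset.subset_biUnion_of_mem id hC
  ext b
  constructor
  · intro hb
    obtain ⟨-, hab⟩ := mem_lcomp.1 hb
    -- every chain from `a` inside the union stays in `C`
    suffices key : ∀ c, LReach link (Ps.biUnion id) a c → c ∈ C from key b hab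
    intro c hac
    induction hac with
    | refl => exact ha
    | @tail x y _ hxy ih =>
      obtain ⟨C', hC', hy⟩ := Finset.mem_biUnion.1 hxy.2.2
      by_contra hyC
      have hne : C ≠ C' := by rintro rfl; exact hyC hy
      exact h.2 C hC C' hC' hne x ih y hy hxy.1
  · intro hb
    exact mem_lcomp.2 ⟨hCT hb, ((h.1 C hC).2 a ha b hb).mono hCT⟩

/-- Distinct members of a family of components are disjoint. [cite: Balaban1989LargeFieldII, (1.90) p.388] -/
theorem IsCompFamily.disjoint [DecidableEq I] {Ps : Finset (Finset I)} (h : IsCompFamily link Ps) {C C' : Finset I}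
    (hC : C ∈ Ps) (hC' : C' ∈ Ps) (hne : C ≠ C') : Disjoint C C' := by
  rw [Finset.disjoint_left]
  intro a ha ha'
  exact hne ((h.lcomp_biUnion_eq hC ha).symm.trans (h.lcomp_biUnion_eq hC' ha'))

/-- **Inverse law**: the components of the union of a family of components are its members (the decomposition
`X′₀ = ⋃_p X′_p` is recovered from `{X′_p}`). [cite: Balaban1989LargeFieldII, (1.90) p.388] -/
theorem IsCompFamily.lcomps_biUnion [DecidableEq I] {Ps : Finset (Finset I)} (h : IsCompFamily link Ps) :
    lcomps link (Ps.biUnion id) = Ps := by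
  ext C
  rw [mem_lcomps]
  constructor
  · rintro ⟨a, ha, rfl⟩
    obtain ⟨C, hC, haC⟩ := Finset.mem_biUnion.1 ha
    rw [h.lcomp_biUnion_eq hC haC]
    exact hC
  · intro hC
    obtain ⟨a, ha⟩ := (h.1 C hC).1
    exact ⟨a, Finset.mem_biUnion.2 ⟨C, hC, ha⟩, h.lcomp_biUnion_eq hC ha⟩

/-! ### «the expression corresponding to X′₀ factorizes in the components» -/

variable {R : Type*} [CommSemiring R]

variable (link) in
/-- **The factorization clause** p. 388, verbatim: *"the expression corresponding to X′₀ factorizes in the components"* —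
as the binary multiplicativity of the term functional `W` over disjoint, mutually UNLINKED families of items (the shape of
`B13Factor210.ActMul`; in print it is the locality of the integral operations 𝐓′_k of (1.71) and of the factors
`V(Y)e^{t(Y)V(Y)}`, not asserted here).  A DEFINITION of a property of `W`, used as a hypothesis. [cite: Balaban1989LargeFieldII, (1.90) p.388] -/
def LinkMul [DecidableEq I] (W : Finset I → R) : Prop :=
  ∀ S T : Finset I, Disjoint S T → (∀ u ∈ S, ∀ v ∈ T, ¬ link u v) → W (S ∪ T) = W S * W T

/-- The factorization over a whole family of components: `W(⋃_p C_p) = Π_p W(C_p)`. [cite: Balaban1989LargeFieldII, (1.90) p.388] -/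
theorem IsCompFamily.apply_biUnion [DecidableEq I] {W : Finset I → R} (h0 : W ∅ = 1) (hmul : LinkMul link W)
    {Ps : Finset (Finset I)} (h : IsCompFamily link Ps) : W (Ps.biUnion id) = ∏ C ∈ Ps, W C := by
  induction Ps using Finset.induction_on with
  | empty => simpa using h0
  | insert C Ps hCPs ih =>
    have h' : IsCompFamily link Ps := h.subset (Finset.subset_insert C Ps)
    rw [Finset.biUnion_insert, Finset.prod_insert hCPs, ← ih h', id_eq]
    refine hmul C (Ps.biUnion id) ?_ ?_
    · rw [Finset.disjoint_biUnion_right]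
      intro C' hC'
      have hne : C ≠ C' := by rintro rfl; exact hCPs hC'
      exact h.disjoint (Finset.mem_insert_self C Ps) (Finset.mem_insert_of_mem hC') hne
    · intro u hu v hv
      obtain ⟨C', hC', hv'⟩ := Finset.mem_biUnion.1 hv
      have hne : C ≠ C' := by rintro rfl; exact hCPs hC'
      exact h.2 C (Finset.mem_insert_self C Ps) C' (Finset.mem_insert_of_mem hC') hne u hu v hv'

/-- **(2.10)-type factorization over the components of a term**: `W(T) = Π_{C ∈ components of T} W(C)`.
[cite: Balaban1989LargeFieldII, (1.90) p.388] -/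
theorem prod_lcomps [DecidableEq I] (hsymm : ∀ x y, link x y → link y x) {W : Finset I → R} (h0 : W ∅ = 1)
    (hmul : LinkMul link W) (T : Finset I) : W T = ∏ C ∈ lcomps link T, W C := by
  rw [← (isCompFamily_lcomps hsymm T).apply_biUnion h0 hmul, biUnion_lcomps]

/-- Sanity / the independent case: a weight that is a PRODUCT over the items (no operations coupling them, e.g. the pure
Mayer factors `Π_{Y∈𝐃}(e^{V(Y)} − 1)` before any integration) factorizes over ANY two disjoint families, hence satisfies
`LinkMul` for every link relation — the hypothesis is not vacuous. [cite: Balaban1989LargeFieldII, (1.90) p.388] -/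
theorem linkMul_prod [DecidableEq I] (a : I → R) : LinkMul link (fun T => ∏ u ∈ T, a u) := by
  intro S T hST _
  dsimp only
  rw [Finset.prod_union hST]

variable (link) in
open Classical in
/-- The families of components inside the finite item catalogue. [cite: Balaban1989LargeFieldII, (1.90) p.388] -/
noncomputable def compFamilies [Fintype I] [DecidableEq I] : Finset (Finset (Finset I)) :=
  Finset.univ.filter (IsCompFamily link)

/-- Membership in `compFamilies`. [cite: Balaban1989LargeFieldII, (1.90) p.388] -/
theorem mem_compFamilies [Fintype I] [DecidableEq I] {Ps : Finset (Finset I)} :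
    Ps ∈ compFamilies link ↔ IsCompFamily link Ps := by
  classical
  simp [compFamilies]

/-- **The resummation over item families as a sum over families of components**: `Σ_T W(T) = Σ_{Ps} Π_{C∈Ps} W(C)`, the
sum over all families `Ps` of pairwise unlinked components — the bijection `T ↦ {components of T}`, inverse `⋃`
(*"For the fixed decomposition we resum all the expressions determining the same components"*, item level).
[cite: Balaban1989LargeFieldII, (1.90) p.388] -/
theorem sum_eq_sum_compFamilies [Fintype I] [DecidableEq I] (hsymm : ∀ x y, link x y → link y x) {W : Finset I → R}
    (h0 : W ∅ = 1) (hmul : LinkMul link W) :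
    ∑ T : Finset I, W T = ∑ Ps ∈ compFamilies link, ∏ C ∈ Ps, W C := by
  refine Finset.sum_nbij' (lcomps link) (fun Ps => Ps.biUnion id) (fun T _ => ?_) (fun _ _ => Finset.mem_univ _)
    (fun T _ => biUnion_lcomps T) (fun Ps hPs => (mem_compFamilies.1 hPs).lcomps_biUnion) (fun T _ => ?_)
  · exact mem_compFamilies.2 (isCompFamily_lcomps hsymm T)
  · exact prod_lcomps hsymm h0 hmul T

end Components

/-! ## Part B. Footprints: the modified connectedness and the polymers X′ -/

section Footprints

variable {Cube : Type*} {adjC : Cube → Cube → Prop}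

variable (adjC) in
/-- Two families of cubes TOUCH: a cube of one is equal to or shares a wall with a cube of the other (`adjC`) — print's
*"ordinary notion of connectedness"* of unions of M-cubes (p. 391) / [II] (2.11) *"contains a cube, or a wall of a cube"*.
[cite: Balaban1989LargeFieldII, (1.90) p.388] -/
def Touch (A B : Finset Cube) : Prop := ∃ a ∈ A, ∃ b ∈ B, adjC a b

variable (adjC) in
/-- `Touch` is decidable on finite families. [cite: Balaban1989LargeFieldII, (1.90) p.388] -/
instance instDecidableTouch [DecidableRel adjC] (A B : Finset Cube) : Decidable (Touch adjC A B) :=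
  inferInstanceAs (Decidable (∃ a ∈ A, ∃ b ∈ B, adjC a b))

/-- Touching is symmetric for a symmetric cube adjacency. [cite: Balaban1989LargeFieldII, (1.90) p.388] -/
theorem Touch.symm (hsymm : ∀ a b, adjC a b → adjC b a) {A B : Finset Cube} (h : Touch adjC A B) : Touch adjC B A := by
  obtain ⟨a, ha, b, hb, hab⟩ := h
  exact ⟨b, hb, a, ha, hsymm a b hab⟩

/-- A non-empty family touches itself (reflexive adjacency). [cite: Balaban1989LargeFieldII, (1.90) p.388] -/
theorem touch_self_of_nonempty (hrefl : ∀ a, adjC a a) {A : Finset Cube} (hA : A.Nonempty) : Touch adjC A A := by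
  obtain ⟨a, ha⟩ := hA
  exact ⟨a, ha, a, ha, hrefl a⟩

/-- Touching distributes over unions (left). [cite: Balaban1989LargeFieldII, (1.90) p.388] -/
theorem touch_biUnion_left [DecidableEq Cube] {κ : Type*} {s : Finset κ} {f : κ → Finset Cube} {B : Finset Cube} :
    Touch adjC (s.biUnion f) B ↔ ∃ i ∈ s, Touch adjC (f i) B := by
  constructor
  · rintro ⟨a, ha, b, hb, hab⟩
    obtain ⟨i, hi, hai⟩ := Finset.mem_biUnion.1 ha
    exact ⟨i, hi, a, hai, b, hb, hab⟩
  · rintro ⟨i, hi, a, ha, b, hb, hab⟩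
    exact ⟨a, Finset.mem_biUnion.2 ⟨i, hi, ha⟩, b, hb, hab⟩

/-- Touching distributes over unions (right). [cite: Balaban1989LargeFieldII, (1.90) p.388] -/
theorem touch_biUnion_right [DecidableEq Cube] {κ : Type*} {s : Finset κ} {f : κ → Finset Cube} {A : Finset Cube} :
    Touch adjC A (s.biUnion f) ↔ ∃ i ∈ s, Touch adjC A (f i) := by
  constructor
  · rintro ⟨a, ha, b, hb, hab⟩
    obtain ⟨i, hi, hbi⟩ := Finset.mem_biUnion.1 hb
    exact ⟨i, hi, a, ha, b, hbi, hab⟩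
  · rintro ⟨i, hi, a, ha, b, hb, hab⟩
    exact ⟨a, ha, b, Finset.mem_biUnion.2 ⟨i, hi, hb⟩, hab⟩

variable [DecidableEq Cube] {I : Type*} {loc : I → Finset Cube} {Yfix : Finset Cube}

variable (loc Yfix) in
/-- The part of an item's localization domain OUTSIDE the fixed regions ⋃_{i=1}^m Y_i (*"components of X′₀∖⋃_{i=1}^m Y_i"*).
[cite: Balaban1989LargeFieldII, (1.90) p.388] -/
def out (u : I) : Finset Cube := loc u \ Yfix

variable (adjC loc Yfix) in
/-- **The modified connectedness at item level**: two items of a term are LINKED iff their parts outside ⋃Y_i touch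
(*"At first we take components of X′₀∖⋃Y_i, and we consider two such components as connected, if they are contained in
one localization domain Y of a term in the product"* — an ordinary step inside X′₀∖⋃Y_i joins the outside parts of two
items, and the pieces of one item's outside part are glued). [cite: Balaban1989LargeFieldII, (1.90) p.388] -/
def olink (u v : I) : Prop := Touch adjC (out loc Yfix u) (out loc Yfix v)

variable (adjC loc Yfix) in
/-- The link relation is decidable. [cite: Balaban1989LargeFieldII, (1.90) p.388] -/
instance instDecidableRelOlink [DecidableRel adjC] : DecidableRel (olink adjC loc Yfix) :=
  fun u v => inferInstanceAs (Decidable (Touch adjC (out loc Yfix u) (out loc Yfix v)))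

variable (loc) in
/-- The localization domain of a family of items: `X′₀ = ⋃_{Y∈𝐃} Y ∪ ⋃_j X_j` (p. 387), and for one component its polymer
`X′_p`. [cite: Balaban1989LargeFieldII, (1.90) p.388] -/
def fp (T : Finset I) : Finset Cube := T.biUnion loc

variable (adjC Yfix) in
/-- **The incompatibility of the polymers of (1.90)**: the parts outside ⋃Y_i touch (= the `ι` of `B16Exp198.Geometry`:
*"two polymers are incompatible iff their parts OUTSIDE ⋃_i Y_i meet; polymers attached to the same FIXED Y_i are
compatible"*). [cite: Balaban1989LargeFieldII, (1.90) p.388] -/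
def pinc (X X' : Finset Cube) : Prop := Touch adjC (X \ Yfix) (X' \ Yfix)

variable (adjC Yfix) in
/-- The incompatibility is decidable. [cite: Balaban1989LargeFieldII, (1.90) p.388] -/
instance instDecidableRelPinc [DecidableRel adjC] : DecidableRel (pinc adjC Yfix) :=
  fun X X' => inferInstanceAs (Decidable (Touch adjC (X \ Yfix) (X' \ Yfix)))

/-- The link relation is symmetric. [cite: Balaban1989LargeFieldII, (1.90) p.388] -/
theorem olink_symm (hsymm : ∀ a b, adjC a b → adjC b a) (u v : I) (h : olink adjC loc Yfix u v) :
    olink adjC loc Yfix v u :=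
  Touch.symm hsymm h

/-- The incompatibility is symmetric. [cite: Balaban1989LargeFieldII, (1.90) p.388] -/
theorem pinc_symm (hsymm : ∀ a b, adjC a b → adjC b a) (X X' : Finset Cube) (h : pinc adjC Yfix X X') :
    pinc adjC Yfix X' X :=
  Touch.symm hsymm h

/-- The outside part of a localization domain is the union of the outside parts of its items.
[cite: Balaban1989LargeFieldII, (1.90) p.388] -/
theorem fp_sdiff (T : Finset I) : fp loc T \ Yfix = T.biUnion (out loc Yfix) := by
  ext c
  simp only [fp, out, Finset.mem_sdiff, Finset.mem_biUnion]
  constructor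
  · rintro ⟨⟨u, hu, hc⟩, hcY⟩
    exact ⟨u, hu, hc, hcY⟩
  · rintro ⟨u, hu, hc, hcY⟩
    exact ⟨⟨u, hu, hc⟩, hcY⟩

/-- **Polymers of two item families are incompatible iff some item of one is linked to some item of the other** (touching
distributes over unions) — so distinct components give COMPATIBLE polymers and conversely.
[cite: Balaban1989LargeFieldII, (1.90) p.388] -/
theorem pinc_fp_iff (C C' : Finset I) :
    pinc adjC Yfix (fp loc C) (fp loc C') ↔ ∃ u ∈ C, ∃ v ∈ C', olink adjC loc Yfix u v := by
  unfold pinc olink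
  rw [fp_sdiff, fp_sdiff, touch_biUnion_left]
  simp only [touch_biUnion_right]

/-- Every item owns a cube outside ⋃Y_i ⇒ every item is linked to itself (`B16Exp198.Geometry.out_nonempty`, `ι_refl`).
[cite: Balaban1989LargeFieldII, (1.90) p.388] -/
theorem olink_refl (hrefl : ∀ a, adjC a a) (hout : ∀ u, (out loc Yfix u).Nonempty) (u : I) :
    olink adjC loc Yfix u u :=
  touch_self_of_nonempty hrefl (hout u)

/-- A non-empty item family has a polymer incompatible with itself. [cite: Balaban1989LargeFieldII, (1.90) p.388] -/
theorem pinc_fp_self (hrefl : ∀ a, adjC a a) (hout : ∀ u, (out loc Yfix u).Nonempty) {C : Finset I}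
    (hC : C.Nonempty) : pinc adjC Yfix (fp loc C) (fp loc C) := by
  obtain ⟨u, hu⟩ := hC
  exact (pinc_fp_iff C C).2 ⟨u, hu, u, hu, olink_refl hrefl hout u⟩

variable (adjC loc Yfix)

open Classical in
/-- The item families forming ONE component (the candidates for the index set of (1.91)). [cite: Balaban1989LargeFieldII, (1.91) p.388] -/
noncomputable def conn [Fintype I] [DecidableEq I] : Finset (Finset I) :=
  Finset.univ.filter (IsLConn (olink adjC loc Yfix))

/-- The polymers of (1.90): the localization domains of the connected item families (the `adm` of `B16Exp198.Geometry`).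
[cite: Balaban1989LargeFieldII, (1.90) p.388] -/
noncomputable def polys [Fintype I] [DecidableEq I] : Finset (Finset Cube) :=
  (conn adjC loc Yfix).image (fp loc)

/-- The connected item families with a given polymer: the index set of (1.91), *"{X_{j₁},…,X_{j_q}} and 𝐃 such that the
connected localization domain they determine is equal to X′"*. [cite: Balaban1989LargeFieldII, (1.91) p.388] -/
noncomputable def fibC [Fintype I] [DecidableEq I] (X : Finset Cube) : Finset (Finset I) :=
  (conn adjC loc Yfix).filter fun C => fp loc C = X

/-- **The activity of a polymer, (1.91) at the abstract level**: `F(X′) = Σ_{T : one component, locDom T = X′} W(T)`.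
[cite: Balaban1989LargeFieldII, (1.91) p.388] -/
noncomputable def F [Fintype I] [DecidableEq I] (W : Finset I → ℂ) (X : Finset Cube) : ℂ :=
  ∑ C ∈ fibC adjC loc Yfix X, W C

variable {adjC loc Yfix}

/-- Membership in `conn`. [cite: Balaban1989LargeFieldII, (1.91) p.388] -/
theorem mem_conn [Fintype I] [DecidableEq I] {C : Finset I} :
    C ∈ conn adjC loc Yfix ↔ IsLConn (olink adjC loc Yfix) C := by
  classical
  simp [conn]

/-- Membership in the index set of (1.91). [cite: Balaban1989LargeFieldII, (1.91) p.388] -/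
theorem mem_fibC [Fintype I] [DecidableEq I] {X : Finset Cube} {C : Finset I} :
    C ∈ fibC adjC loc Yfix X ↔ IsLConn (olink adjC loc Yfix) C ∧ fp loc C = X := by
  simp [fibC, mem_conn]

/-- `F` as a sum over the index set. [cite: Balaban1989LargeFieldII, (1.91) p.388] -/
theorem F_eq_sum_fibC [Fintype I] [DecidableEq I] (W : Finset I → ℂ) (X : Finset Cube) :
    F adjC loc Yfix W X = ∑ C ∈ fibC adjC loc Yfix X, W C := rfl

/-- Membership in the polymer catalogue. [cite: Balaban1989LargeFieldII, (1.90) p.388] -/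
theorem mem_polys [Fintype I] [DecidableEq I] {X : Finset Cube} :
    X ∈ polys adjC loc Yfix ↔ ∃ C : Finset I, IsLConn (olink adjC loc Yfix) C ∧ fp loc C = X := by
  simp [polys, mem_conn]

/-- Every polymer of the catalogue is incompatible with itself (the `ι_refl` of `B16Exp198.Geometry` on `adm`): it is the
footprint of a non-empty item family, every item owning a cube outside ⋃Y_i. [cite: Balaban1989LargeFieldII, (1.90) p.388] -/
theorem pinc_refl_of_mem_polys [Fintype I] [DecidableEq I] (hrefl : ∀ a, adjC a a)
    (hout : ∀ u, (out loc Yfix u).Nonempty) {X : Finset Cube} (hX : X ∈ polys adjC loc Yfix) : pinc adjC Yfix X X := by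
  obtain ⟨C, hC, rfl⟩ := mem_polys.1 hX
  exact pinc_fp_self hrefl hout hC.1

/-- The family of polymers of a family of components is compatible and lies in the catalogue.
[cite: Balaban1989LargeFieldII, (1.90) p.388] -/
theorem image_fp_mem [Fintype I] [DecidableEq I] [DecidableRel adjC] {Ps : Finset (Finset I)}
    (h : IsCompFamily (olink adjC loc Yfix) Ps) :
    Ps.image (fp loc) ∈ (polys adjC loc Yfix).powerset.filter (IsCompatible (pinc adjC Yfix)) := by
  refine Finset.mem_filter.2 ⟨Finset.mem_powerset.2 fun X hX => ?_, ?_⟩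
  · obtain ⟨C, hC, rfl⟩ := Finset.mem_image.1 hX
    exact mem_polys.2 ⟨C, h.1 C hC, rfl⟩
  · intro X hX X' hX' hne hinc
    obtain ⟨C, hC, rfl⟩ := Finset.mem_image.1 (Finset.mem_coe.1 hX)
    obtain ⟨C', hC', rfl⟩ := Finset.mem_image.1 (Finset.mem_coe.1 hX')
    have hCC' : C ≠ C' := by rintro rfl; exact hne rfl
    obtain ⟨u, hu, v, hv, huv⟩ := (pinc_fp_iff C C').1 hinc
    exact h.2 C hC C' hC' hCC' u hu v hv huv

/-- In a family of components the polymer map is injective (a connected family is incompatible with itself).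
[cite: Balaban1989LargeFieldII, (1.90) p.388] -/
theorem IsCompFamily.fp_injOn (hrefl : ∀ a, adjC a a) (hout : ∀ u, (out loc Yfix u).Nonempty)
    {Ps : Finset (Finset I)} (h : IsCompFamily (olink adjC loc Yfix) Ps) {C C' : Finset I} (hC : C ∈ Ps)
    (hC' : C' ∈ Ps) (heq : fp loc C = fp loc C') : C = C' := by
  by_contra hne
  have hinc : pinc adjC Yfix (fp loc C) (fp loc C') := by
    rw [← heq]; exact pinc_fp_self hrefl hout (h.1 C hC).1
  obtain ⟨u, hu, v, hv, huv⟩ := (pinc_fp_iff C C').1 hinc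
  exact h.2 C hC C' hC' hne u hu v hv huv

/-- **The resummation at fixed polymers** (*"For the fixed decomposition we resum all the expressions determining the same
components"*): for a compatible family `Qs` of polymers, the families of components with polymer family `Qs` contribute
`Π_{X′∈Qs} F(X′)`. [cite: Balaban1989LargeFieldII, (1.90) p.388] -/
theorem sum_fiber_eq_prod_F [Fintype I] [DecidableEq I] (hrefl : ∀ a, adjC a a) (hsymm : ∀ a b, adjC a b → adjC b a)
    (hout : ∀ u, (out loc Yfix u).Nonempty) (W : Finset I → ℂ) (Qs : Finset (Finset Cube))
    (hQs : IsCompatible (pinc adjC Yfix) Qs) :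
    ∑ Ps ∈ (compFamilies (olink adjC loc Yfix)).filter (fun Ps => Ps.image (fp loc) = Qs), ∏ C ∈ Ps, W C
      = ∏ X ∈ Qs, F adjC loc Yfix W X := by
  induction Qs using Finset.induction_on with
  | empty =>
    have hfib : (compFamilies (olink adjC loc Yfix)).filter (fun Ps : Finset (Finset I) => Ps.image (fp loc) = ∅)
        = {∅} := by
      ext Ps
      simp only [Finset.mem_filter, mem_compFamilies, Finset.image_eq_empty, Finset.mem_singleton]
      constructor
      · exact fun h => h.2
      · rintro rfl
        exact ⟨⟨fun C hC => (Finset.notMem_empty C hC).elim, fun C hC => (Finset.notMem_empty C hC).elim⟩, rfl⟩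
    rw [hfib, Finset.sum_singleton, Finset.prod_empty, Finset.prod_empty]
  | insert X₀ Qs hX₀ ih =>
    have hQs' : IsCompatible (pinc adjC Yfix) Qs := hQs.mono (Finset.subset_insert X₀ Qs)
    rw [Finset.prod_insert hX₀, ← ih hQs', F_eq_sum_fibC, Finset.sum_mul_sum, ← Finset.sum_product']
    symm
    -- the bijection (C₀, Ps′) ↦ insert C₀ Ps′
    refine Finset.sum_bij (fun p _ => insert p.1 p.2) ?_ ?_ ?_ ?_
    · -- lands in the fiber over `insert X₀ Qs`
      rintro ⟨C₀, Ps'⟩ hp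
      dsimp only
      obtain ⟨hC₀, hPs'⟩ := Finset.mem_product.1 hp
      obtain ⟨hC₀conn, hC₀fp⟩ := mem_fibC.1 hC₀
      obtain ⟨hPs'fam, hPs'im⟩ := Finset.mem_filter.1 hPs'
      rw [mem_compFamilies] at hPs'fam
      refine Finset.mem_filter.2 ⟨mem_compFamilies.2 ⟨?_, ?_⟩, ?_⟩
      · intro C hC
        obtain rfl | hC1 := Finset.mem_insert.1 hC
        · exact hC₀conn
        · exact hPs'fam.1 C hC1
      · -- no link between C₀ and a member of Ps′: their polymers are compatible
        have key : ∀ C ∈ Ps', ∀ u ∈ C₀, ∀ v ∈ C, ¬ olink adjC loc Yfix u v := by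
          intro C hC u hu v hv huv
          have hfpC : fp loc C ∈ Qs := by rw [← hPs'im]; exact Finset.mem_image_of_mem _ hC
          have hne : X₀ ≠ fp loc C := by rintro rfl; exact hX₀ hfpC
          have := hQs (Finset.mem_coe.2 (Finset.mem_insert_self X₀ Qs))
            (Finset.mem_coe.2 (Finset.mem_insert_of_mem hfpC)) hne
          exact this (hC₀fp ▸ (pinc_fp_iff C₀ C).2 ⟨u, hu, v, hv, huv⟩)
        intro C hC C' hC' hne u hu v hv huv
        obtain rfl | hC1 := Finset.mem_insert.1 hC
        · obtain rfl | hC'1 := Finset.mem_insert.1 hC'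
          · exact hne rfl
          · exact key C' hC'1 u hu v hv huv
        · obtain rfl | hC'1 := Finset.mem_insert.1 hC'
          · exact key C hC1 v hv u hu (olink_symm hsymm u v huv)
          · exact hPs'fam.2 C hC1 C' hC'1 hne u hu v hv huv
      · rw [Finset.image_insert, hC₀fp, hPs'im]
    · -- injective
      rintro ⟨C₀, Ps'⟩ hp ⟨C₁, Ps''⟩ hq heq
      dsimp only at heq
      obtain ⟨hC₀, hPs'⟩ := Finset.mem_product.1 hp
      obtain ⟨hC₁, hPs''⟩ := Finset.mem_product.1 hq
      have hC₀fp := (mem_fibC.1 hC₀).2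
      have hPs'im := (Finset.mem_filter.1 hPs').2
      have hPs''im := (Finset.mem_filter.1 hPs'').2
      have hC₀Ps'' : C₀ ∉ Ps'' := fun h => hX₀ (by
        rw [← hPs''im, ← hC₀fp]; exact Finset.mem_image_of_mem _ h)
      have hC₀Ps' : C₀ ∉ Ps' := fun h => hX₀ (by
        rw [← hPs'im, ← hC₀fp]; exact Finset.mem_image_of_mem _ h)
      have h01 : C₀ = C₁ := by
        have : C₀ ∈ insert C₁ Ps'' := heq ▸ Finset.mem_insert_self C₀ Ps'
        rcases Finset.mem_insert.1 this with h | h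
        · exact h
        · exact (hC₀Ps'' h).elim
      subst h01
      have : Ps' = Ps'' := by
        rw [← Finset.erase_insert hC₀Ps', heq, Finset.erase_insert hC₀Ps'']
      rw [this]
    · -- surjective
      intro Ps hPs
      obtain ⟨hPsfam, hPsim⟩ := Finset.mem_filter.1 hPs
      rw [mem_compFamilies] at hPsfam
      have hX₀im : X₀ ∈ Ps.image (fp loc) := by rw [hPsim]; exact Finset.mem_insert_self X₀ Qs
      obtain ⟨C₀, hC₀, hC₀fp⟩ := Finset.mem_image.1 hX₀im
      refine ⟨(C₀, Ps.erase C₀), Finset.mem_product.2 ⟨mem_fibC.2 ⟨hPsfam.1 C₀ hC₀, hC₀fp⟩,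
        Finset.mem_filter.2 ⟨mem_compFamilies.2 (hPsfam.subset (Finset.erase_subset C₀ Ps)), ?_⟩⟩,
        Finset.insert_erase hC₀⟩
      -- the image of the rest is `Qs`: no other member has the polymer `X₀`
      have himg : (Ps.erase C₀).image (fp loc) = (Ps.image (fp loc)).erase X₀ := by
        ext X
        simp only [Finset.mem_image, Finset.mem_erase]
        constructor
        · rintro ⟨C, ⟨hCne, hC⟩, rfl⟩
          refine ⟨fun h => hCne (hPsfam.fp_injOn hrefl hout hC hC₀ (h.trans hC₀fp.symm)), C, hC, rfl⟩
        · rintro ⟨hXne, C, hC, rfl⟩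
          exact ⟨C, ⟨fun h => hXne (h ▸ hC₀fp), hC⟩, rfl⟩
      rw [himg, hPsim, Finset.erase_insert hX₀]
    · -- the summand
      rintro ⟨C₀, Ps'⟩ hp
      obtain ⟨hC₀, hPs'⟩ := Finset.mem_product.1 hp
      have hC₀fp := (mem_fibC.1 hC₀).2
      have hPs'im := (Finset.mem_filter.1 hPs').2
      have hC₀Ps' : C₀ ∉ Ps' := fun h => hX₀ (by
        rw [← hPs'im, ← hC₀fp]; exact Finset.mem_image_of_mem _ h)
      dsimp only
      rw [Finset.prod_insert hC₀Ps']

/-- **(1.90) at the abstract level — the component resummation**: for a term functional `W` on item families with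
`W(∅) = 1` that *"factorizes in the components"* (`LinkMul` for the modified connectedness), every item owning a cube outside
⋃Y_i, and a reflexive symmetric cube adjacency,
`Σ_T W(T) = Σ_{{X′₁,…,X′_r} compatible} Π_p F(X′_p)` = the partition function of the polymer gas of `B16Exp198` with the
activities (1.91). [cite: Balaban1989LargeFieldII, (1.90) p.388] -/
theorem sum_eq_polymerPartitionFunction [Fintype I] [DecidableEq I] [DecidableRel adjC] (hrefl : ∀ a, adjC a a)
    (hsymm : ∀ a b, adjC a b → adjC b a) (hout : ∀ u, (out loc Yfix u).Nonempty) {W : Finset I → ℂ} (h0 : W ∅ = 1)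
    (hmul : LinkMul (olink adjC loc Yfix) W) :
    ∑ T : Finset I, W T = polymerPartitionFunction (pinc adjC Yfix) (F adjC loc Yfix W) (polys adjC loc Yfix) := by
  rw [sum_eq_sum_compFamilies (olink_symm hsymm) h0 hmul, polymerPartitionFunction_eq_sum_filter,
    ← Finset.sum_fiberwise_of_maps_to (g := fun Ps : Finset (Finset I) => Ps.image (fp loc))
      (t := (polys adjC loc Yfix).powerset.filter (IsCompatible (pinc adjC Yfix)))
      (fun Ps hPs => image_fp_mem (mem_compFamilies.1 hPs))]
  refine Finset.sum_congr rfl fun Qs hQs => ?_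
  exact sum_fiber_eq_prod_F hrefl hsymm hout W Qs (Finset.mem_filter.1 hQs).2

/-- The printed shape of the right-hand side of (1.90): `Ξ = 1 + Σ_{r≥1} Σ_{{X′₁,…,X′_r}} Π_{p=1}^r F(X′_p)`, the sum over the
NON-EMPTY compatible families (the leading `1`, cf. `B16Sect1Kernels.exp_sum_eq_one_add`). [cite: Balaban1989LargeFieldII, (1.90) p.388] -/
theorem polymerPartitionFunction_eq_one_add {P : Type*} [DecidableEq P] (inc : P → P → Prop) [DecidableRel inc]
    (z : P → ℂ) (Λ : Finset P) :
    polymerPartitionFunction inc z Λ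
      = 1 + ∑ A ∈ (Λ.powerset.erase ∅).filter (IsCompatible inc), ∏ γ ∈ A, z γ := by
  rw [polymerPartitionFunction_eq_sum_filter]
  have hmem : (∅ : Finset P) ∈ Λ.powerset.filter (IsCompatible inc) :=
    Finset.mem_filter.2 ⟨Finset.empty_mem_powerset Λ, Literature.Probability.LatticeModels.isCompatible_empty⟩
  rw [← Finset.add_sum_erase _ _ hmem, Finset.prod_empty, ← Finset.filter_erase]

end Footprints

/-! ## Part C. The printed reading: terms indexed by `({X_{j₁},…,X_{j_q}}, 𝐃)`, (1.91) as a definition, (1.90) -/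

section Printed

variable {LF DomY Cube : Type*} [DecidableEq Cube] {adjC : Cube → Cube → Prop}
  {locX : LF → Finset Cube} {locY : DomY → Finset Cube} {Yfix : Finset Cube}

variable (locX locY) in
/-- The footprint of an item of a term: an operation domain `X_j` or a localization domain `Y ∈ 𝐃`, on the one item type
`LF ⊕ DomY`. [cite: Balaban1989LargeFieldII, (1.91) p.388] -/
def locI : LF ⊕ DomY → Finset Cube := Sum.elim locX locY

/-- The items of the term `({X_j}_{j∈S}, 𝐃)`. [cite: Balaban1989LargeFieldII, (1.91) p.388] -/
def items (S : Finset LF) (D : Finset DomY) : Finset (LF ⊕ DomY) := S.disjSum D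

variable (locX locY) in
/-- **The localization domain a term determines**: `⋃_{Y∈𝐃} Y ∪ ⋃_h X_{j_h}` (p. 387: X′₀; for one component, the polymer X′
of (1.91)). [cite: Balaban1989LargeFieldII, (1.91) p.388] -/
def locDom (S : Finset LF) (D : Finset DomY) : Finset Cube := S.biUnion locX ∪ D.biUnion locY

variable (adjC locX locY Yfix) in
/-- **The index condition of (1.91), as a definition**: the term `({X_{j_h}}, 𝐃)` determines ONE connected localization domain
— its items form one component for the modified connectedness (outside parts glued through touching, print p. 388 ll. 1–2).
[cite: Balaban1989LargeFieldII, (1.91) p.388] -/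
def IsConnTerm (S : Finset LF) (D : Finset DomY) : Prop :=
  IsLConn (olink adjC (locI locX locY) Yfix) (items S D)

variable (adjC locX locY Yfix) in
/-- **«The expression corresponding to X′₀ factorizes in the components»** for the printed two-sorted terms: the term of
`({X_j}_{S₁∪S₂}, 𝐃₁∪𝐃₂)` is the product of the terms of `(S₁, 𝐃₁)` and `(S₂, 𝐃₂)` whenever these are disjoint and no item of
one is linked to an item of the other.  HYPOTHESIS shape (the locality of the 𝐓′_k-operations of (1.71); `B13Factor210.ActMul`).
[cite: Balaban1989LargeFieldII, (1.90) p.388] -/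
def TermMul [DecidableEq LF] [DecidableEq DomY] {R : Type*} [CommSemiring R]
    (term : Finset LF → Finset DomY → R) : Prop :=
  ∀ S₁ D₁ S₂ D₂, Disjoint S₁ S₂ → Disjoint D₁ D₂ →
    (∀ u ∈ items S₁ D₁, ∀ v ∈ items S₂ D₂, ¬ olink adjC (locI locX locY) Yfix u v) →
      term (S₁ ∪ S₂) (D₁ ∪ D₂) = term S₁ D₁ * term S₂ D₂

/-- Sanity / the independent case: a term functional that is a product of one factor per operation domain and one factor per
localization domain satisfies `TermMul` (for every geometry) — the hypothesis is not vacuous; the printed terms are of this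
kind only before the 𝐓′_k-integrations couple the factors inside a component. [cite: Balaban1989LargeFieldII, (1.90) p.388] -/
theorem termMul_prod [DecidableEq LF] [DecidableEq DomY] {R : Type*} [CommSemiring R] (a : LF → R) (b : DomY → R) :
    TermMul adjC locX locY Yfix (fun S D => (∏ j ∈ S, a j) * ∏ Y ∈ D, b Y) := by
  intro S₁ D₁ S₂ D₂ hS hD _
  dsimp only
  rw [Finset.prod_union hS, Finset.prod_union hD]
  ring

variable (adjC locX locY Yfix) in
open Classical in
/-- **(1.91), the activities**: `F(X′) = Σ_q Σ′_{{X_{j₁},…,X_{j_q}}} Σ′_𝐃 term({X_{j_h}}, 𝐃)`, *"the summation is over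
{X_{j₁},…,X_{j_q}} and 𝐃 such that the connected localization domain they determine is equal to X′"* — with the printed
summand `term(S, 𝐃) = Π_{Y∈𝐃}∫₀¹dt(Y) Π_h 𝐓′_k(X_{j_h}) Π_{Y∈𝐃}V(Y) exp Σ_{Y∈𝐃} t(Y)V(Y)` abstract (Part D instantiates it by
the Mayer step). [cite: Balaban1989LargeFieldII, (1.91) p.388] -/
noncomputable def F191 [Fintype LF] [Fintype DomY] [DecidableEq LF] [DecidableEq DomY]
    (term : Finset LF → Finset DomY → ℂ) (X : Finset Cube) : ℂ :=
  ∑ p ∈ (Finset.univ ×ˢ Finset.univ).filter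
      (fun p : Finset LF × Finset DomY => IsConnTerm adjC locX locY Yfix p.1 p.2 ∧ locDom locX locY p.1 p.2 = X),
    term p.1 p.2

variable (adjC locX locY Yfix) in
/-- The polymers `X′` of (1.90): the connected localization domains determined by terms. [cite: Balaban1989LargeFieldII, (1.90) p.388] -/
noncomputable def polys190 [Fintype LF] [Fintype DomY] [DecidableEq LF] [DecidableEq DomY] : Finset (Finset Cube) :=
  polys adjC (locI locX locY) Yfix

/-- The items of a term split back into its two index families. [cite: Balaban1989LargeFieldII, (1.91) p.388] -/
theorem items_toLeft_toRight (T : Finset (LF ⊕ DomY)) : items T.toLeft T.toRight = T :=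
  Finset.toLeft_disjSum_toRight

/-- The localization domain of a term is the footprint of its items. [cite: Balaban1989LargeFieldII, (1.91) p.388] -/
theorem fp_items (S : Finset LF) (D : Finset DomY) : fp (locI locX locY) (items S D) = locDom locX locY S D := by
  ext c
  simp only [fp, items, locDom, locI, Finset.mem_biUnion, Finset.mem_disjSum, Finset.mem_union]
  constructor
  · rintro ⟨u, hu, hc⟩
    rcases hu with ⟨a, ha, rfl⟩ | ⟨b, hb, rfl⟩
    · exact Or.inl ⟨a, ha, hc⟩
    · exact Or.inr ⟨b, hb, hc⟩
  · rintro (⟨a, ha, hc⟩ | ⟨b, hb, hc⟩)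
    · exact ⟨Sum.inl a, Or.inl ⟨a, ha, rfl⟩, hc⟩
    · exact ⟨Sum.inr b, Or.inr ⟨b, hb, rfl⟩, hc⟩

/-- Membership in the polymer catalogue of (1.90), in the printed letters. [cite: Balaban1989LargeFieldII, (1.90) p.388] -/
theorem mem_polys190 [Fintype LF] [Fintype DomY] [DecidableEq LF] [DecidableEq DomY] {X : Finset Cube} :
    X ∈ polys190 adjC locX locY Yfix ↔
      ∃ S : Finset LF, ∃ D : Finset DomY, IsConnTerm adjC locX locY Yfix S D ∧ locDom locX locY S D = X := by
  rw [polys190, mem_polys]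
  constructor
  · rintro ⟨C, hC, rfl⟩
    refine ⟨C.toLeft, C.toRight, ?_, ?_⟩
    · simpa only [IsConnTerm, items_toLeft_toRight] using hC
    · rw [← fp_items, items_toLeft_toRight]
  · rintro ⟨S, D, hconn, rfl⟩
    exact ⟨items S D, hconn, fp_items S D⟩

/-- (1.91) on the one item type: `F` of Part B for the term functional read through `toLeft`/`toRight` is `F191`.
[cite: Balaban1989LargeFieldII, (1.91) p.388] -/
theorem F_eq_F191 [Fintype LF] [Fintype DomY] [DecidableEq LF] [DecidableEq DomY]
    (term : Finset LF → Finset DomY → ℂ) (X : Finset Cube) :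
    F adjC (locI locX locY) Yfix (fun T => term T.toLeft T.toRight) X = F191 adjC locX locY Yfix term X := by
  classical
  unfold F F191
  refine Finset.sum_nbij' (fun C => (C.toLeft, C.toRight)) (fun p => items p.1 p.2) ?_ ?_ ?_ ?_ ?_
  · intro C hC
    obtain ⟨hconn, hfp⟩ := mem_fibC.1 hC
    refine Finset.mem_filter.2 ⟨Finset.mem_product.2 ⟨Finset.mem_univ _, Finset.mem_univ _⟩, ?_, ?_⟩
    · simpa only [IsConnTerm, items_toLeft_toRight] using hconn
    · rw [← fp_items, items_toLeft_toRight, hfp]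
  · rintro ⟨S, D⟩ hp
    obtain ⟨-, hconn, hdom⟩ := Finset.mem_filter.1 hp
    exact mem_fibC.2 ⟨hconn, by rw [fp_items, hdom]⟩
  · intro C _
    exact items_toLeft_toRight C
  · rintro ⟨S, D⟩ _
    simp only [items, Finset.toLeft_disjSum, Finset.toRight_disjSum]
  · intro C _
    rfl

/-- **(1.90) PROVED in the printed letters**: for terms indexed by `({X_j}_{j∈S}, 𝐃)` with `term(∅, ∅) = 1` (the leading
`1`) which *"factorize in the components"* (`TermMul`), every X_j and every Y owning a cube outside ⋃_i Y_i, and a reflexive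
symmetric cube adjacency: `Σ_{{X_j}} Σ_𝐃 term({X_j}, 𝐃) = Σ_{{X′₁,…,X′_r} compatible} Π_p F(X′_p)` with `F` = (1.91) (`F191`)
— the right-hand side being the partition function of the polymer gas of `B16Exp198` (incompatibility `pinc`: outside parts
touch). [cite: Balaban1989LargeFieldII, (1.90) p.388] -/
theorem eq190 [Fintype LF] [Fintype DomY] [DecidableEq LF] [DecidableEq DomY] [DecidableRel adjC]
    (hrefl : ∀ a, adjC a a) (hsymm : ∀ a b, adjC a b → adjC b a) (houtX : ∀ j, (locX j \ Yfix).Nonempty)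
    (houtY : ∀ Y, (locY Y \ Yfix).Nonempty) {term : Finset LF → Finset DomY → ℂ} (h0 : term ∅ ∅ = 1)
    (hmul : TermMul adjC locX locY Yfix term) :
    ∑ S : Finset LF, ∑ D : Finset DomY, term S D
      = polymerPartitionFunction (pinc adjC Yfix) (F191 adjC locX locY Yfix term) (polys190 adjC locX locY Yfix) := by
  classical
  -- the term functional on the one item type
  set W : Finset (LF ⊕ DomY) → ℂ := fun T => term T.toLeft T.toRight with hW
  have hsum : ∑ S : Finset LF, ∑ D : Finset DomY, term S D = ∑ T : Finset (LF ⊕ DomY), W T := by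
    rw [← Fintype.sum_prod_type' (f := fun S D => term S D)]
    exact (Fintype.sum_equiv Finset.sumEquiv.toEquiv W (fun p => term p.1 p.2) fun T => rfl).symm
  have hout : ∀ u : LF ⊕ DomY, (out (locI locX locY) Yfix u).Nonempty := by
    rintro (j | Y)
    · exact houtX j
    · exact houtY Y
  have h0' : W ∅ = 1 := by
    have h1 : (∅ : Finset (LF ⊕ DomY)).toLeft = ∅ := by ext; simp
    have h2 : (∅ : Finset (LF ⊕ DomY)).toRight = ∅ := by ext; simp
    rw [hW]; dsimp only; rw [h1, h2, h0]
  have hmul' : LinkMul (olink adjC (locI locX locY) Yfix) W := by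
    intro T₁ T₂ hdisj hunl
    rw [hW]; dsimp only
    rw [Finset.toLeft_union, Finset.toRight_union]
    refine hmul _ _ _ _ ?_ ?_ ?_
    · rw [Finset.disjoint_left] at hdisj ⊢
      intro a ha₁ ha₂
      exact hdisj (Finset.mem_toLeft.1 ha₁) (Finset.mem_toLeft.1 ha₂)
    · rw [Finset.disjoint_left] at hdisj ⊢
      intro b hb₁ hb₂
      exact hdisj (Finset.mem_toRight.1 hb₁) (Finset.mem_toRight.1 hb₂)
    · intro u hu v hv
      rw [items_toLeft_toRight] at hu hv
      exact hunl u hu v hv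
  rw [hsum, sum_eq_polymerPartitionFunction hrefl hsymm hout h0' hmul', polys190]
  exact Literature.Probability.LatticeModels.polymerPartitionFunction_congr fun X _ => F_eq_F191 term X

end Printed

/-! ## Part D. The Mayer step (7.1) [I] producing the terms, and (1.90) for the curly bracket of (1.72) -/

section Mayer

variable {LF DomY Cube Φ : Type*} [DecidableEq Cube] {adjC : Cube → Cube → Prop}
  {locX : LF → Finset Cube} {locY : DomY → Finset Cube} {Yfix : Finset Cube}

/-- **The curly bracket of (1.72)** p. 379, `{Σ_{n≥0} Σ_{{X₁,…,X_n}} Π_{j=1}^n 𝐓′_k(X_j) exp Σ_Y V(Y, U_k)}`, over an abstract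
carrier: functions of the field configuration `φ : Φ`, the terms `V(Y)` as such functions, and for each family `{X_j}` of
operation domains ONE additive operation `Op {X_j}` on functions (the product `Π_j 𝐓′_k(X_j)` of the commuting integral
operations (1.71); their construction is not reproduced), the whole evaluated at `φ`. [cite: Balaban1989LargeFieldII, (1.72) p.379] -/
noncomputable def bracket [Fintype LF] [Fintype DomY] (Op : Finset LF → (Φ → ℂ) →+ (Φ → ℂ)) (V : DomY → Φ → ℂ)
    (φ : Φ) : ℂ :=
  ∑ S : Finset LF, Op S (fun ψ => Complex.exp (∑ Y : DomY, V Y ψ)) φ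

/-- **The summand of (1.91) for one term `({X_{j_h}}, 𝐃)`**: `Op{X_{j_h}}[Π_{Y∈𝐃} ∫₀¹dt(Y) V(Y) e^{t(Y)V(Y)}]` at `φ` (print:
`Π_{Y∈𝐃}∫₀¹dt(Y) Π_h 𝐓′_k(X_{j_h}) Π_{Y∈𝐃}V(Y) exp Σ_{Y∈𝐃} t(Y)V(Y)`; the interpolation integrals are kept INSIDE the operation —
their exchange with the 𝐓′_k-integrals, as print writes them, is not asserted). [cite: Balaban1989LargeFieldII, (1.91) p.388] -/
noncomputable def mayerTerm (Op : Finset LF → (Φ → ℂ) →+ (Φ → ℂ)) (V : DomY → Φ → ℂ) (φ : Φ) (S : Finset LF)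
    (D : Finset DomY) : ℂ :=
  Op S (fun ψ => ∏ Y ∈ D, ∫ t in (0 : ℝ)..1, Complex.exp ((t : ℂ) * V Y ψ) * V Y ψ) φ

/-- **The Mayer step** (*"The first operation is the Mayer expansion of the exponential, the same as in (7.1) [I]. We obtain
a sum of terms over {X₁,…,X_n} and subfamilies 𝐃 ⊂ 𝐃_k"*): by `B13MayerDecoupling.mayer_expansion_21`
(`exp Σ_Y V(Y) = Σ_𝐃 Π_{Y∈𝐃} ∫₀¹dt e^{tV(Y)}V(Y)`, pointwise in the fields) and the additivity of the operations,
`{⋯} = Σ_{{X_j}} Σ_𝐃 mayerTerm({X_j}, 𝐃)`. [cite: Balaban1989LargeFieldII, (1.90) p.388] -/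
theorem bracket_eq_sum_mayerTerm [Fintype LF] [Fintype DomY] (Op : Finset LF → (Φ → ℂ) →+ (Φ → ℂ))
    (V : DomY → Φ → ℂ) (φ : Φ) :
    bracket Op V φ = ∑ S : Finset LF, ∑ D : Finset DomY, mayerTerm Op V φ S D := by
  classical
  unfold bracket mayerTerm
  refine Finset.sum_congr rfl fun S _ => ?_
  have hfun : (fun ψ => Complex.exp (∑ Y : DomY, V Y ψ))
      = ∑ D : Finset DomY, fun ψ => ∏ Y ∈ D, ∫ t in (0 : ℝ)..1, Complex.exp ((t : ℂ) * V Y ψ) * V Y ψ := by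
    funext ψ
    rw [Finset.sum_apply, B13MayerDecoupling.mayer_expansion_21 (Finset.univ : Finset DomY) (fun Y => V Y ψ),
      Finset.powerset_univ]
  rw [hfun, map_sum, Finset.sum_apply]

/-- **(1.90) for the curly bracket of (1.72)**: if the Mayer terms *"factorize in the components"* (`TermMul`, the locality of
the 𝐓′_k), the empty family of operations acts as the identity, every X_j and every Y owns a cube outside ⋃_i Y_i, and the cube
adjacency is reflexive and symmetric, then `{⋯} = 1 + Σ_{r≥1} Σ_{{X′₁,…,X′_r}} Π_p F(X′_p)` with `F` = (1.91) of the Mayer terms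
— i.e. `{⋯}` IS the polymer partition function exponentiated in `B16Exp198` ((1.97) ⇒ (1.98)). [cite: Balaban1989LargeFieldII, (1.90) p.388] -/
theorem eq190_bracket [Fintype LF] [Fintype DomY] [DecidableEq LF] [DecidableEq DomY] [DecidableRel adjC]
    (hrefl : ∀ a, adjC a a) (hsymm : ∀ a b, adjC a b → adjC b a) (houtX : ∀ j, (locX j \ Yfix).Nonempty)
    (houtY : ∀ Y, (locY Y \ Yfix).Nonempty) (Op : Finset LF → (Φ → ℂ) →+ (Φ → ℂ)) (V : DomY → Φ → ℂ) (φ : Φ)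
    (hOp0 : ∀ f, Op ∅ f = f) (hmul : TermMul adjC locX locY Yfix (mayerTerm Op V φ)) :
    bracket Op V φ = polymerPartitionFunction (pinc adjC Yfix) (F191 adjC locX locY Yfix (mayerTerm Op V φ))
      (polys190 adjC locX locY Yfix) := by
  rw [bracket_eq_sum_mayerTerm]
  refine eq190 hrefl hsymm houtX houtY ?_ hmul
  simp [mayerTerm, hOp0]

end Mayer

/-! ## Part E. (1.72) ⇒ (1.98): the curly bracket exponentiated, «{⋯} = exp 𝐑′^{(k)} = exp Σ_X 𝐑′^{(k)}(X)» (p. 390)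

p. 390, verbatim: *"The estimate (1.97) is sufficient for convergence of the exponentiated cluster expansion, and we have
{⋯} = exp 𝐑′^{(k)} = exp Σ_X 𝐑′^{(k)}(X). (1.98) The summation here is over domains X ∈ 𝐃_k"*.  The sibling `B16Exp198`
proves this for an ABSTRACT polymer gas with two footprints (`exp_sum_locR_eq_Z`: Kotecký–Preiss with the size on the
outside footprint); Parts C–D identify the curly bracket of (1.72) with the partition function of the CONCRETE gas
(`pinc`, `F191`, `polys190`).  This part composes the two: for the gas of (1.90) itself, under the (1.97)-shaped activity
bound `|F(X′)| ≤ c₁ e^{−R d(X′)}` and the relative geometric leaves of `B16Exp198` written for its catalogue ((1.26)_rel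
and the volume bound on the outside footprints `X′∖⋃Y_i`, footprint-local cube adjacency `nbr`), the curly bracket equals
`exp Σ_X 𝐑′^{(k)}(X)` with `𝐑′^{(k)}(X) = B16Exp198.locR` (the X-localized part of log Ξ, (1.99)'s object).  The only new
ingredient is bookkeeping: the Kotecký–Preiss engine is stated for an incompatibility reflexive on the whole type
(`Std.Refl`), and `pinc` is reflexive exactly on the cube families owning a cube outside ⋃Y_i — so we pass to the reflexive
closure `pincR`, which agrees with `pinc` on the catalogue (relabeling invariance `polymerPartitionFunction_image` /
`truncatedWeight_image` of `ClusterExpansion` along the identity). -/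

section Exp198

open Literature.Probability.LatticeModels
open Literature.MathematicalPhysics.QuantumFieldTheory.Balaban1983to89.B13FamilySum (Ineq126 VolBound mem_coveringFamilies)
open Literature.MathematicalPhysics.QuantumFieldTheory.Balaban1983to89.B16Exp198 (locR)

variable {Cube : Type*} [DecidableEq Cube] {adjC : Cube → Cube → Prop} {Yfix : Finset Cube}

variable (adjC Yfix) in
/-- The incompatibility of (1.90) closed reflexively on ALL cube families — the form in which the Kotecký–Preiss engine of
`ClusterExpansion` / `B16Exp198` is stated (`Std.Refl`: a polymer never occurs twice in a compatible family; compatibility of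
a family only constrains DISTINCT members).  On the catalogue of polymers it coincides with `pinc` (`pincR_iff_of_mem`,
`pinc_refl_of_mem_polys`: every polymer owns a cube outside ⋃_i Y_i). [cite: Balaban1989LargeFieldII, (1.90) p.388] -/
def pincR (X X' : Finset Cube) : Prop := pinc adjC Yfix X X' ∨ X = X'

variable (adjC Yfix) in
/-- `pincR` is decidable. [cite: Balaban1989LargeFieldII, (1.90) p.388] -/
instance instDecidableRelPincR [DecidableRel adjC] : DecidableRel (pincR adjC Yfix) :=
  fun X X' => inferInstanceAs (Decidable (pinc adjC Yfix X X' ∨ X = X'))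

variable (adjC Yfix) in
/-- `pincR` is reflexive. [cite: Balaban1989LargeFieldII, (1.90) p.388] -/
instance instReflPincR : Std.Refl (pincR adjC Yfix) := ⟨fun _ => Or.inr rfl⟩

/-- `pincR` is symmetric for a symmetric cube adjacency. [cite: Balaban1989LargeFieldII, (1.90) p.388] -/
theorem pincR_symm (hsymm : ∀ a b, adjC a b → adjC b a) {X X' : Finset Cube} (h : pincR adjC Yfix X X') :
    pincR adjC Yfix X' X := by
  rcases h with h | rfl
  · exact Or.inl (pinc_symm hsymm X X' h)
  · exact Or.inr rfl

/-- On a catalogue on which `pinc` is reflexive the two incompatibilities agree. [cite: Balaban1989LargeFieldII, (1.90) p.388] -/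
theorem pincR_iff_of_mem {Λ : Finset (Finset Cube)} (hΛ : ∀ X ∈ Λ, pinc adjC Yfix X X) {X X' : Finset Cube}
    (hX : X ∈ Λ) : pincR adjC Yfix X X' ↔ pinc adjC Yfix X X' := by
  constructor
  · rintro (h | rfl)
    · exact h
    · exact hΛ X hX
  · exact Or.inl

/-- The partition function of (1.90) is the same for `pinc` and for its reflexive closure (relabeling invariance along the
identity). [cite: Balaban1989LargeFieldII, (1.90) p.388] -/
theorem polymerPartitionFunction_pincR [DecidableRel adjC] {Λ : Finset (Finset Cube)}
    (hΛ : ∀ X ∈ Λ, pinc adjC Yfix X X) (w : Finset Cube → ℂ) :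
    polymerPartitionFunction (pincR adjC Yfix) w Λ = polymerPartitionFunction (pinc adjC Yfix) w Λ := by
  have h := polymerPartitionFunction_image (inc := pinc adjC Yfix) (inc' := pincR adjC Yfix) (φ := id)
    (w := w) (w' := w) (Λ := Λ) (Set.injOn_id _) (fun a ha _ _ => pincR_iff_of_mem hΛ ha) fun _ _ => rfl
  rwa [Finset.image_id] at h

/-- `𝐑′^{(k)}(X)` (`B16Exp198.locR`, the X-localized part of log Ξ) is the same for `pinc` and for its reflexive closure.
[cite: Balaban1989LargeFieldII, (1.98) p.390] -/
theorem locR_pincR [DecidableRel adjC] {Λ : Finset (Finset Cube)} (hΛ : ∀ X ∈ Λ, pinc adjC Yfix X X)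
    (cubes : Finset Cube → Finset Cube) (w : Finset Cube → ℂ) (X : Finset Cube) :
    locR (pincR adjC Yfix) Λ cubes w X = locR (pinc adjC Yfix) Λ cubes w X := by
  unfold B16Exp198.locR
  refine Finset.sum_congr rfl fun C hC => ?_
  have hCΛ : C ⊆ Λ := (mem_coveringFamilies.1 hC).1
  have h := truncatedWeight_image (inc := pinc adjC Yfix) (inc' := pincR adjC Yfix) (φ := id)
    (w := w) (w' := w) (C := C) (Set.injOn_id _) (fun a ha _ _ => pincR_iff_of_mem hΛ (hCΛ ha)) fun _ _ => rfl
  rwa [Finset.image_id] at h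

/-- Footprint locality of the incompatibility (the `hloc` of `B16Exp198.kp_condition_rel`): if the adjacency is generated
by finite cube neighbourhoods `nbr` (`adjC a b → a ∈ nbr b`), a polymer `Z′` of the catalogue incompatible with `Z` owns an
outside cube in the neighbourhood `⋃_{b ∈ Z∖⋃Y_i} nbr b` of the outside part of `Z`. [cite: Balaban1989LargeFieldII, (1.98) p.390] -/
theorem exists_reach_of_pincR (hrefl : ∀ a, adjC a a) {nbr : Cube → Finset Cube} (hnbr : ∀ a b, adjC a b → a ∈ nbr b)
    {Λ : Finset (Finset Cube)} (hΛ : ∀ X ∈ Λ, pinc adjC Yfix X X) (Z Z' : Finset Cube) (hZ' : Z' ∈ Λ)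
    (h : pincR adjC Yfix Z' Z) : ∃ q ∈ (Z \ Yfix).biUnion nbr, q ∈ Z' \ Yfix := by
  rcases h with ⟨a, ha, b, hb, hab⟩ | rfl
  · exact ⟨a, Finset.mem_biUnion.2 ⟨b, hb, hnbr a b hab⟩, ha⟩
  · obtain ⟨b, hb, -⟩ := hΛ Z' hZ'
    exact ⟨b, Finset.mem_biUnion.2 ⟨b, hb, hnbr b b (hrefl b)⟩, hb⟩

/-- The neighbourhood of the outside part has at most `ν·|Z∖⋃Y_i|` cubes when every cube neighbourhood has at most `ν` cubes
(the `hreach` of `B16Exp198.kp_condition_rel`; in the lattice `ν = 3^d`). [cite: Balaban1989LargeFieldII, (1.98) p.390] -/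
theorem card_biUnion_nbr_le {nbr : Cube → Finset Cube} {ν : ℝ} (hν : ∀ b, ((nbr b).card : ℝ) ≤ ν) (A : Finset Cube) :
    (((A.biUnion nbr).card : ℕ) : ℝ) ≤ ν * A.card := by
  calc (((A.biUnion nbr).card : ℕ) : ℝ) ≤ ((∑ b ∈ A, (nbr b).card : ℕ) : ℝ) := by
        exact_mod_cast Finset.card_biUnion_le
    _ = ∑ b ∈ A, ((nbr b).card : ℝ) := by push_cast; rfl
    _ ≤ ∑ b ∈ A, ν := Finset.sum_le_sum fun b _ => hν b
    _ = ν * A.card := by rw [Finset.sum_const, nsmul_eq_mul, mul_comm]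

variable {LF DomY : Type*} {locX : LF → Finset Cube} {locY : DomY → Finset Cube}

/-- The activities (1.91) vanish off the catalogue of polymers (the `hwΛ` of `B16Exp198.exp_sum_locR_eq_Z`).
[cite: Balaban1989LargeFieldII, (1.91) p.388] -/
theorem F191_eq_zero_of_not_mem [Fintype LF] [Fintype DomY] [DecidableEq LF] [DecidableEq DomY]
    (term : Finset LF → Finset DomY → ℂ) {X : Finset Cube} (hX : X ∉ polys190 adjC locX locY Yfix) :
    F191 adjC locX locY Yfix term X = 0 := by
  classical
  unfold F191
  refine Finset.sum_eq_zero fun p hp => ?_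
  exact absurd (mem_polys190.2 ⟨p.1, p.2, (Finset.mem_filter.1 hp).2.1, (Finset.mem_filter.1 hp).2.2⟩) hX

/-- Every polymer of (1.90) is incompatible with itself: it owns a cube outside ⋃_i Y_i (every X_j and every Y does).
[cite: Balaban1989LargeFieldII, (1.90) p.388] -/
theorem pinc_refl_of_mem_polys190 [Fintype LF] [Fintype DomY] [DecidableEq LF] [DecidableEq DomY]
    (hrefl : ∀ a, adjC a a) (houtX : ∀ j, (locX j \ Yfix).Nonempty) (houtY : ∀ Y, (locY Y \ Yfix).Nonempty)
    {X : Finset Cube} (hX : X ∈ polys190 adjC locX locY Yfix) : pinc adjC Yfix X X := by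
  refine pinc_refl_of_mem_polys hrefl ?_ hX
  rintro (j | Y)
  · exact houtX j
  · exact houtY Y

/-- **(1.90) exponentiated, = (1.98) for the gas of (1.90)** (p. 390: *"The estimate (1.97) is sufficient for convergence of
the exponentiated cluster expansion, and we have {⋯} = exp 𝐑′^{(k)} = exp Σ_X 𝐑′^{(k)}(X). (1.98)"*), for abstract terms
indexed by `({X_j}_{j∈S}, 𝐃)` as in `eq190`: if the terms factorize in the components (`TermMul`) with `term(∅,∅) = 1`, every
item owns a cube outside ⋃_i Y_i, the cube adjacency is reflexive, symmetric and generated by neighbourhoods of at most `ν`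
cubes, the activities (1.91) obey the (1.97)-shaped bound `|F(X′)| ≤ c₁ e^{−R d(X′)}` for a size `d ≥ 0`, the catalogue of
polymers obeys (1.26)_rel `Σ_{X′: q ∈ X′∖⋃Y_i} e^{−κ₀ d(X′)} ≤ K₀` and the volume bound `|X′∖⋃Y_i| ≤ c_v(1 + d(X′))`, and the
constants satisfy `κ₀ + τ c_v ≤ R`, `c₁ e^{τ c_v} K₀ ν ≤ τ` (the hypotheses of `B16Exp198.exp_sum_locR_eq_Z`, verbatim for
this gas), then `Σ_{{X_j}} Σ_𝐃 term = exp Σ_X 𝐑′^{(k)}(X)`, the sum over the unions `X` of polymers of the catalogue and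
`𝐑′^{(k)}(X) = B16Exp198.locR` (the part of log Ξ localized in `X`). [cite: Balaban1989LargeFieldII, (1.98) p.390] -/
theorem eq190_exp [Fintype LF] [Fintype DomY] [Fintype Cube] [DecidableEq LF] [DecidableEq DomY] [DecidableRel adjC]
    (hrefl : ∀ a, adjC a a) (hsymm : ∀ a b, adjC a b → adjC b a) (houtX : ∀ j, (locX j \ Yfix).Nonempty)
    (houtY : ∀ Y, (locY Y \ Yfix).Nonempty) {term : Finset LF → Finset DomY → ℂ} (h0 : term ∅ ∅ = 1)
    (hmul : TermMul adjC locX locY Yfix term)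
    {nbr : Cube → Finset Cube} (hnbr : ∀ a b, adjC a b → a ∈ nbr b) {ν : ℝ} (hν : ∀ b, ((nbr b).card : ℝ) ≤ ν)
    {d : Finset Cube → ℝ} {c₁ R κ₀ K₀ cv τ : ℝ} (hd : ∀ X, 0 ≤ d X) (hc₁ : 0 ≤ c₁) (hK₀ : 0 ≤ K₀) (hτ : 0 ≤ τ)
    (h197 : ∀ X, ‖F191 adjC locX locY Yfix term X‖ ≤ c₁ * Real.exp (-(R * d X)))
    (h126 : Ineq126 (polys190 adjC locX locY Yfix) (fun X => X \ Yfix) d κ₀ K₀)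
    (hvol : VolBound (polys190 adjC locX locY Yfix) (fun X => X \ Yfix) d cv)
    (hrate : κ₀ + τ * cv ≤ R) (hsmall : c₁ * Real.exp (τ * cv) * K₀ * ν ≤ τ) :
    ∑ S : Finset LF, ∑ D : Finset DomY, term S D
      = Complex.exp (∑ X ∈ (polys190 adjC locX locY Yfix).powerset.image (fun C => C.biUnion id),
          locR (pinc adjC Yfix) (polys190 adjC locX locY Yfix) id (F191 adjC locX locY Yfix term) X) := by
  have hΛ : ∀ X ∈ polys190 adjC locX locY Yfix, pinc adjC Yfix X X := fun X hX =>
    pinc_refl_of_mem_polys190 hrefl houtX houtY hX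
  haveI : Std.Symm (pincR adjC Yfix) := ⟨fun X X' h => pincR_symm hsymm h⟩
  have h198 := B16Exp198.exp_sum_locR_eq_Z (pincR adjC Yfix) (Λ := polys190 adjC locX locY Yfix) (cubes := id)
    (out := fun X => X \ Yfix) (reach := fun Z => (Z \ Yfix).biUnion nbr) (d := d)
    (w := F191 adjC locX locY Yfix term)
    (fun Z Z' hZ' h => exists_reach_of_pincR hrefl hnbr hΛ Z Z' hZ' h) (fun Z => card_biUnion_nbr_le hν _)
    hd hc₁ hK₀ hτ (fun Z hZ => F191_eq_zero_of_not_mem term hZ) h197 h126 hvol hrate hsmall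
  have hsum : (∑ X ∈ (polys190 adjC locX locY Yfix).powerset.image (fun C => C.biUnion id),
        locR (pincR adjC Yfix) (polys190 adjC locX locY Yfix) id (F191 adjC locX locY Yfix term) X)
      = ∑ X ∈ (polys190 adjC locX locY Yfix).powerset.image (fun C => C.biUnion id),
          locR (pinc adjC Yfix) (polys190 adjC locX locY Yfix) id (F191 adjC locX locY Yfix term) X :=
    Finset.sum_congr rfl fun X _ => locR_pincR hΛ id _ X
  rw [hsum, polymerPartitionFunction_pincR hΛ] at h198
  rw [eq190 hrefl hsymm houtX houtY h0 hmul]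
  exact h198.symm

variable {Φ : Type*}

/-- **(1.72) ⇒ (1.98): the curly bracket exponentiated** — `{⋯} = exp 𝐑′^{(k)} = exp Σ_X 𝐑′^{(k)}(X)` for the curly bracket
`{Σ_{{X_j}} Π_j 𝐓′_k(X_j) exp Σ_Y V(Y)}` of (1.72) itself (`bracket`): the Mayer step (Part D), the component resummation
(1.90)–(1.91) (Parts A–C) and the exponentiation of `B16Exp198` composed, under the locality of the operations (`TermMul` of
the Mayer terms, `Op ∅ = id`) and the hypotheses of `eq190_exp` ((1.97)-shaped activity bound, relative leaves, constants).
[cite: Balaban1989LargeFieldII, (1.98) p.390] -/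
theorem bracket_eq_exp_sum_locR [Fintype LF] [Fintype DomY] [Fintype Cube] [DecidableEq LF] [DecidableEq DomY]
    [DecidableRel adjC] (hrefl : ∀ a, adjC a a) (hsymm : ∀ a b, adjC a b → adjC b a)
    (houtX : ∀ j, (locX j \ Yfix).Nonempty) (houtY : ∀ Y, (locY Y \ Yfix).Nonempty)
    (Op : Finset LF → (Φ → ℂ) →+ (Φ → ℂ)) (V : DomY → Φ → ℂ) (φ : Φ) (hOp0 : ∀ f, Op ∅ f = f)
    (hmul : TermMul adjC locX locY Yfix (mayerTerm Op V φ))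
    {nbr : Cube → Finset Cube} (hnbr : ∀ a b, adjC a b → a ∈ nbr b) {ν : ℝ} (hν : ∀ b, ((nbr b).card : ℝ) ≤ ν)
    {d : Finset Cube → ℝ} {c₁ R κ₀ K₀ cv τ : ℝ} (hd : ∀ X, 0 ≤ d X) (hc₁ : 0 ≤ c₁) (hK₀ : 0 ≤ K₀) (hτ : 0 ≤ τ)
    (h197 : ∀ X, ‖F191 adjC locX locY Yfix (mayerTerm Op V φ) X‖ ≤ c₁ * Real.exp (-(R * d X)))
    (h126 : Ineq126 (polys190 adjC locX locY Yfix) (fun X => X \ Yfix) d κ₀ K₀)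
    (hvol : VolBound (polys190 adjC locX locY Yfix) (fun X => X \ Yfix) d cv)
    (hrate : κ₀ + τ * cv ≤ R) (hsmall : c₁ * Real.exp (τ * cv) * K₀ * ν ≤ τ) :
    bracket Op V φ
      = Complex.exp (∑ X ∈ (polys190 adjC locX locY Yfix).powerset.image (fun C => C.biUnion id),
          locR (pinc adjC Yfix) (polys190 adjC locX locY Yfix) id
            (F191 adjC locX locY Yfix (mayerTerm Op V φ)) X) := by
  rw [bracket_eq_sum_mayerTerm]
  refine eq190_exp hrefl hsymm houtX houtY ?_ hmul hnbr hν hd hc₁ hK₀ hτ h197 h126 hvol hrate hsmall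
  simp [mayerTerm, hOp0]

end Exp198

/-! ## Part F. «The expression corresponding to X′₀ factorizes in the components» DERIVED from the locality of the
operations (pp. 378–379, (1.71)–(1.72): the 𝐓′_k(X) are integral operations in the variables localized in X)

Parts C–E carry the printed clause *"the expression corresponding to X′₀ factorizes in the components"* as the hypothesis
`TermMul` on the Mayer terms.  Here it is DERIVED from structural hypotheses on the data of the curly bracket of (1.72),
over a configuration space `Var → Sv` of variables `v` sitting at cubes `site v`: (i) `V(Y)` depends only on the variables
in `Y` — and, freely, on the variables inside the FIXED regions ⋃_i Y_i, which no operation of the curly bracket integrates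
(p. 387: the 𝐓′_k(Y_i) stand outside the bracket in (1.72) with their δ-functions `δ_{G_i}(V_k V_{Λ_i}^{−1})`); (ii) the
operations `Op {X_j} = Π_j 𝐓′_k(X_j)` act as the identity for the empty family, compose over disjoint families, pull out
every factor depending only on variables whose cubes outside ⋃_i Y_i do not touch those of ⋃_j X_j outside ⋃_i Y_i (an
integral in the variables of ⋃_j X_j), and produce functions depending only on the variables of the integrand and of
⋃_j X_j (`LocalOps`).  Under (i)–(ii) the Mayer terms satisfy `TermMul` (`termMul_mayerTerm`), whence (1.90) and (1.98) for
the curly bracket with (i)–(ii) in place of `TermMul` (`eq190_bracket_of_localOps`, `bracket_eq_exp_sum_locR_of_localOps`).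
The hypotheses (ii) are consistent (`localOps_id`; non-identity model `localOps_reset`). -/

section Locality

open Literature.MathematicalPhysics.QuantumFieldTheory.Balaban1983to89.B13FamilySum (Ineq126 VolBound)
open Literature.MathematicalPhysics.QuantumFieldTheory.Balaban1983to89.B16Exp198 (locR)

variable {LF DomY Cube Var Sv : Type*} [DecidableEq Cube] {adjC : Cube → Cube → Prop}
  {locX : LF → Finset Cube} {locY : DomY → Finset Cube} {Yfix : Finset Cube} {site : Var → Cube}

variable (Yfix site) in
/-- **Localization of a function of the field configuration**: `f` depends only on the variables sitting in the cubes of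
`A` and on the variables inside the fixed regions ⋃_i Y_i (configurations agreeing there give the same value).  Print:
*"V(Y, U_k)"* localized in Y in (1.72); *"The expression 𝐑′^{(k)}(X) depends on the background field U_k restricted to X"*
(p. 390). [cite: Balaban1989LargeFieldII, (1.72) p.379] -/
def DepOn (f : (Var → Sv) → ℂ) (A : Finset Cube) : Prop :=
  ∀ φ ψ : Var → Sv, (∀ v, site v ∈ A ∪ Yfix → φ v = ψ v) → f φ = f ψ

/-- Localization is monotone in the region. [cite: Balaban1989LargeFieldII, (1.72) p.379] -/
theorem DepOn.mono {f : (Var → Sv) → ℂ} {A A' : Finset Cube} (h : DepOn Yfix site f A) (hAA' : A ⊆ A') :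
    DepOn Yfix site f A' :=
  fun φ ψ hφψ => h φ ψ fun v hv => hφψ v (Finset.union_subset_union hAA' subset_rfl hv)

/-- A product of localized functions is localized in the union of the regions. [cite: Balaban1989LargeFieldII, (1.72) p.379] -/
theorem DepOn.mul {f g : (Var → Sv) → ℂ} {A B : Finset Cube} (hf : DepOn Yfix site f A) (hg : DepOn Yfix site g B) :
    DepOn Yfix site (f * g) (A ∪ B) := by
  intro φ ψ h
  simp only [Pi.mul_apply]
  rw [hf φ ψ fun v hv => h v (Finset.union_subset_union Finset.subset_union_left subset_rfl hv),
    hg φ ψ fun v hv => h v (Finset.union_subset_union Finset.subset_union_right subset_rfl hv)]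

/-- A function of a localized function is localized in the same region. [cite: Balaban1989LargeFieldII, (1.72) p.379] -/
theorem DepOn.comp {g : (Var → Sv) → ℂ} {A : Finset Cube} (hg : DepOn Yfix site g A) (G : ℂ → ℂ) :
    DepOn Yfix site (fun ψ => G (g ψ)) A :=
  fun φ ψ h => by simp only [hg φ ψ h]

variable (locX locY) in
/-- The localization domain grows with the term. [cite: Balaban1989LargeFieldII, (1.91) p.388] -/
theorem locDom_mono {S S' : Finset LF} {D D' : Finset DomY} (hS : S ⊆ S') (hD : D ⊆ D') :
    locDom locX locY S D ⊆ locDom locX locY S' D' :=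
  Finset.union_subset_union (Finset.biUnion_subset_biUnion_of_subset_left _ hS)
    (Finset.biUnion_subset_biUnion_of_subset_left _ hD)

/-- The localization domain of a family of operations alone is `⋃_j X_j`. [cite: Balaban1989LargeFieldII, (1.91) p.388] -/
theorem locDom_empty_right (S : Finset LF) : locDom locX locY S (∅ : Finset DomY) = S.biUnion locX := by
  simp [locDom]

/-- Mutually unlinked terms — and all their sub-terms — have localization domains whose parts outside ⋃_i Y_i do not touch.
[cite: Balaban1989LargeFieldII, (1.90) p.388] -/
theorem not_touch_of_unlinked {S₁ S₂ S₁' S₂' : Finset LF} {D₁ D₂ D₁' D₂' : Finset DomY}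
    (hunl : ∀ u ∈ items S₁ D₁, ∀ v ∈ items S₂ D₂, ¬ olink adjC (locI locX locY) Yfix u v)
    (h₁ : S₁' ⊆ S₁) (h₁' : D₁' ⊆ D₁) (h₂ : S₂' ⊆ S₂) (h₂' : D₂' ⊆ D₂) :
    ¬ Touch adjC (locDom locX locY S₁' D₁' \ Yfix) (locDom locX locY S₂' D₂' \ Yfix) := by
  intro ht
  have hp : pinc adjC Yfix (fp (locI locX locY) (items S₁' D₁')) (fp (locI locX locY) (items S₂' D₂')) := by
    rw [fp_items, fp_items]
    exact ht
  obtain ⟨u, hu, v, hv, huv⟩ := (pinc_fp_iff _ _).1 hp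
  exact hunl u (Finset.disjSum_mono h₁ h₁' hu) v (Finset.disjSum_mono h₂ h₂' hv) huv

variable (adjC locX Yfix site) in
/-- **Locality of the operations `Op {X_j} = Π_j 𝐓′_k(X_j)`** (pp. 378–379: the 𝐓′_k(X) of (1.71) are integral operations
in the variables localized in X, composed over the family {X₁,…,X_n} in (1.72)): the empty family acts as the identity;
disjoint families compose; a factor depending only on variables whose cubes outside ⋃_i Y_i do not touch the cubes of
⋃_j X_j outside ⋃_i Y_i is pulled out of the operation; the result depends only on the variables of the integrand and of
⋃_j X_j.  A HYPOTHESIS structure on abstract data (the construction (1.71) is not reproduced); consistent (`localOps_id`),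
with a non-identity model (`localOps_reset`).
[cite: Balaban1989LargeFieldII, (1.71) p.378] -/
structure LocalOps [DecidableEq LF] (Op : Finset LF → ((Var → Sv) → ℂ) →+ ((Var → Sv) → ℂ)) : Prop where
  /-- the empty product of operations is the identity -/
  empty : ∀ f, Op ∅ f = f
  /-- products of operations over disjoint families compose -/
  comp : ∀ S₁ S₂, Disjoint S₁ S₂ → ∀ f, Op (S₁ ∪ S₂) f = Op S₁ (Op S₂ f)
  /-- a factor localized away from ⋃_j X_j (outside parts not touching) is pulled out of the operation -/
  mul_out : ∀ S (f g : (Var → Sv) → ℂ) (B : Finset Cube), DepOn Yfix site g B →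
    ¬ Touch adjC (B \ Yfix) (S.biUnion locX \ Yfix) → Op S (f * g) = Op S f * g
  /-- the result is localized in ⋃_j X_j and the integrand's region -/
  depOn : ∀ S (f : (Var → Sv) → ℂ) (A : Finset Cube), DepOn Yfix site f A →
    DepOn Yfix site (Op S f) (S.biUnion locX ∪ A)

/-- The hypotheses `LocalOps` are consistent: the identity operations satisfy them, for every geometry.
[cite: Balaban1989LargeFieldII, (1.71) p.378] -/
theorem localOps_id [DecidableEq LF] : LocalOps adjC locX Yfix site (fun _ : Finset LF => AddMonoidHom.id ((Var → Sv) → ℂ)) where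
  empty _ := rfl
  comp _ _ _ _ := rfl
  mul_out _ _ _ _ _ _ := rfl
  depOn _ _ _ h := h.mono Finset.subset_union_right

variable (locX Yfix site) in
/-- The configuration with the variables of `⋃_{j∈S} X_j` outside ⋃_i Y_i reset to a reference configuration `ψ₀` — used to
exhibit a non-identity model of `LocalOps` (integration against a Dirac measure in those variables).
[cite: Balaban1989LargeFieldII, (1.71) p.378] -/
def resetCfg (S : Finset LF) (ψ₀ φ : Var → Sv) : Var → Sv :=
  fun v => if site v ∈ S.biUnion locX \ Yfix then ψ₀ v else φ v

variable (locX Yfix site) in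
/-- The evaluation operations `f ↦ (φ ↦ f(φ with the variables of ⋃_{j∈S} X_j outside ⋃_i Y_i reset to ψ₀))`, additive in `f`.
[cite: Balaban1989LargeFieldII, (1.71) p.378] -/
def resetOp (ψ₀ : Var → Sv) (S : Finset LF) : ((Var → Sv) → ℂ) →+ ((Var → Sv) → ℂ) where
  toFun f := fun φ => f (resetCfg locX Yfix site S ψ₀ φ)
  map_zero' := rfl
  map_add' _ _ := rfl

/-- A NON-identity model of `LocalOps` in which the touching geometry matters: for every reflexive cube adjacency the
evaluation operations `resetOp` satisfy `LocalOps` (a factor localized where the outside parts do not touch those of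
⋃_{j∈S} X_j does not see the reset variables). [cite: Balaban1989LargeFieldII, (1.71) p.378] -/
theorem localOps_reset [DecidableEq LF] (hrefl : ∀ a, adjC a a) (ψ₀ : Var → Sv) :
    LocalOps adjC locX Yfix site (resetOp locX Yfix site ψ₀) where
  empty f := by
    funext φ
    show f (resetCfg locX Yfix site ∅ ψ₀ φ) = f φ
    congr 1
    funext v
    simp [resetCfg]
  comp S₁ S₂ _ f := by
    funext φ
    show f (resetCfg locX Yfix site (S₁ ∪ S₂) ψ₀ φ) =
      f (resetCfg locX Yfix site S₂ ψ₀ (resetCfg locX Yfix site S₁ ψ₀ φ))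
    congr 1
    funext v
    simp only [resetCfg, Finset.union_biUnion, Finset.mem_sdiff, Finset.mem_union]
    by_cases h₁ : site v ∈ S₁.biUnion locX <;> by_cases h₂ : site v ∈ S₂.biUnion locX <;>
      by_cases hY : site v ∈ Yfix <;> simp [h₁, h₂, hY]
  mul_out S f g B hg hnt := by
    funext φ
    show f (resetCfg locX Yfix site S ψ₀ φ) * g (resetCfg locX Yfix site S ψ₀ φ) =
      f (resetCfg locX Yfix site S ψ₀ φ) * g φ
    congr 1
    refine hg _ _ fun v hv => ?_
    simp only [resetCfg]
    split_ifs with h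
    · have hvY : site v ∉ Yfix := (Finset.mem_sdiff.1 h).2
      have hvB : site v ∈ B := (Finset.mem_union.1 hv).resolve_right hvY
      exact (hnt ⟨site v, Finset.mem_sdiff.2 ⟨hvB, hvY⟩, site v, h, hrefl _⟩).elim
    · rfl
  depOn S f A hf := by
    intro φ ψ h
    show f (resetCfg locX Yfix site S ψ₀ φ) = f (resetCfg locX Yfix site S ψ₀ ψ)
    refine hf _ _ fun v hv => ?_
    simp only [resetCfg]
    split_ifs with h1
    · rfl
    · exact h v (Finset.union_subset_union Finset.subset_union_right subset_rfl hv)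

/-- **The factorization in the components, derived**: under `LocalOps` and the localization of every `V(Y)` in `Y`, the
Mayer terms `Op{X_j}[Π_{Y∈𝐃} ∫₀¹dt e^{tV(Y)}V(Y)](φ)` of Part D satisfy `TermMul` — the term of a disjoint union of two
mutually unlinked terms is the product of their terms (p. 388: *"the expression corresponding to X′₀ factorizes in the
components"*): the factor of 𝐃₁ is pulled out of the 𝐓′-operations of the second term, then the whole second term out of
those of the first. [cite: Balaban1989LargeFieldII, (1.90) p.388] -/
theorem termMul_mayerTerm [DecidableEq LF] [DecidableEq DomY] (hsymm : ∀ a b, adjC a b → adjC b a)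
    {Op : Finset LF → ((Var → Sv) → ℂ) →+ ((Var → Sv) → ℂ)} (hOps : LocalOps adjC locX Yfix site Op)
    {V : DomY → (Var → Sv) → ℂ} (hV : ∀ Y, DepOn Yfix site (V Y) (locY Y)) (φ : Var → Sv) :
    TermMul adjC locX locY Yfix (mayerTerm Op V φ) := by
  intro S₁ D₁ S₂ D₂ hS hD hunl
  -- the interpolated factors `u Y = ∫₀¹dt e^{tV(Y)}V(Y)` and their products `g 𝐃`, as functions of the configuration
  obtain ⟨u, hu⟩ : ∃ u : DomY → (Var → Sv) → ℂ,
      u = fun Y ψ => ∫ t in (0 : ℝ)..1, Complex.exp ((t : ℂ) * V Y ψ) * V Y ψ := ⟨_, rfl⟩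
  obtain ⟨g, hg⟩ : ∃ g : Finset DomY → (Var → Sv) → ℂ, g = fun D ψ => ∏ Y ∈ D, u Y ψ := ⟨_, rfl⟩
  have hmayer : ∀ S D, mayerTerm Op V φ S D = Op S (g D) φ := fun S D => by
    rw [hg, hu]
    rfl
  have hdep_u : ∀ Y, DepOn Yfix site (u Y) (locY Y) := fun Y φ' ψ' h => by
    rw [hu]
    simp only [hV Y φ' ψ' h]
  have hdep_g : ∀ D, DepOn Yfix site (g D) (locDom locX locY ∅ D) := fun D φ' ψ' h => by
    rw [hg]
    show ∏ Y ∈ D, u Y φ' = ∏ Y ∈ D, u Y ψ'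
    refine Finset.prod_congr rfl fun Y hY => hdep_u Y φ' ψ' fun v hv => h v ?_
    refine Finset.union_subset_union ?_ subset_rfl hv
    exact (Finset.subset_biUnion_of_mem locY hY).trans Finset.subset_union_right
  have hprod : g (D₁ ∪ D₂) = g D₂ * g D₁ := by
    rw [hg]
    funext ψ
    simp only [Pi.mul_apply]
    rw [Finset.prod_union hD, mul_comm]
  -- the outside parts do not touch: 𝐃₁ against {X_j}_{S₂}, and the whole second term against {X_j}_{S₁}
  have hnt₁ : ¬ Touch adjC (locDom locX locY ∅ D₁ \ Yfix) (S₂.biUnion locX \ Yfix) := by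
    rw [← locDom_empty_right (locX := locX) (locY := locY) S₂]
    exact not_touch_of_unlinked hunl (Finset.empty_subset _) subset_rfl subset_rfl (Finset.empty_subset _)
  have hnt₂ : ¬ Touch adjC (locDom locX locY S₂ D₂ \ Yfix) (S₁.biUnion locX \ Yfix) := by
    rw [← locDom_empty_right (locX := locX) (locY := locY) S₁]
    intro ht
    exact not_touch_of_unlinked hunl subset_rfl (Finset.empty_subset _) subset_rfl subset_rfl
      (Touch.symm hsymm ht)
  -- the second term, after its own operations, is localized in its localization domain
  have hdep_h : DepOn Yfix site (Op S₂ (g D₂)) (locDom locX locY S₂ D₂) :=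
    (hOps.depOn S₂ (g D₂) _ (hdep_g D₂)).mono
      (Finset.union_subset Finset.subset_union_left (locDom_mono locX locY (Finset.empty_subset _) subset_rfl))
  rw [hmayer, hmayer, hmayer, hOps.comp S₁ S₂ hS, hprod, hOps.mul_out S₂ (g D₂) (g D₁) _ (hdep_g D₁) hnt₁,
    mul_comm (Op S₂ (g D₂)) (g D₁), hOps.mul_out S₁ (g D₁) (Op S₂ (g D₂)) _ hdep_h hnt₂, Pi.mul_apply]

/-- **(1.90) for the curly bracket of (1.72) from the locality of the operations**: as `eq190_bracket`, with the
factorization clause replaced by `LocalOps` and the localization of the `V(Y)`. [cite: Balaban1989LargeFieldII, (1.90) p.388] -/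
theorem eq190_bracket_of_localOps [Fintype LF] [Fintype DomY] [DecidableEq LF] [DecidableEq DomY] [DecidableRel adjC]
    (hrefl : ∀ a, adjC a a) (hsymm : ∀ a b, adjC a b → adjC b a) (houtX : ∀ j, (locX j \ Yfix).Nonempty)
    (houtY : ∀ Y, (locY Y \ Yfix).Nonempty) {Op : Finset LF → ((Var → Sv) → ℂ) →+ ((Var → Sv) → ℂ)}
    (hOps : LocalOps adjC locX Yfix site Op) {V : DomY → (Var → Sv) → ℂ}
    (hV : ∀ Y, DepOn Yfix site (V Y) (locY Y)) (φ : Var → Sv) :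
    bracket Op V φ = polymerPartitionFunction (pinc adjC Yfix) (F191 adjC locX locY Yfix (mayerTerm Op V φ))
      (polys190 adjC locX locY Yfix) :=
  eq190_bracket hrefl hsymm houtX houtY Op V φ hOps.empty (termMul_mayerTerm hsymm hOps hV φ)

/-- **(1.72) ⇒ (1.98) from the locality of the operations**: as `bracket_eq_exp_sum_locR`, with the factorization clause
replaced by `LocalOps` and the localization of the `V(Y)`. [cite: Balaban1989LargeFieldII, (1.98) p.390] -/
theorem bracket_eq_exp_sum_locR_of_localOps [Fintype LF] [Fintype DomY] [Fintype Cube] [DecidableEq LF]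
    [DecidableEq DomY] [DecidableRel adjC] (hrefl : ∀ a, adjC a a) (hsymm : ∀ a b, adjC a b → adjC b a)
    (houtX : ∀ j, (locX j \ Yfix).Nonempty) (houtY : ∀ Y, (locY Y \ Yfix).Nonempty)
    {Op : Finset LF → ((Var → Sv) → ℂ) →+ ((Var → Sv) → ℂ)} (hOps : LocalOps adjC locX Yfix site Op)
    {V : DomY → (Var → Sv) → ℂ} (hV : ∀ Y, DepOn Yfix site (V Y) (locY Y)) (φ : Var → Sv)
    {nbr : Cube → Finset Cube} (hnbr : ∀ a b, adjC a b → a ∈ nbr b) {ν : ℝ} (hν : ∀ b, ((nbr b).card : ℝ) ≤ ν)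
    {d : Finset Cube → ℝ} {c₁ R κ₀ K₀ cv τ : ℝ} (hd : ∀ X, 0 ≤ d X) (hc₁ : 0 ≤ c₁) (hK₀ : 0 ≤ K₀) (hτ : 0 ≤ τ)
    (h197 : ∀ X, ‖F191 adjC locX locY Yfix (mayerTerm Op V φ) X‖ ≤ c₁ * Real.exp (-(R * d X)))
    (h126 : Ineq126 (polys190 adjC locX locY Yfix) (fun X => X \ Yfix) d κ₀ K₀)
    (hvol : VolBound (polys190 adjC locX locY Yfix) (fun X => X \ Yfix) d cv)
    (hrate : κ₀ + τ * cv ≤ R) (hsmall : c₁ * Real.exp (τ * cv) * K₀ * ν ≤ τ) :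
    bracket Op V φ
      = Complex.exp (∑ X ∈ (polys190 adjC locX locY Yfix).powerset.image (fun C => C.biUnion id),
          locR (pinc adjC Yfix) (polys190 adjC locX locY Yfix) id
            (F191 adjC locX locY Yfix (mayerTerm Op V φ)) X) :=
  bracket_eq_exp_sum_locR hrefl hsymm houtX houtY Op V φ hOps.empty (termMul_mayerTerm hsymm hOps hV φ) hnbr hν hd
    hc₁ hK₀ hτ h197 h126 hvol hrate hsmall

end Locality

/-! ## Part G. (1.99) for the gas of (1.90): the decay of 𝐑′^{(k)}(X) (p. 390), composed with `B16Exp198`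

p. 390, verbatim: *"It is given by the convergent series (7.13) [I] (with proper notational changes), and it satisfies the
inequality |𝐑′^{(k)}(X,(𝐔,𝐉))| ≤ O(1)c₁ exp(−(1+½β)κ d_{k,∪Y_i}(X)). (1.99)"*.  The sibling `B16Exp198.norm_locR_le_of_small`
proves the kernel form of (1.99) for the abstract two-footprint gas; here it is instantiated to the gas of (1.90)
(`pinc`, `polys190`, `F191`) exactly as (1.98) was in Part E — the relative cluster subadditivity `RelSubadd` and the
cluster notion being insensitive to the passage `pinc ↦ pincR` (`isPolymerCluster_pincR_iff`: the two members of a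
decomposition witness are distinct). -/

section Ineq199

open Literature.Probability.LatticeModels
open Literature.MathematicalPhysics.QuantumFieldTheory.Balaban1983to89.B13FamilySum (Ineq126 VolBound)
open Literature.MathematicalPhysics.QuantumFieldTheory.Balaban1983to89.B16Exp198 (locR RelSubadd)

variable {Cube : Type*} [DecidableEq Cube] {adjC : Cube → Cube → Prop} {Yfix : Finset Cube}

/-- Clusters are the same for `pinc` and for its reflexive closure (a decomposition witness joins two DISTINCT polymers).
[cite: Balaban1989LargeFieldII, (1.90) p.388] -/
theorem isPolymerCluster_pincR_iff (C : Finset (Finset Cube)) :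
    IsPolymerCluster (pincR adjC Yfix) C ↔ IsPolymerCluster (pinc adjC Yfix) C := by
  refine ⟨fun h C₁ hC₁ hne hne' => ?_, fun h C₁ hC₁ hne hne' => ?_⟩
  · obtain ⟨γ₁, hγ₁, γ₂, hγ₂, hγ | rfl⟩ := h C₁ hC₁ hne hne'
    · exact ⟨γ₁, hγ₁, γ₂, hγ₂, hγ⟩
    · exact absurd hγ₁ (Finset.mem_sdiff.1 hγ₂).2
  · obtain ⟨γ₁, hγ₁, γ₂, hγ₂, hγ⟩ := h C₁ hC₁ hne hne'
    exact ⟨γ₁, hγ₁, γ₂, hγ₂, Or.inl hγ⟩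

/-- The relative cluster subadditivity is the same for `pinc` and for its reflexive closure.
[cite: Balaban1989LargeFieldII, (1.93) p.388] -/
theorem relSubadd_pincR_iff [DecidableRel adjC] (Λ : Finset (Finset Cube)) (cubes : Finset Cube → Finset Cube)
    (d : Finset Cube → ℝ) (X : Finset Cube) (dX c : ℝ) :
    RelSubadd (pincR adjC Yfix) Λ cubes d X dX c ↔ RelSubadd (pinc adjC Yfix) Λ cubes d X dX c := by
  unfold B16Exp198.RelSubadd
  simp only [isPolymerCluster_pincR_iff]

variable {LF DomY : Type*} {locX : LF → Finset Cube} {locY : DomY → Finset Cube}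

/-- **(1.99) for the gas of (1.90), kernel form** (p. 390: *"|𝐑′^{(k)}(X,(𝐔,𝐉))| ≤ O(1)c₁ exp(−(1+½β)κ d_{k,∪Y_i}(X))"*):
for a union `X` of polymers owning a cube `q₀` outside ⋃_i Y_i, of relative size `dX`, with the relative cluster
subadditivity `RelSubadd` (junction cost `c`, print: 2d) for the clusters of the (1.90) gas covering `X`: if the activities
(1.91) of the polymers inside `X` obey the (1.97)-shaped bound `|F(X′)| ≤ c₁ e^{−R d(X′)}`, the catalogue obeys (1.26)_rel and
the volume bound on the outside footprints, the adjacency is generated by neighbourhoods of at most `ν` cubes, and the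
constants satisfy `r₁c ≤ b`, `r₁ + 2κ₀ + 2 ≤ R` (print: rate loss (1+β)κ → (1+½β)κ) and `c₁ e^{b+1} K₀ ν c_v ≤ 1` (print: c₁
small), then `|𝐑′^{(k)}(X)| ≤ (e ν c_v K₀²) · c₁ · e^{−r₁ dX}` — `B16Exp198.norm_locR_le_of_small` for THIS gas.
[cite: Balaban1989LargeFieldII, (1.99) p.390] -/
theorem norm_locR190_le [Fintype LF] [Fintype DomY] [Fintype Cube] [DecidableEq LF] [DecidableEq DomY] [DecidableRel adjC]
    (hrefl : ∀ a, adjC a a) (hsymm : ∀ a b, adjC a b → adjC b a) (houtX : ∀ j, (locX j \ Yfix).Nonempty)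
    (houtY : ∀ Y, (locY Y \ Yfix).Nonempty) (term : Finset LF → Finset DomY → ℂ)
    {nbr : Cube → Finset Cube} (hnbr : ∀ a b, adjC a b → a ∈ nbr b) {ν : ℝ} (hν : ∀ b, ((nbr b).card : ℝ) ≤ ν)
    (hν0 : 0 ≤ ν) {d : Finset Cube → ℝ} {c₁ R r₁ κ₀ K₀ cv c b dX : ℝ} {X : Finset Cube} {q₀ : Cube}
    (hd : ∀ Z, 0 ≤ d Z) (hc₁ : 0 ≤ c₁) (hK₀ : 0 ≤ K₀) (hcv : 0 ≤ cv) (hκ₀ : 0 ≤ κ₀) (hr₁ : 0 ≤ r₁) (hc : 0 ≤ c)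
    (hb : r₁ * c ≤ b)
    (h197 : ∀ Z ∈ polys190 adjC locX locY Yfix, Z ⊆ X →
      ‖F191 adjC locX locY Yfix term Z‖ ≤ c₁ * Real.exp (-(R * d Z)))
    (h126 : Ineq126 (polys190 adjC locX locY Yfix) (fun Z => Z \ Yfix) d κ₀ K₀)
    (hvol : VolBound (polys190 adjC locX locY Yfix) (fun Z => Z \ Yfix) d cv)
    (hsub : RelSubadd (pinc adjC Yfix) (polys190 adjC locX locY Yfix) id d X dX c)
    (hrate : r₁ + 2 * κ₀ + 2 ≤ R) (hsmall : c₁ * Real.exp (b + 1) * K₀ * ν * cv ≤ 1)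
    (hq₀X : q₀ ∈ X) (hq₀ : q₀ ∉ Yfix) :
    ‖locR (pinc adjC Yfix) (polys190 adjC locX locY Yfix) id (F191 adjC locX locY Yfix term) X‖
      ≤ Real.exp 1 * ν * cv * K₀ ^ 2 * c₁ * Real.exp (-(r₁ * dX)) := by
  have hΛ : ∀ Z ∈ polys190 adjC locX locY Yfix, pinc adjC Yfix Z Z := fun Z hZ =>
    pinc_refl_of_mem_polys190 hrefl houtX houtY hZ
  haveI : Std.Symm (pincR adjC Yfix) := ⟨fun Z Z' h => pincR_symm hsymm h⟩
  rw [← locR_pincR hΛ]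
  exact B16Exp198.norm_locR_le_of_small (pincR adjC Yfix) (Λ := polys190 adjC locX locY Yfix) (cubes := id)
    (out := fun Z => Z \ Yfix) (reach := fun Z => (Z \ Yfix).biUnion nbr) (d := d)
    (w := F191 adjC locX locY Yfix term)
    (fun Z Z' hZ' h => exists_reach_of_pincR hrefl hnbr hΛ Z Z' hZ' h) (fun Z => card_biUnion_nbr_le hν _)
    hd hc₁ hK₀ hcv hν0 hκ₀ hr₁ hc hb (fun Z hZ hZX => h197 Z hZ hZX) h126 hvol
    ((relSubadd_pincR_iff _ _ _ _ _ _).2 hsub) hrate hsmall hq₀X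
    (fun Z _ hq => Finset.mem_sdiff.2 ⟨hq, hq₀⟩)

end Ineq199

/-! ## Part H. (1.92) and (1.97) for the gas of (1.90): the activity bound of Part E DISCHARGED from the
(1.68)- and (1.73)·(1.89)-shaped leaves and the geometric leaves of the sibling `B16Ineq197` (v1.4)

p. 388, verbatim: *"To get a convergent exponentiated expansion of the right-hand side of (1.90), we have to obtain the
bounds for the activities. Using (1.68), (1.73), (1.89), we obtain |F(X′)| ≤ Σ_q Σ′_{{X_{j_1},…,X_{j_q}}} Σ′_𝐃 Π_{h=1}^q
exp(−2(1+β₀)⁻¹p₀(g_k) + 1) · (Π_{Y∈𝐃} α exp(−(1+2β)κ d_{k,Z′}(Y))) exp Σ_{Y∈𝐃} α exp(−(1+2β)κ d_{k,Z′}(Y)), (1.92)"*;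
pp. 389–390: *"|F(X′)| ≤ c₁ exp(−(1+β)κ d_{k,∪Y_i}(X′)), (1.97) where c₁ = exp(−p₀(g_k)) if X′ does not intersect
⋃_{i=1}^m Y_i, and c₁ = α^{1/3} in the remaining cases."*  The sibling `B16Ineq197` proves (1.92)–(1.96) ⇒ (1.97) for ONE
abstract polymer catalogue (`B16Ineq197.Polymer`: admissible pairs `adm`, sizes) from the per-term majorant `Major192`, the
geometric leaves `Subadd193`/`Vol193`/`XBudget`/`Anch194`/`Count196` and the two selector facts of p. 389.  Here, for the
CONCRETE gas of Parts C–D: the catalogue of one polymer X′ IS the index set of `F191` (`adm191`, `polymer191`); (1.92) is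
DERIVED for the Mayer terms `mayerTerm Op V φ` from a sup-norm bound of the operations (`OpBound`: `‖Op{X_j} f‖ ≤ Π_j θ_j ·
sup‖f‖`, the shape (1.73)–(1.75)·(1.89) give — *"we have estimated the expression |σ| in (1.73) by 1"* — and itself derived
from single-operation bounds by the composition law of `LocalOps`, `opBound_of_single`) and the (1.68)-shaped bound
`‖V(Y)‖ ≤ a(d(Y))` through `‖∫₀¹e^{tV}V dt‖ ≤ |V|e^{|V|}`; the selector *"Either the domain X′ contains one of the domains
Y_i, then … c₀ = α^{1/3}"* is PROVED (`snd_nonempty_of_meets`: the X_j do not meet ⋃Y_i, so a term whose domain meets ⋃Y_i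
owns a Y ∈ 𝐃); the other selector (*"or the domain X′ is disjoint with ⋃Y_i, and then the sum begins with q = 1"* — in print
a consequence of p. 377 *"the summation is over domains Y ∈ 𝐃_k satisfying the property that the intersection Y ∩ Z^~ is a
union of components of Z^~, containing at least one component"*, structure the abstract catalogue does not carry) is kept as
the explicit hypothesis `hsel`, next to a selector-free bound with `c₁ = e^{−p₀(g_k)} + α^{1/3}` valid for every polymer
(every connected term is nonempty); whence (1.97) for `F191 (mayerTerm Op V φ)` (`norm_F191_mayerTerm_le*`, and unit b02's
leaf `B16.Ineq197` BY NAME, `ineq197_gas`), and Part E's / Part G's (1.98) / (1.99) for the curly bracket with their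
hypothesis `h197` DISCHARGED (`bracket_eq_exp_sum_locR_of_leaves`, `norm_locR190_le_of_leaves`). -/

section Ineq197Gas

/-! ### H.1 One interpolated factor of (1.91): `‖∫₀¹ e^{tV} V dt‖ ≤ |V| e^{|V|}` -/

/-- `‖∫₀¹ e^{tv} v dt‖ ≤ ‖v‖ e^{‖v‖}` — the (1.68)-half of (1.92) for one interpolated factor `∫₀¹dt(Y) V(Y) e^{t(Y)V(Y)}` of
(1.91) (`|e^{tv}| = e^{t Re v} ≤ e^{‖v‖}` for `t ∈ [0,1]`). [cite: Balaban1989LargeFieldII, (1.92) p.388] -/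
theorem norm_integral_exp_mul_le (v : ℂ) :
    ‖∫ t in (0 : ℝ)..1, Complex.exp ((t : ℂ) * v) * v‖ ≤ ‖v‖ * Real.exp ‖v‖ := by
  have h : ∀ t ∈ Set.uIoc (0 : ℝ) 1, ‖Complex.exp ((t : ℂ) * v) * v‖ ≤ ‖v‖ * Real.exp ‖v‖ := by
    intro t ht
    rw [Set.uIoc_of_le zero_le_one] at ht
    rw [norm_mul, Complex.norm_exp, mul_comm]
    refine mul_le_mul_of_nonneg_left (Real.exp_le_exp.2 ?_) (norm_nonneg _)
    calc ((t : ℂ) * v).re ≤ ‖(t : ℂ) * v‖ := Complex.re_le_norm _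
      _ = |t| * ‖v‖ := by rw [norm_mul, Complex.norm_real, Real.norm_eq_abs]
      _ ≤ 1 * ‖v‖ := by
          refine mul_le_mul_of_nonneg_right ?_ (norm_nonneg _)
          rw [abs_le]
          constructor <;> linarith [ht.1, ht.2]
      _ = ‖v‖ := one_mul _
  have h' := intervalIntegral.norm_integral_le_of_norm_le_const h
  simpa using h'

/-- Monotone form: `‖v‖ ≤ a ⇒ ‖∫₀¹ e^{tv} v dt‖ ≤ a e^{a}`. [cite: Balaban1989LargeFieldII, (1.92) p.388] -/
theorem norm_integral_exp_mul_le_of_le {v : ℂ} {a : ℝ} (h : ‖v‖ ≤ a) :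
    ‖∫ t in (0 : ℝ)..1, Complex.exp ((t : ℂ) * v) * v‖ ≤ a * Real.exp a :=
  (norm_integral_exp_mul_le v).trans
    (mul_le_mul h (Real.exp_le_exp.2 h) (Real.exp_pos _).le ((norm_nonneg _).trans h))

/-- The integrand of the Mayer term for `𝐃`: `‖Π_{Y∈𝐃} ∫₀¹ e^{tV(Y)}V(Y) dt‖ ≤ Π_{Y∈𝐃} a(Y) · exp Σ_{Y∈𝐃} a(Y)` when
`‖V(Y)‖ ≤ a(Y)` — the second and third factors of (1.92). [cite: Balaban1989LargeFieldII, (1.92) p.388] -/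
theorem norm_prod_integral_exp_mul_le {DomY Φ : Type*} (D : Finset DomY) (V : DomY → Φ → ℂ) (a : DomY → ℝ) (ψ : Φ)
    (hV : ∀ Y ∈ D, ‖V Y ψ‖ ≤ a Y) :
    ‖∏ Y ∈ D, ∫ t in (0 : ℝ)..1, Complex.exp ((t : ℂ) * V Y ψ) * V Y ψ‖
      ≤ (∏ Y ∈ D, a Y) * Real.exp (∑ Y ∈ D, a Y) := by
  rw [norm_prod, Real.exp_sum, ← Finset.prod_mul_distrib]
  exact Finset.prod_le_prod (fun Y _ => norm_nonneg _) fun Y hY => norm_integral_exp_mul_le_of_le (hV Y hY)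

/-! ### H.2 The sup-norm bound of the operations ((1.73)–(1.75) with (1.89)) -/

variable {LF Φ : Type*}

/-- **(1.73)·(1.89), the sup-norm bound of the operations `Op{X_j} = Π_j 𝐓′_k(X_j)`**: a function bounded by `B` is mapped
to a function bounded by `(Π_{j∈S} θ_j) · B` — print (1.73)–(1.75) p. 380: *"|𝐓′_k(X,(𝐔,𝐉))F| = |𝐓′_k(X,(𝐔,0))e^{σ}F| ≤
𝐓′_k(X,(𝐔,0))|e^{σ}F| ≤ (𝐓′_k(X,(𝐔,0))1) sup e^{|σ|}|F|"* with (1.89) p. 387 *"𝐓′_k(X)1 ≤ exp(−2(1+β₀)⁻¹p₀(g_k))"*, i.e.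
`θ_j = exp(−2(1+β₀)⁻¹p₀(g_k) + sup|σ|)`; a HYPOTHESIS on the abstract operations (derived from single-operation bounds by
`opBound_of_single`). [cite: Balaban1989LargeFieldII, (1.73) p.380] -/
def OpBound (Op : Finset LF → (Φ → ℂ) →+ (Φ → ℂ)) (θ : LF → ℝ) : Prop :=
  ∀ (S : Finset LF) (f : Φ → ℂ) (B : ℝ), (∀ ψ, ‖f ψ‖ ≤ B) → ∀ φ, ‖Op S f φ‖ ≤ (∏ j ∈ S, θ j) * B

/-- **The family bound from single-operation bounds**: if the empty family acts as the identity, disjoint families compose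
(the `empty`/`comp` clauses of `LocalOps`), and each `𝐓′_k(X_j)` maps a function bounded by `B` to one bounded by `θ_j·B`
((1.73)·(1.89) for ONE operation), then `OpBound Op θ` (induction over the family, print's iteration over h = 1,…,q).
[cite: Balaban1989LargeFieldII, (1.73) p.380] -/
theorem opBound_of_single [DecidableEq LF] {Op : Finset LF → (Φ → ℂ) →+ (Φ → ℂ)} {θ : LF → ℝ}
    (hempty : ∀ f, Op ∅ f = f) (hcomp : ∀ S₁ S₂, Disjoint S₁ S₂ → ∀ f, Op (S₁ ∪ S₂) f = Op S₁ (Op S₂ f))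
    (h1 : ∀ (j : LF) (f : Φ → ℂ) (B : ℝ), (∀ ψ, ‖f ψ‖ ≤ B) → ∀ φ, ‖Op {j} f φ‖ ≤ θ j * B) :
    OpBound Op θ := by
  intro S
  induction S using Finset.induction_on with
  | empty =>
    intro f B hf φ
    rw [hempty, Finset.prod_empty, one_mul]
    exact hf φ
  | insert a S ha ih =>
    intro f B hf φ
    have hdisj : Disjoint ({a} : Finset LF) S := Finset.disjoint_singleton_left.2 ha
    rw [Finset.insert_eq, hcomp _ _ hdisj, Finset.prod_union hdisj, Finset.prod_singleton, mul_assoc]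
    exact h1 a _ _ (fun ψ => ih f B hf ψ) φ

section OpBoundModels

variable {Cube Var Sv : Type*} [DecidableEq Cube] {adjC : Cube → Cube → Prop} {locX : LF → Finset Cube}
  {Yfix : Finset Cube} {site : Var → Cube}

/-- `OpBound` from `LocalOps` (Part F) and single-operation bounds. [cite: Balaban1989LargeFieldII, (1.73) p.380] -/
theorem opBound_of_localOps [DecidableEq LF] {Op : Finset LF → ((Var → Sv) → ℂ) →+ ((Var → Sv) → ℂ)} {θ : LF → ℝ}
    (hOps : LocalOps adjC locX Yfix site Op)
    (h1 : ∀ (j : LF) (f : (Var → Sv) → ℂ) (B : ℝ), (∀ ψ, ‖f ψ‖ ≤ B) → ∀ φ, ‖Op {j} f φ‖ ≤ θ j * B) :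
    OpBound Op θ :=
  opBound_of_single hOps.empty hOps.comp h1

/-- Joint non-vacuity with Part F: the evaluation operations `resetOp` (a non-identity model of `LocalOps`, `localOps_reset`)
satisfy `OpBound` with `θ ≡ 1`. [cite: Balaban1989LargeFieldII, (1.73) p.380] -/
theorem opBound_resetOp (ψ₀ : Var → Sv) : OpBound (resetOp locX Yfix site ψ₀) (fun _ : LF => (1 : ℝ)) := by
  intro S f B hf φ
  rw [Finset.prod_const_one, one_mul]
  exact hf _

end OpBoundModels

/-! ### H.3 The one-polymer catalogue of `B16Ineq197` induced by the gas of (1.90) -/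

variable {DomY Cube : Type*} [DecidableEq Cube] {adjC : Cube → Cube → Prop}
  {locX : LF → Finset Cube} {locY : DomY → Finset Cube} {Yfix : Finset Cube}

/-- **The sizes entering (1.92)–(1.96)** for the gas of (1.90): `dX X′` = d_{k,∪Y_i}(X′), `v X′` = M^{−d}|X′∖⋃Y_i| ≥ 0,
`dY Y` = d_{k,Z}(Y) ≥ 0 (= d_{k,Z′}(Y) for Y ⊂ X′), `treeX j` / `vol j` = tree cost / M^{−d}|X_j| of the operation domain
X_j — abstract real data of the cube geometry (cell DIVERGENCE D-b02.8/D-b02.14), the fields of `B16Ineq197.Polymer` made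
functions on the catalogue. [cite: Balaban1989LargeFieldII, (1.92) p.388] -/
structure Sizes (LF DomY Cube : Type*) where
  /-- d_{k,∪Y_i}(X′) -/
  dX : Finset Cube → ℝ
  /-- M^{−d}|X′∖⋃Y_i| -/
  v : Finset Cube → ℝ
  /-- d_{k,Z}(Y) -/
  dY : DomY → ℝ
  /-- tree cost of X_j (with its entry connector) -/
  treeX : LF → ℝ
  /-- M^{−d}|X_j| -/
  vol : LF → ℝ
  v_nonneg : ∀ X, 0 ≤ v X
  dY_nonneg : ∀ Y, 0 ≤ dY Y

variable (adjC locX locY Yfix) in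
open Classical in
/-- **The admissible pairs of one polymer X′** — *"{X_{j₁},…,X_{j_q}} and 𝐃 such that the connected localization domain
they determine is equal to X′"*: the index set of `F191` at X′. [cite: Balaban1989LargeFieldII, (1.91) p.388] -/
noncomputable def adm191 [Fintype LF] [Fintype DomY] [DecidableEq LF] [DecidableEq DomY] (X : Finset Cube) :
    Finset (Finset LF × Finset DomY) :=
  (Finset.univ ×ˢ Finset.univ).filter
    (fun p : Finset LF × Finset DomY => IsConnTerm adjC locX locY Yfix p.1 p.2 ∧ locDom locX locY p.1 p.2 = X)

/-- Membership in the admissible pairs of X′. [cite: Balaban1989LargeFieldII, (1.91) p.388] -/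
theorem mem_adm191 [Fintype LF] [Fintype DomY] [DecidableEq LF] [DecidableEq DomY] {X : Finset Cube}
    {p : Finset LF × Finset DomY} :
    p ∈ adm191 adjC locX locY Yfix X ↔ IsConnTerm adjC locX locY Yfix p.1 p.2 ∧ locDom locX locY p.1 p.2 = X := by
  unfold adm191
  simp only [Finset.mem_filter, Finset.mem_product, Finset.mem_univ, true_and]

/-- (1.91) summed over its admissible pairs: `F(X′) = Σ_{(S,𝐃) ∈ adm(X′)} term(S, 𝐃)`. [cite: Balaban1989LargeFieldII, (1.91) p.388] -/
theorem F191_eq_sum_adm191 [Fintype LF] [Fintype DomY] [DecidableEq LF] [DecidableEq DomY]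
    (term : Finset LF → Finset DomY → ℂ) (X : Finset Cube) :
    F191 adjC locX locY Yfix term X = ∑ p ∈ adm191 adjC locX locY Yfix X, term p.1 p.2 := by
  unfold F191 adm191
  rfl

variable (adjC locX locY Yfix) in
/-- **The one-polymer catalogue of `B16Ineq197` for the gas of (1.90)** at the polymer X′: candidates `cand` = the operation
domains X_j ⊆ X′, `Ycat` = the localization domains Y ⊆ X′, admissible pairs = `adm191 X′` (the connected terms with
localization domain X′), sizes from `Sizes`. [cite: Balaban1989LargeFieldII, (1.91) p.388] -/
noncomputable def polymer191 [Fintype LF] [Fintype DomY] [DecidableEq LF] [DecidableEq DomY]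
    (sz : Sizes LF DomY Cube) (X : Finset Cube) : B16Ineq197.Polymer LF DomY where
  cand := Finset.univ.filter (fun j => locX j ⊆ X)
  Ycat := Finset.univ.filter (fun Y => locY Y ⊆ X)
  adm := adm191 adjC locX locY Yfix X
  dX := sz.dX X
  v := sz.v X
  dY := sz.dY
  treeX := sz.treeX
  vol := sz.vol
  adm_fst := fun p hp j hj => by
    have hdom := (mem_adm191.1 hp).2
    refine Finset.mem_filter.2 ⟨Finset.mem_univ _, ?_⟩
    rw [← hdom]
    exact (Finset.subset_biUnion_of_mem locX hj).trans Finset.subset_union_left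
  adm_snd := fun p hp Y hY => by
    have hdom := (mem_adm191.1 hp).2
    refine Finset.mem_filter.2 ⟨Finset.mem_univ _, ?_⟩
    rw [← hdom]
    exact (Finset.subset_biUnion_of_mem locY hY).trans Finset.subset_union_right
  v_nonneg := sz.v_nonneg X
  dY_nonneg := fun Y _ => sz.dY_nonneg Y

/-- The admissible pairs of the induced catalogue are those of `F191`. [cite: Balaban1989LargeFieldII, (1.91) p.388] -/
theorem polymer191_adm [Fintype LF] [Fintype DomY] [DecidableEq LF] [DecidableEq DomY] (sz : Sizes LF DomY Cube)
    (X : Finset Cube) : (polymer191 adjC locX locY Yfix sz X).adm = adm191 adjC locX locY Yfix X := rfl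

/-- `F(X′)` is the sum of the term functional over the induced catalogue. [cite: Balaban1989LargeFieldII, (1.91) p.388] -/
theorem F191_eq_sum_polymer191 [Fintype LF] [Fintype DomY] [DecidableEq LF] [DecidableEq DomY] (sz : Sizes LF DomY Cube)
    (term : Finset LF → Finset DomY → ℂ) (X : Finset Cube) :
    F191 adjC locX locY Yfix term X = ∑ p ∈ (polymer191 adjC locX locY Yfix sz X).adm, term p.1 p.2 :=
  F191_eq_sum_adm191 term X

/-! ### H.4 (1.92) for the Mayer terms: *"Using (1.68), (1.73), (1.89), we obtain (1.92)"* -/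

/-- **(1.92) PROVED for the gas of (1.90)**: under the sup-norm bound of the operations (`OpBound Op θ` with `0 ≤ θ_j ≤ θ =
exp(−2(1+β₀)⁻¹p₀(g_k) + s)`, (1.73)·(1.89)) and the (1.68)-shaped bound `‖V(Y)‖ ≤ α exp(−(1+2β)κ d(Y))` of every
localization term, the Mayer terms `Op{X_j}[Π_{Y∈𝐃}∫₀¹dt e^{tV(Y)}V(Y)](φ)` of Part D obey the displayed majorant (1.92) =
`B16Ineq197.Polymer.Major192` of the induced catalogue: `|term(S,𝐃)| ≤ θ^{#S} Π_{Y∈𝐃} a(d(Y)) exp Σ_{Y∈𝐃} a(d(Y))`.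
[cite: Balaban1989LargeFieldII, (1.92) p.388] -/
theorem major192_mayerTerm [Fintype LF] [Fintype DomY] [DecidableEq LF] [DecidableEq DomY] (sz : Sizes LF DomY Cube)
    (K : B16Ineq197.Consts) {Op : Finset LF → (Φ → ℂ) →+ (Φ → ℂ)} {θ : LF → ℝ} (hOp : OpBound Op θ)
    (hθ : ∀ j, 0 ≤ θ j ∧ θ j ≤ K.θ) (hα : 0 ≤ K.α) {V : DomY → Φ → ℂ} (h168 : ∀ Y ψ, ‖V Y ψ‖ ≤ K.a (sz.dY Y))
    (φ : Φ) (X : Finset Cube) :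
    (polymer191 adjC locX locY Yfix sz X).Major192 K (fun p => mayerTerm Op V φ p.1 p.2) := by
  intro p _
  show ‖mayerTerm Op V φ p.1 p.2‖
    ≤ K.θ ^ p.1.card * (∏ Y ∈ p.2, K.a (sz.dY Y)) * Real.exp (∑ Y ∈ p.2, K.a (sz.dY Y))
  have hB : ∀ ψ, ‖∏ Y ∈ p.2, ∫ t in (0 : ℝ)..1, Complex.exp ((t : ℂ) * V Y ψ) * V Y ψ‖
      ≤ (∏ Y ∈ p.2, K.a (sz.dY Y)) * Real.exp (∑ Y ∈ p.2, K.a (sz.dY Y)) := fun ψ =>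
    norm_prod_integral_exp_mul_le p.2 V (fun Y => K.a (sz.dY Y)) ψ fun Y _ => h168 Y ψ
  have h1 := hOp p.1 _ _ hB φ
  have hθ' : ∏ j ∈ p.1, θ j ≤ K.θ ^ p.1.card := by
    rw [← Finset.prod_const]
    exact Finset.prod_le_prod (fun j _ => (hθ j).1) fun j _ => (hθ j).2
  have hnn : 0 ≤ (∏ Y ∈ p.2, K.a (sz.dY Y)) * Real.exp (∑ Y ∈ p.2, K.a (sz.dY Y)) :=
    mul_nonneg (Finset.prod_nonneg fun Y _ => B16Ineq197.Consts.a_nonneg hα _) (Real.exp_pos _).le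
  calc ‖mayerTerm Op V φ p.1 p.2‖
      ≤ (∏ j ∈ p.1, θ j) * ((∏ Y ∈ p.2, K.a (sz.dY Y)) * Real.exp (∑ Y ∈ p.2, K.a (sz.dY Y))) := h1
    _ ≤ K.θ ^ p.1.card * ((∏ Y ∈ p.2, K.a (sz.dY Y)) * Real.exp (∑ Y ∈ p.2, K.a (sz.dY Y))) :=
        mul_le_mul_of_nonneg_right hθ' hnn
    _ = _ := by ring

/-! ### H.5 The admissible pairs are nonempty; the p.389 selector «X′ ∩ ⋃Y_i ≠ ∅ ⇒ 𝐃 ≠ ∅» -/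

/-- Every connected term has an item: `S ≠ ∅` or `𝐃 ≠ ∅`. [cite: Balaban1989LargeFieldII, (1.91) p.388] -/
theorem isConnTerm_nonempty {S : Finset LF} {D : Finset DomY} (h : IsConnTerm adjC locX locY Yfix S D) :
    S.Nonempty ∨ D.Nonempty := by
  obtain ⟨u, hu⟩ := h.1
  rcases Finset.mem_disjSum.1 hu with ⟨a, ha, -⟩ | ⟨b, hb, -⟩
  · exact Or.inl ⟨a, ha⟩
  · exact Or.inr ⟨b, hb⟩

/-- **The first selector of p. 389, PROVED** (*"Either the domain X′ contains one of the domains Y_i, then the sum over q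
above begins with q = 0, but then c₀ = α^{1/3}"* — i.e. every admissible 𝐃 is nonempty): the operation domains X_j are
components of Z distinct from the Y_i (p. 378), hence disjoint from ⋃Y_i; so a term whose localization domain meets ⋃Y_i
owns a localization domain Y ∈ 𝐃. [cite: Balaban1989LargeFieldII, (1.97) p.389] -/
theorem snd_nonempty_of_meets (hXY : ∀ j, Disjoint (locX j) Yfix) {S : Finset LF} {D : Finset DomY} {X : Finset Cube}
    (hdom : locDom locX locY S D = X) (hX : ¬ Disjoint X Yfix) : D.Nonempty := by
  by_contra hD
  rw [Finset.not_nonempty_iff_eq_empty] at hD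
  subst hD
  apply hX
  rw [← hdom, locDom_empty_right, Finset.disjoint_biUnion_left]
  exact fun j _ => hXY j

/-! ### H.6 (1.97) with both selectors replaced by «every admissible pair is nonempty» (generic over `B16Ineq197.Polymer`) -/

/-- A one-polymer catalogue with its admissible pairs restricted to a sub-family (all sizes and leaves unchanged).
[cite: Balaban1989LargeFieldII, (1.91) p.388] -/
def restrictAdm (P : B16Ineq197.Polymer LF DomY) (q : Finset LF × Finset DomY → Prop) [DecidablePred q] :
    B16Ineq197.Polymer LF DomY where
  cand := P.cand
  Ycat := P.Ycat
  adm := P.adm.filter q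
  dX := P.dX
  v := P.v
  dY := P.dY
  treeX := P.treeX
  vol := P.vol
  adm_fst := fun p hp => P.adm_fst p (Finset.mem_filter.1 hp).1
  adm_snd := fun p hp => P.adm_snd p (Finset.mem_filter.1 hp).1
  v_nonneg := P.v_nonneg
  dY_nonneg := P.dY_nonneg

/-- **(1.97) with `c₁ = exp(−p₀(g_k)) + α^{1/3}` for EVERY polymer**: if every admissible pair has an operation domain or a
localization domain (no selector facts needed), then the leaves of `B16Ineq197` give `|Σ_{adm} term| ≤ (e^{−p₀(g_k)} +
α^{1/3}) exp(−(1+β)κ d_{k,∪Y_i}(X′))` — the sum split into the pairs with `q ≥ 1` (sibling's case c₁ = e^{−p₀(g_k)}) and those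
with `q = 0`, hence `𝐃 ≠ ∅` (case c₁ = α^{1/3}). [cite: Balaban1989LargeFieldII, (1.97) p.389] -/
theorem norm_sum_adm_le_of_nonempty [DecidableEq LF] [DecidableEq DomY] (P : B16Ineq197.Polymer LF DomY)
    (K : B16Ineq197.Consts) (hK : K.Small) (hS : P.Subadd193 K) (hV : P.Vol193 K) (hX : P.XBudget K)
    (h194 : P.Anch194 K) (h196 : P.Count196 K) {term : Finset LF × Finset DomY → ℂ} (h192 : P.Major192 K term)
    (hne : ∀ p ∈ P.adm, p.1.Nonempty ∨ p.2.Nonempty) :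
    ‖∑ p ∈ P.adm, term p‖
      ≤ (Real.exp (-K.p0) + K.α ^ (1 / 3 : ℝ)) * Real.exp (-((1 + K.β) * K.κ) * P.dX) := by
  classical
  have hsplit : ∑ p ∈ P.adm, term p
      = ∑ p ∈ (restrictAdm P (fun p => p.1.Nonempty)).adm, term p
        + ∑ p ∈ (restrictAdm P (fun p => ¬ p.1.Nonempty)).adm, term p :=
    (Finset.sum_filter_add_sum_filter_not P.adm (fun p => p.1.Nonempty) term).symm
  have hB : ‖∑ p ∈ (restrictAdm P (fun p => p.1.Nonempty)).adm, term p‖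
      ≤ Real.exp (-K.p0) * Real.exp (-((1 + K.β) * K.κ) * P.dX) :=
    B16Ineq197.Polymer.norm_sum_le_of_not_meets (restrictAdm P (fun p => p.1.Nonempty)) K hK
      (fun p hp => hS p (Finset.mem_filter.1 hp).1) (fun p hp => hV p (Finset.mem_filter.1 hp).1) hX h194 h196
      (fun p hp => h192 p (Finset.mem_filter.1 hp).1) (fun p hp => (Finset.mem_filter.1 hp).2)
  have hA : ‖∑ p ∈ (restrictAdm P (fun p => ¬ p.1.Nonempty)).adm, term p‖
      ≤ K.α ^ (1 / 3 : ℝ) * Real.exp (-((1 + K.β) * K.κ) * P.dX) :=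
    B16Ineq197.Polymer.norm_sum_le_of_meets (restrictAdm P (fun p => ¬ p.1.Nonempty)) K hK
      (fun p hp => hS p (Finset.mem_filter.1 hp).1) (fun p hp => hV p (Finset.mem_filter.1 hp).1) hX h194 h196
      (fun p hp => h192 p (Finset.mem_filter.1 hp).1)
      (fun p hp => (hne p (Finset.mem_filter.1 hp).1).resolve_left (Finset.mem_filter.1 hp).2)
  calc ‖∑ p ∈ P.adm, term p‖
      = ‖∑ p ∈ (restrictAdm P (fun p => p.1.Nonempty)).adm, term p
          + ∑ p ∈ (restrictAdm P (fun p => ¬ p.1.Nonempty)).adm, term p‖ := by rw [hsplit]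
    _ ≤ ‖∑ p ∈ (restrictAdm P (fun p => p.1.Nonempty)).adm, term p‖
          + ‖∑ p ∈ (restrictAdm P (fun p => ¬ p.1.Nonempty)).adm, term p‖ := norm_add_le _ _
    _ ≤ Real.exp (-K.p0) * Real.exp (-((1 + K.β) * K.κ) * P.dX)
          + K.α ^ (1 / 3 : ℝ) * Real.exp (-((1 + K.β) * K.κ) * P.dX) := add_le_add hB hA
    _ = _ := by ring

/-! ### H.7 (1.97) for the activities `F191 (mayerTerm Op V φ)` of the gas of (1.90) -/

/-- The admissible pairs of a polymer are nonempty terms. [cite: Balaban1989LargeFieldII, (1.91) p.388] -/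
theorem adm191_nonempty [Fintype LF] [Fintype DomY] [DecidableEq LF] [DecidableEq DomY] {X : Finset Cube}
    {p : Finset LF × Finset DomY} (hp : p ∈ adm191 adjC locX locY Yfix X) : p.1.Nonempty ∨ p.2.Nonempty :=
  isConnTerm_nonempty (mem_adm191.1 hp).1

/-- **(1.97) for the gas of (1.90), selector-free** — `|F(X′)| ≤ (e^{−p₀(g_k)} + α^{1/3}) exp(−(1+β)κ d_{k,∪Y_i}(X′))` for
EVERY polymer X′: from the sup-norm bound of the operations ((1.73)·(1.89)), the (1.68)-shaped bound of the `V(Y)`, the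
geometric leaves of `B16Ineq197` for the induced catalogue at X′ and the smallness clauses `Consts.Small` of pp. 388–389;
(1.92) is `major192_mayerTerm`, (1.93)–(1.96) are the sibling's. [cite: Balaban1989LargeFieldII, (1.97) p.389] -/
theorem norm_F191_mayerTerm_le [Fintype LF] [Fintype DomY] [DecidableEq LF] [DecidableEq DomY]
    (sz : Sizes LF DomY Cube) (K : B16Ineq197.Consts) (hK : K.Small)
    {Op : Finset LF → (Φ → ℂ) →+ (Φ → ℂ)} {θ : LF → ℝ} (hOp : OpBound Op θ) (hθ : ∀ j, 0 ≤ θ j ∧ θ j ≤ K.θ)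
    {V : DomY → Φ → ℂ} (h168 : ∀ Y ψ, ‖V Y ψ‖ ≤ K.a (sz.dY Y)) (φ : Φ) {X : Finset Cube}
    (h193s : (polymer191 adjC locX locY Yfix sz X).Subadd193 K)
    (h193v : (polymer191 adjC locX locY Yfix sz X).Vol193 K)
    (hXB : (polymer191 adjC locX locY Yfix sz X).XBudget K)
    (h194 : (polymer191 adjC locX locY Yfix sz X).Anch194 K)
    (h196 : (polymer191 adjC locX locY Yfix sz X).Count196 K) :
    ‖F191 adjC locX locY Yfix (mayerTerm Op V φ) X‖
      ≤ (Real.exp (-K.p0) + K.α ^ (1 / 3 : ℝ)) * Real.exp (-((1 + K.β) * K.κ) * sz.dX X) := by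
  rw [F191_eq_sum_polymer191 sz]
  exact norm_sum_adm_le_of_nonempty _ K hK h193s h193v hXB h194 h196
    (major192_mayerTerm sz K hOp hθ hK.α_pos.le h168 φ X) (fun p hp => adm191_nonempty hp)

/-- **(1.97) for the gas of (1.90), case X′ ∩ ⋃Y_i ≠ ∅: `c₁ = α^{1/3}`** (the selector PROVED, `snd_nonempty_of_meets`, from
the disjointness of the operation domains X_j from ⋃Y_i). [cite: Balaban1989LargeFieldII, (1.97) p.389] -/
theorem norm_F191_mayerTerm_le_of_meets [Fintype LF] [Fintype DomY] [DecidableEq LF] [DecidableEq DomY]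
    (sz : Sizes LF DomY Cube) (K : B16Ineq197.Consts) (hK : K.Small)
    {Op : Finset LF → (Φ → ℂ) →+ (Φ → ℂ)} {θ : LF → ℝ} (hOp : OpBound Op θ) (hθ : ∀ j, 0 ≤ θ j ∧ θ j ≤ K.θ)
    {V : DomY → Φ → ℂ} (h168 : ∀ Y ψ, ‖V Y ψ‖ ≤ K.a (sz.dY Y)) (φ : Φ)
    (hXY : ∀ j, Disjoint (locX j) Yfix) {X : Finset Cube} (hXfix : ¬ Disjoint X Yfix)
    (h193s : (polymer191 adjC locX locY Yfix sz X).Subadd193 K)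
    (h193v : (polymer191 adjC locX locY Yfix sz X).Vol193 K)
    (hXB : (polymer191 adjC locX locY Yfix sz X).XBudget K)
    (h194 : (polymer191 adjC locX locY Yfix sz X).Anch194 K)
    (h196 : (polymer191 adjC locX locY Yfix sz X).Count196 K) :
    ‖F191 adjC locX locY Yfix (mayerTerm Op V φ) X‖
      ≤ K.α ^ (1 / 3 : ℝ) * Real.exp (-((1 + K.β) * K.κ) * sz.dX X) := by
  rw [F191_eq_sum_polymer191 sz]
  exact B16Ineq197.Polymer.norm_sum_le_of_meets _ K hK h193s h193v hXB h194 h196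
    (major192_mayerTerm sz K hOp hθ hK.α_pos.le h168 φ X)
    (fun p hp => snd_nonempty_of_meets hXY (mem_adm191.1 hp).2 hXfix)

/-- **(1.97) for the gas of (1.90), case X′ ∩ ⋃Y_i = ∅: `c₁ = exp(−p₀(g_k))`** under the second selector of p. 389 as the
explicit hypothesis `hsel` (*"or the domain X′ is disjoint with ⋃_{i=1}^m Y_i, and then the sum begins with q = 1"*: every
connected term whose localization domain misses ⋃Y_i owns an operation domain — in print a consequence of the structure of
𝐃_k described on p. 377, not carried by the abstract catalogue). [cite: Balaban1989LargeFieldII, (1.97) p.389] -/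
theorem norm_F191_mayerTerm_le_of_not_meets [Fintype LF] [Fintype DomY] [DecidableEq LF] [DecidableEq DomY]
    (sz : Sizes LF DomY Cube) (K : B16Ineq197.Consts) (hK : K.Small)
    {Op : Finset LF → (Φ → ℂ) →+ (Φ → ℂ)} {θ : LF → ℝ} (hOp : OpBound Op θ) (hθ : ∀ j, 0 ≤ θ j ∧ θ j ≤ K.θ)
    {V : DomY → Φ → ℂ} (h168 : ∀ Y ψ, ‖V Y ψ‖ ≤ K.a (sz.dY Y)) (φ : Φ)
    (hsel : ∀ (S : Finset LF) (D : Finset DomY), IsConnTerm adjC locX locY Yfix S D →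
      Disjoint (locDom locX locY S D) Yfix → S.Nonempty)
    {X : Finset Cube} (hXfix : Disjoint X Yfix)
    (h193s : (polymer191 adjC locX locY Yfix sz X).Subadd193 K)
    (h193v : (polymer191 adjC locX locY Yfix sz X).Vol193 K)
    (hXB : (polymer191 adjC locX locY Yfix sz X).XBudget K)
    (h194 : (polymer191 adjC locX locY Yfix sz X).Anch194 K)
    (h196 : (polymer191 adjC locX locY Yfix sz X).Count196 K) :
    ‖F191 adjC locX locY Yfix (mayerTerm Op V φ) X‖
      ≤ Real.exp (-K.p0) * Real.exp (-((1 + K.β) * K.κ) * sz.dX X) := by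
  rw [F191_eq_sum_polymer191 sz]
  refine B16Ineq197.Polymer.norm_sum_le_of_not_meets _ K hK h193s h193v hXB h194 h196
    (major192_mayerTerm sz K hOp hθ hK.α_pos.le h168 φ X) (fun p hp => ?_)
  obtain ⟨hconn, hdom⟩ := mem_adm191.1 hp
  exact hsel p.1 p.2 hconn (hdom.symm ▸ hXfix)

/-- **Unit b02's leaf `B16.Ineq197` INHABITED by the gas of (1.90)**: for any relative domain system `S` whose domains name
cube families (`cubesOf`) with `S.dRel` = the relative size `d_{k,∪Y_i}` and `S.MeetsLF` = "meets ⋃Y_i", the activities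
`F(X′, φ) = F191 (mayerTerm Op V φ) X′` satisfy (1.97) exactly as quoted in `B16.lean` (`c₁ = exp(−p₀(g_k))` off ⋃Y_i under
the printed selector `hsel`, `c₁ = α^{1/3}` on ⋃Y_i), from the operator and (1.68) leaves, the geometric leaves of
`B16Ineq197` for every polymer, and `Consts.Small`. [cite: Balaban1989LargeFieldII, (1.97) p.390] -/
theorem ineq197_gas [Fintype LF] [Fintype DomY] [DecidableEq LF] [DecidableEq DomY]
    (sz : Sizes LF DomY Cube) (K : B16Ineq197.Consts) (hK : K.Small)
    {Op : Finset LF → (Φ → ℂ) →+ (Φ → ℂ)} {θ : LF → ℝ} (hOp : OpBound Op θ) (hθ : ∀ j, 0 ≤ θ j ∧ θ j ≤ K.θ)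
    {V : DomY → Φ → ℂ} (h168 : ∀ Y ψ, ‖V Y ψ‖ ≤ K.a (sz.dY Y)) (hXY : ∀ j, Disjoint (locX j) Yfix)
    (hsel : ∀ (S : Finset LF) (D : Finset DomY), IsConnTerm adjC locX locY Yfix S D →
      Disjoint (locDom locX locY S D) Yfix → S.Nonempty)
    (h193s : ∀ X, (polymer191 adjC locX locY Yfix sz X).Subadd193 K)
    (h193v : ∀ X, (polymer191 adjC locX locY Yfix sz X).Vol193 K)
    (hXB : ∀ X, (polymer191 adjC locX locY Yfix sz X).XBudget K)
    (h194 : ∀ X, (polymer191 adjC locX locY Yfix sz X).Anch194 K)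
    (h196 : ∀ X, (polymer191 adjC locX locY Yfix sz X).Count196 K)
    (S : B16.RelDomainSys) (cubesOf : S.Dom → Finset Cube) (hdRel : ∀ Z, S.dRel Z = sz.dX (cubesOf Z))
    (hmeets : ∀ Z, S.MeetsLF Z ↔ ¬ Disjoint (cubesOf Z) Yfix) (dom : S.Dom → Set Φ) :
    B16.Ineq197 S dom (fun Z φ => F191 adjC locX locY Yfix (mayerTerm Op V φ) (cubesOf Z)) K.p0 K.α K.β K.κ := by
  refine ⟨fun Z hZ φ _ => ?_, fun Z hZ φ _ => ?_⟩
  · rw [hdRel]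
    exact norm_F191_mayerTerm_le_of_not_meets sz K hK hOp hθ h168 φ hsel (not_not.1 ((hmeets Z).not.1 hZ))
      (h193s _) (h193v _) (hXB _) (h194 _) (h196 _)
  · rw [hdRel]
    exact norm_F191_mayerTerm_le_of_meets sz K hK hOp hθ h168 φ hXY ((hmeets Z).1 hZ)
      (h193s _) (h193v _) (hXB _) (h194 _) (h196 _)

/-! ### H.8 (1.98) and (1.99) for the curly bracket of (1.72) with (1.97) discharged -/

section Knitting

open Literature.MathematicalPhysics.QuantumFieldTheory.Balaban1983to89.B13FamilySum (Ineq126 VolBound)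
open Literature.MathematicalPhysics.QuantumFieldTheory.Balaban1983to89.B16Exp198 (locR RelSubadd)

variable {Var Sv : Type*} {site : Var → Cube}

/-- **(1.72) ⇒ (1.98) for the curly bracket, with the activity bound (1.97) DISCHARGED**: as Part F's
`bracket_eq_exp_sum_locR_of_localOps` (locality `LocalOps` of the operations, localization `DepOn` of the `V(Y)`, the
relative leaves (1.26)_rel / volume bound of the catalogue in the size `d_{k,∪Y_i}`, footprint-local adjacency, the
Kotecký–Preiss constants), its hypothesis `h197` now PROVED (`norm_F191_mayerTerm_le`) from the sup-norm bound of the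
operations, the (1.68)-shaped bound of the `V(Y)`, the geometric leaves of `B16Ineq197` for every polymer and `Consts.Small`:
`{⋯} = exp Σ_X 𝐑′^{(k)}(X)` with `c₁ = e^{−p₀(g_k)} + α^{1/3}`, `R = (1+β)κ` in the KP clauses `κ₀ + τc_v ≤ (1+β)κ`,
`c₁e^{τc_v}K₀ν ≤ τ`. [cite: Balaban1989LargeFieldII, (1.98) p.390] -/
theorem bracket_eq_exp_sum_locR_of_leaves [Fintype LF] [Fintype DomY] [Fintype Cube] [DecidableEq LF]
    [DecidableEq DomY] [DecidableRel adjC] (hrefl : ∀ a, adjC a a) (hsymm : ∀ a b, adjC a b → adjC b a)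
    (houtX : ∀ j, (locX j \ Yfix).Nonempty) (houtY : ∀ Y, (locY Y \ Yfix).Nonempty)
    {Op : Finset LF → ((Var → Sv) → ℂ) →+ ((Var → Sv) → ℂ)} (hOps : LocalOps adjC locX Yfix site Op)
    {θ : LF → ℝ} (hOp : OpBound Op θ) (sz : Sizes LF DomY Cube) (K : B16Ineq197.Consts) (hK : K.Small)
    (hθ : ∀ j, 0 ≤ θ j ∧ θ j ≤ K.θ) {V : DomY → (Var → Sv) → ℂ} (hV : ∀ Y, DepOn Yfix site (V Y) (locY Y))
    (h168 : ∀ Y ψ, ‖V Y ψ‖ ≤ K.a (sz.dY Y)) (φ : Var → Sv)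
    (h193s : ∀ X, (polymer191 adjC locX locY Yfix sz X).Subadd193 K)
    (h193v : ∀ X, (polymer191 adjC locX locY Yfix sz X).Vol193 K)
    (hXB : ∀ X, (polymer191 adjC locX locY Yfix sz X).XBudget K)
    (h194 : ∀ X, (polymer191 adjC locX locY Yfix sz X).Anch194 K)
    (h196 : ∀ X, (polymer191 adjC locX locY Yfix sz X).Count196 K)
    {nbr : Cube → Finset Cube} (hnbr : ∀ a b, adjC a b → a ∈ nbr b) {ν : ℝ} (hν : ∀ b, ((nbr b).card : ℝ) ≤ ν)
    {κ₀ K₀ cv τ : ℝ} (hdX : ∀ X, 0 ≤ sz.dX X) (hK₀ : 0 ≤ K₀) (hτ : 0 ≤ τ)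
    (h126 : Ineq126 (polys190 adjC locX locY Yfix) (fun X => X \ Yfix) sz.dX κ₀ K₀)
    (hvol : VolBound (polys190 adjC locX locY Yfix) (fun X => X \ Yfix) sz.dX cv)
    (hrate : κ₀ + τ * cv ≤ (1 + K.β) * K.κ)
    (hsmall : (Real.exp (-K.p0) + K.α ^ (1 / 3 : ℝ)) * Real.exp (τ * cv) * K₀ * ν ≤ τ) :
    bracket Op V φ
      = Complex.exp (∑ X ∈ (polys190 adjC locX locY Yfix).powerset.image (fun C => C.biUnion id),
          locR (pinc adjC Yfix) (polys190 adjC locX locY Yfix) id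
            (F191 adjC locX locY Yfix (mayerTerm Op V φ)) X) :=
  bracket_eq_exp_sum_locR_of_localOps hrefl hsymm houtX houtY hOps hV φ hnbr hν hdX
    (add_nonneg (Real.exp_pos _).le (Real.rpow_nonneg hK.α_pos.le _)) hK₀ hτ
    (fun X => by
      rw [← neg_mul]
      exact norm_F191_mayerTerm_le sz K hK hOp hθ h168 φ (h193s X) (h193v X) (hXB X) (h194 X) (h196 X))
    h126 hvol hrate hsmall

/-- **(1.99) for the gas of (1.90) with (1.97) DISCHARGED, kernel form**: as Part G's `norm_locR190_le` (a union `X` of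
polymers owning an outside cube `q₀`, relative cluster subadditivity `RelSubadd` with junction cost `c`, the relative leaves,
`r₁c ≤ b`, `r₁ + 2κ₀ + 2 ≤ (1+β)κ`, `c₁e^{b+1}K₀νc_v ≤ 1`), its hypothesis `h197` PROVED for the Mayer terms:
`|𝐑′^{(k)}(X)| ≤ (eνc_vK₀²)·(e^{−p₀(g_k)} + α^{1/3})·e^{−r₁ dX}`. [cite: Balaban1989LargeFieldII, (1.99) p.390] -/
theorem norm_locR190_le_of_leaves [Fintype LF] [Fintype DomY] [Fintype Cube] [DecidableEq LF] [DecidableEq DomY]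
    [DecidableRel adjC] (hrefl : ∀ a, adjC a a) (hsymm : ∀ a b, adjC a b → adjC b a)
    (houtX : ∀ j, (locX j \ Yfix).Nonempty) (houtY : ∀ Y, (locY Y \ Yfix).Nonempty)
    {Op : Finset LF → (Φ → ℂ) →+ (Φ → ℂ)} {θ : LF → ℝ} (hOp : OpBound Op θ) (sz : Sizes LF DomY Cube)
    (K : B16Ineq197.Consts) (hK : K.Small) (hθ : ∀ j, 0 ≤ θ j ∧ θ j ≤ K.θ) {V : DomY → Φ → ℂ}
    (h168 : ∀ Y ψ, ‖V Y ψ‖ ≤ K.a (sz.dY Y)) (φ : Φ)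
    (h193s : ∀ X, (polymer191 adjC locX locY Yfix sz X).Subadd193 K)
    (h193v : ∀ X, (polymer191 adjC locX locY Yfix sz X).Vol193 K)
    (hXB : ∀ X, (polymer191 adjC locX locY Yfix sz X).XBudget K)
    (h194 : ∀ X, (polymer191 adjC locX locY Yfix sz X).Anch194 K)
    (h196 : ∀ X, (polymer191 adjC locX locY Yfix sz X).Count196 K)
    {nbr : Cube → Finset Cube} (hnbr : ∀ a b, adjC a b → a ∈ nbr b) {ν : ℝ} (hν : ∀ b, ((nbr b).card : ℝ) ≤ ν)
    (hν0 : 0 ≤ ν) {r₁ κ₀ K₀ cv c b dX : ℝ} {X : Finset Cube} {q₀ : Cube}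
    (hdX : ∀ Z, 0 ≤ sz.dX Z) (hK₀ : 0 ≤ K₀) (hcv : 0 ≤ cv) (hκ₀ : 0 ≤ κ₀) (hr₁ : 0 ≤ r₁) (hc : 0 ≤ c)
    (hb : r₁ * c ≤ b)
    (h126 : Ineq126 (polys190 adjC locX locY Yfix) (fun Z => Z \ Yfix) sz.dX κ₀ K₀)
    (hvol : VolBound (polys190 adjC locX locY Yfix) (fun Z => Z \ Yfix) sz.dX cv)
    (hsub : RelSubadd (pinc adjC Yfix) (polys190 adjC locX locY Yfix) id sz.dX X dX c)
    (hrate : r₁ + 2 * κ₀ + 2 ≤ (1 + K.β) * K.κ)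
    (hsmall : (Real.exp (-K.p0) + K.α ^ (1 / 3 : ℝ)) * Real.exp (b + 1) * K₀ * ν * cv ≤ 1)
    (hq₀X : q₀ ∈ X) (hq₀ : q₀ ∉ Yfix) :
    ‖locR (pinc adjC Yfix) (polys190 adjC locX locY Yfix) id (F191 adjC locX locY Yfix (mayerTerm Op V φ)) X‖
      ≤ Real.exp 1 * ν * cv * K₀ ^ 2 * (Real.exp (-K.p0) + K.α ^ (1 / 3 : ℝ)) * Real.exp (-(r₁ * dX)) :=
  norm_locR190_le hrefl hsymm houtX houtY (mayerTerm Op V φ) hnbr hν hν0 hdX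
    (add_nonneg (Real.exp_pos _).le (Real.rpow_nonneg hK.α_pos.le _)) hK₀ hcv hκ₀ hr₁ hc hb
    (fun Z _ _ => by
      rw [← neg_mul]
      exact norm_F191_mayerTerm_le sz K hK hOp hθ h168 φ (h193s Z) (h193v Z) (hXB Z) (h194 Z) (h196 Z))
    h126 hvol hsub hrate hsmall hq₀X hq₀

end Knitting

end Ineq197Gas

/-! ## Part I. Configuration-dependent localization terms (pp. 377, 379): the second selector of p. 389 DERIVED (v1.5)

p. 379, verbatim: *"Notice that the terms V(Y, U_k) depend on the sequence {Ω_j^c, Z_j} restricted to the components of Z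
contained in Y"*; p. 377, verbatim: *"Thus, after all these resummations we obtain a sum of expressions, the summation is
over domains Y ∈ 𝐃_k satisfying the property that the intersection Y ∩ Z^~ is a union of components of Z^~, containing at
least one component."*  Parts D–H take the localization terms `V(Y)` of the curly bracket of (1.72) independent of the family
`{X_j}` of operation domains (class-1 components) of the term (cell DIVERGENCE D-b02.14).  Here they may depend on it —
`V S Y` — but only through the operation domains CONTAINED IN `Y` (`VLocal`, the p. 379 sentence), and they vanish unless
`Y` contains an operation domain of the family or meets an anchor cube set `A` (`VSupp A`, the abstract form of the p. 377
index condition: `A` = the cubes of ⋃Y_i, plus those of the step's new region Z_k if any).  Under these structural hypotheses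
the Mayer step and the factorization in the components go through (`bracketS_eq_sum_mayerTermS`, `termMul_mayerTermS`:
an operation domain contained in a localization domain is linked to it), hence (1.90) and (1.98) for the
configuration-dependent bracket (`eq190_bracketS_of_localOps`, `bracketS_eq_exp_sum_locR_of_localOps`); (1.92) is Part H's
termwise (`major192_mayerTermS`); and the SECOND selector of p. 389 — *"or the domain X′ is disjoint with ⋃_{i=1}^m Y_i,
and then the sum begins with q = 1"* — becomes a THEOREM: a connected term without operation domains whose localization
domain misses the anchors VANISHES (`mayerTermS_eq_zero_of_empty`).  So (1.97) holds in both printed cases with NO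
selector hypothesis (`norm_F191_mayerTermS_le_of_not_meets`: c₁ = e^{−p₀(g_k)} off the anchors; `…_of_meets`: c₁ = α^{1/3}
on ⋃Y_i; `norm_F191_mayerTermS_le`: c₁ = e^{−p₀(g_k)} + α^{1/3} everywhere), unit b02's leaf `B16.Ineq197` is inhabited by
this gas from the analytic and geometric leaves alone when the anchors are the fixed regions (`ineq197_gasS`), and
(1.72) ⇒ (1.98) holds with `c₁ = e^{−p₀(g_k)} + α^{1/3}` (`bracketS_eq_exp_sum_locR_of_leaves`).  The structural hypotheses
are consistent (`switchOn`: `vLocal_switchOn`, `vSupp_switchOn`, with the majorant and the localization of the underlying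
configuration-independent terms, `norm_switchOn_le`, `depOn_switchOn`). -/

section ConfigDependent

variable {LF DomY Cube Φ : Type*} [DecidableEq Cube] {adjC : Cube → Cube → Prop}
  {locX : LF → Finset Cube} {locY : DomY → Finset Cube} {Yfix : Finset Cube}

/-! ### I.1 The configuration-dependent curly bracket and its Mayer terms -/

/-- **The curly bracket of (1.72) with configuration-dependent localization terms**:
`{Σ_{{X_j}} Π_j 𝐓′_k(X_j) exp Σ_Y V_{{X_j}}(Y, U_k)}` — the terms `V S Y` of the family `S = {X_j}` (p. 379: they
*"depend on the sequence {Ω_j^c, Z_j} restricted to the components of Z contained in Y"*). [cite: Balaban1989LargeFieldII, (1.72) p.379] -/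
noncomputable def bracketS [Fintype LF] [Fintype DomY] (Op : Finset LF → (Φ → ℂ) →+ (Φ → ℂ))
    (V : Finset LF → DomY → Φ → ℂ) (φ : Φ) : ℂ :=
  ∑ S : Finset LF, Op S (fun ψ => Complex.exp (∑ Y : DomY, V S Y ψ)) φ

/-- The Mayer term of `({X_j}_{j∈S}, 𝐃)` for configuration-dependent localization terms: Part D's `mayerTerm` with
`V = V S`. [cite: Balaban1989LargeFieldII, (1.91) p.388] -/
noncomputable def mayerTermS (Op : Finset LF → (Φ → ℂ) →+ (Φ → ℂ)) (V : Finset LF → DomY → Φ → ℂ) (φ : Φ)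
    (S : Finset LF) (D : Finset DomY) : ℂ :=
  Op S (fun ψ => ∏ Y ∈ D, ∫ t in (0 : ℝ)..1, Complex.exp ((t : ℂ) * V S Y ψ) * V S Y ψ) φ

/-- `mayerTermS` is `mayerTerm` at the family's own localization terms. [cite: Balaban1989LargeFieldII, (1.91) p.388] -/
theorem mayerTermS_eq (Op : Finset LF → (Φ → ℂ) →+ (Φ → ℂ)) (V : Finset LF → DomY → Φ → ℂ) (φ : Φ)
    (S : Finset LF) (D : Finset DomY) : mayerTermS Op V φ S D = mayerTerm Op (V S) φ S D := rfl

/-- **The Mayer step for the configuration-dependent bracket** (as `bracket_eq_sum_mayerTerm`, family by family).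
[cite: Balaban1989LargeFieldII, (1.90) p.388] -/
theorem bracketS_eq_sum_mayerTermS [Fintype LF] [Fintype DomY] (Op : Finset LF → (Φ → ℂ) →+ (Φ → ℂ))
    (V : Finset LF → DomY → Φ → ℂ) (φ : Φ) :
    bracketS Op V φ = ∑ S : Finset LF, ∑ D : Finset DomY, mayerTermS Op V φ S D := by
  classical
  unfold bracketS mayerTermS
  refine Finset.sum_congr rfl fun S _ => ?_
  have hfun : (fun ψ => Complex.exp (∑ Y : DomY, V S Y ψ))
      = ∑ D : Finset DomY, fun ψ => ∏ Y ∈ D, ∫ t in (0 : ℝ)..1, Complex.exp ((t : ℂ) * V S Y ψ) * V S Y ψ := by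
    funext ψ
    rw [Finset.sum_apply, B13MayerDecoupling.mayer_expansion_21 (Finset.univ : Finset DomY) (fun Y => V S Y ψ),
      Finset.powerset_univ]
  rw [hfun, map_sum, Finset.sum_apply]

/-! ### I.2 The two structural hypotheses on the localization terms -/

variable (locX locY) in
/-- **Locality of the configuration-dependence** (p. 379: *"the terms V(Y, U_k) depend on the sequence {Ω_j^c, Z_j}
restricted to the components of Z contained in Y"*): `V S Y` depends on the family `S` only through the operation domains
`X_j ⊆ Y`. [cite: Balaban1989LargeFieldII, (1.72) p.379] -/
def VLocal (V : Finset LF → DomY → Φ → ℂ) : Prop :=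
  ∀ (S S' : Finset LF) (Y : DomY), (∀ j, locX j ⊆ locY Y → (j ∈ S ↔ j ∈ S')) → V S Y = V S' Y

variable (locX locY) in
/-- **The index condition of the localization terms** (p. 377: *"the summation is over domains Y ∈ 𝐃_k satisfying the
property that the intersection Y ∩ Z^~ is a union of components of Z^~, containing at least one component"*), abstract
form with an ANCHOR cube set `A`: `V S Y` vanishes unless `Y` contains an operation domain of the family `S` or meets `A`.
Print's anchors are the components of Z^~ other than the X_j^~ — the fixed regions Y_i (then `A = Yfix`, the cubes of
⋃Y_i: a domain containing a component Y_i^~ meets Y_i) and, if the step created one, the new region Z_k (`A = Yfix ∪ Z_k`).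
[cite: Balaban1989LargeFieldII, (1.68) p.377] -/
def VSupp (A : Finset Cube) (V : Finset LF → DomY → Φ → ℂ) : Prop :=
  ∀ (S : Finset LF) (Y : DomY), Disjoint (locY Y) A → (∀ j ∈ S, ¬ locX j ⊆ locY Y) → V S Y = 0

/-- An operation domain contained in a localization domain is linked to it (it owns a cube outside ⋃Y_i, which is then a
common outside cube). [cite: Balaban1989LargeFieldII, (1.90) p.388] -/
theorem olink_of_subset (hrefl : ∀ a, adjC a a) (houtX : ∀ j, (locX j \ Yfix).Nonempty) {j : LF} {Y : DomY}
    (h : locX j ⊆ locY Y) : olink adjC (locI locX locY) Yfix (Sum.inl j) (Sum.inr Y) := by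
  obtain ⟨c, hc⟩ := houtX j
  refine ⟨c, hc, c, ?_, hrefl c⟩
  show c ∈ locY Y \ Yfix
  exact Finset.mem_sdiff.2 ⟨h (Finset.mem_sdiff.1 hc).1, (Finset.mem_sdiff.1 hc).2⟩

/-- Under `VLocal`, the localization terms of a union of two mutually unlinked terms are those of the first term on its own
localization domains … [cite: Balaban1989LargeFieldII, (1.90) p.388] -/
theorem VLocal.eq_left [DecidableEq LF] (hrefl : ∀ a, adjC a a) (hsymm : ∀ a b, adjC a b → adjC b a)
    (houtX : ∀ j, (locX j \ Yfix).Nonempty) {V : Finset LF → DomY → Φ → ℂ} (hVl : VLocal locX locY V)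
    {S₁ S₂ : Finset LF} {D₁ D₂ : Finset DomY}
    (hunl : ∀ u ∈ items S₁ D₁, ∀ v ∈ items S₂ D₂, ¬ olink adjC (locI locX locY) Yfix u v) {Y : DomY} (hY : Y ∈ D₁) :
    V (S₁ ∪ S₂) Y = V S₁ Y := by
  refine hVl _ _ Y fun j hj => ⟨fun hj12 => ?_, fun h1 => Finset.mem_union_left _ h1⟩
  rcases Finset.mem_union.1 hj12 with h | h
  · exact h
  · exact absurd (olink_symm hsymm _ _ (olink_of_subset hrefl houtX hj))
      (hunl (Sum.inr Y) (Finset.inr_mem_disjSum.2 hY) (Sum.inl j) (Finset.inl_mem_disjSum.2 h))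

/-- … and those of the second term on its own localization domains. [cite: Balaban1989LargeFieldII, (1.90) p.388] -/
theorem VLocal.eq_right [DecidableEq LF] (hrefl : ∀ a, adjC a a) (houtX : ∀ j, (locX j \ Yfix).Nonempty)
    {V : Finset LF → DomY → Φ → ℂ} (hVl : VLocal locX locY V) {S₁ S₂ : Finset LF} {D₁ D₂ : Finset DomY}
    (hunl : ∀ u ∈ items S₁ D₁, ∀ v ∈ items S₂ D₂, ¬ olink adjC (locI locX locY) Yfix u v) {Y : DomY} (hY : Y ∈ D₂) :
    V (S₁ ∪ S₂) Y = V S₂ Y := by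
  refine hVl _ _ Y fun j hj => ⟨fun hj12 => ?_, fun h2 => Finset.mem_union_right _ h2⟩
  rcases Finset.mem_union.1 hj12 with h | h
  · exact absurd (olink_of_subset hrefl houtX hj)
      (hunl (Sum.inl j) (Finset.inl_mem_disjSum.2 h) (Sum.inr Y) (Finset.inr_mem_disjSum.2 hY))
  · exact h

/-! ### I.3 The factorization in the components for configuration-dependent terms, (1.90), (1.98) -/

section LocalityS

open Literature.Probability.LatticeModels (polymerPartitionFunction)
open Literature.MathematicalPhysics.QuantumFieldTheory.Balaban1983to89.B13FamilySum (Ineq126 VolBound)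
open Literature.MathematicalPhysics.QuantumFieldTheory.Balaban1983to89.B16Exp198 (locR)

variable {Var Sv : Type*} {site : Var → Cube}

/-- **«The expression corresponding to X′₀ factorizes in the components», configuration-dependent terms**: under `LocalOps`,
the localization of every `V S Y` in `Y`, and `VLocal`, the Mayer terms `mayerTermS` satisfy `TermMul` (as
`termMul_mayerTerm`; the extra point is that `V_{S₁∪S₂} = V_{S₁}` on the domains of the first term and `= V_{S₂}` on those
of the second, an operation domain inside a localization domain being linked to it). [cite: Balaban1989LargeFieldII, (1.90) p.388] -/
theorem termMul_mayerTermS [DecidableEq LF] [DecidableEq DomY] (hrefl : ∀ a, adjC a a)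
    (hsymm : ∀ a b, adjC a b → adjC b a) (houtX : ∀ j, (locX j \ Yfix).Nonempty)
    {Op : Finset LF → ((Var → Sv) → ℂ) →+ ((Var → Sv) → ℂ)} (hOps : LocalOps adjC locX Yfix site Op)
    {V : Finset LF → DomY → (Var → Sv) → ℂ} (hV : ∀ S Y, DepOn Yfix site (V S Y) (locY Y))
    (hVl : VLocal locX locY V) (φ : Var → Sv) :
    TermMul adjC locX locY Yfix (mayerTermS Op V φ) := by
  intro S₁ D₁ S₂ D₂ hS hD hunl
  -- the interpolated factors and their products, per family
  obtain ⟨u, hu⟩ : ∃ u : Finset LF → DomY → (Var → Sv) → ℂ,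
      u = fun S Y ψ => ∫ t in (0 : ℝ)..1, Complex.exp ((t : ℂ) * V S Y ψ) * V S Y ψ := ⟨_, rfl⟩
  obtain ⟨g, hg⟩ : ∃ g : Finset LF → Finset DomY → (Var → Sv) → ℂ, g = fun S D ψ => ∏ Y ∈ D, u S Y ψ := ⟨_, rfl⟩
  have hmayer : ∀ S D, mayerTermS Op V φ S D = Op S (g S D) φ := fun S D => by
    rw [hg, hu]
    rfl
  have hdep_u : ∀ S Y, DepOn Yfix site (u S Y) (locY Y) := fun S Y φ' ψ' h => by
    rw [hu]
    simp only [hV S Y φ' ψ' h]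
  have hdep_g : ∀ S D, DepOn Yfix site (g S D) (locDom locX locY ∅ D) := fun S D φ' ψ' h => by
    rw [hg]
    show ∏ Y ∈ D, u S Y φ' = ∏ Y ∈ D, u S Y ψ'
    refine Finset.prod_congr rfl fun Y hY => hdep_u S Y φ' ψ' fun v hv => h v ?_
    refine Finset.union_subset_union ?_ subset_rfl hv
    exact (Finset.subset_biUnion_of_mem locY hY).trans Finset.subset_union_right
  -- `VLocal`: on 𝐃₁ the terms of S₁ ∪ S₂ are those of S₁, on 𝐃₂ those of S₂
  have hu₁ : ∀ Y ∈ D₁, u (S₁ ∪ S₂) Y = u S₁ Y := fun Y hY => by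
    rw [hu]
    funext ψ
    simp only [VLocal.eq_left hrefl hsymm houtX hVl hunl hY]
  have hu₂ : ∀ Y ∈ D₂, u (S₁ ∪ S₂) Y = u S₂ Y := fun Y hY => by
    rw [hu]
    funext ψ
    simp only [VLocal.eq_right hrefl houtX hVl hunl hY]
  have hprod : g (S₁ ∪ S₂) (D₁ ∪ D₂) = g S₂ D₂ * g S₁ D₁ := by
    rw [hg]
    funext ψ
    simp only [Pi.mul_apply]
    have e₁ : ∏ Y ∈ D₁, u (S₁ ∪ S₂) Y ψ = ∏ Y ∈ D₁, u S₁ Y ψ :=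
      Finset.prod_congr rfl fun Y hY => congrFun (hu₁ Y hY) ψ
    have e₂ : ∏ Y ∈ D₂, u (S₁ ∪ S₂) Y ψ = ∏ Y ∈ D₂, u S₂ Y ψ :=
      Finset.prod_congr rfl fun Y hY => congrFun (hu₂ Y hY) ψ
    rw [Finset.prod_union hD, e₁, e₂, mul_comm]
  -- the outside parts do not touch
  have hnt₁ : ¬ Touch adjC (locDom locX locY ∅ D₁ \ Yfix) (S₂.biUnion locX \ Yfix) := by
    rw [← locDom_empty_right (locX := locX) (locY := locY) S₂]
    exact not_touch_of_unlinked hunl (Finset.empty_subset _) subset_rfl subset_rfl (Finset.empty_subset _)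
  have hnt₂ : ¬ Touch adjC (locDom locX locY S₂ D₂ \ Yfix) (S₁.biUnion locX \ Yfix) := by
    rw [← locDom_empty_right (locX := locX) (locY := locY) S₁]
    intro ht
    exact not_touch_of_unlinked hunl subset_rfl (Finset.empty_subset _) subset_rfl subset_rfl
      (Touch.symm hsymm ht)
  have hdep_h : DepOn Yfix site (Op S₂ (g S₂ D₂)) (locDom locX locY S₂ D₂) :=
    (hOps.depOn S₂ (g S₂ D₂) _ (hdep_g S₂ D₂)).mono
      (Finset.union_subset Finset.subset_union_left (locDom_mono locX locY (Finset.empty_subset _) subset_rfl))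
  rw [hmayer, hmayer, hmayer, hOps.comp S₁ S₂ hS, hprod, hOps.mul_out S₂ (g S₂ D₂) (g S₁ D₁) _ (hdep_g S₁ D₁) hnt₁,
    mul_comm (Op S₂ (g S₂ D₂)) (g S₁ D₁), hOps.mul_out S₁ (g S₁ D₁) (Op S₂ (g S₂ D₂)) _ hdep_h hnt₂, Pi.mul_apply]

/-- **(1.90) for the configuration-dependent curly bracket** from the locality of the operations, the localization of the
`V S Y`, and `VLocal`. [cite: Balaban1989LargeFieldII, (1.90) p.388] -/
theorem eq190_bracketS_of_localOps [Fintype LF] [Fintype DomY] [DecidableEq LF] [DecidableEq DomY] [DecidableRel adjC]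
    (hrefl : ∀ a, adjC a a) (hsymm : ∀ a b, adjC a b → adjC b a) (houtX : ∀ j, (locX j \ Yfix).Nonempty)
    (houtY : ∀ Y, (locY Y \ Yfix).Nonempty) {Op : Finset LF → ((Var → Sv) → ℂ) →+ ((Var → Sv) → ℂ)}
    (hOps : LocalOps adjC locX Yfix site Op) {V : Finset LF → DomY → (Var → Sv) → ℂ}
    (hV : ∀ S Y, DepOn Yfix site (V S Y) (locY Y)) (hVl : VLocal locX locY V) (φ : Var → Sv) :
    bracketS Op V φ = polymerPartitionFunction (pinc adjC Yfix) (F191 adjC locX locY Yfix (mayerTermS Op V φ))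
      (polys190 adjC locX locY Yfix) := by
  rw [bracketS_eq_sum_mayerTermS]
  refine eq190 hrefl hsymm houtX houtY ?_ (termMul_mayerTermS hrefl hsymm houtX hOps hV hVl φ)
  simp [mayerTermS, hOps.empty]

/-- **(1.72) ⇒ (1.98) for the configuration-dependent curly bracket** (as `bracket_eq_exp_sum_locR_of_localOps`, under the
(1.97)-shaped activity bound `h197` and the `B16Exp198` leaves). [cite: Balaban1989LargeFieldII, (1.98) p.390] -/
theorem bracketS_eq_exp_sum_locR_of_localOps [Fintype LF] [Fintype DomY] [Fintype Cube] [DecidableEq LF]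
    [DecidableEq DomY] [DecidableRel adjC] (hrefl : ∀ a, adjC a a) (hsymm : ∀ a b, adjC a b → adjC b a)
    (houtX : ∀ j, (locX j \ Yfix).Nonempty) (houtY : ∀ Y, (locY Y \ Yfix).Nonempty)
    {Op : Finset LF → ((Var → Sv) → ℂ) →+ ((Var → Sv) → ℂ)} (hOps : LocalOps adjC locX Yfix site Op)
    {V : Finset LF → DomY → (Var → Sv) → ℂ} (hV : ∀ S Y, DepOn Yfix site (V S Y) (locY Y))
    (hVl : VLocal locX locY V) (φ : Var → Sv)
    {nbr : Cube → Finset Cube} (hnbr : ∀ a b, adjC a b → a ∈ nbr b) {ν : ℝ} (hν : ∀ b, ((nbr b).card : ℝ) ≤ ν)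
    {d : Finset Cube → ℝ} {c₁ R κ₀ K₀ cv τ : ℝ} (hd : ∀ X, 0 ≤ d X) (hc₁ : 0 ≤ c₁) (hK₀ : 0 ≤ K₀) (hτ : 0 ≤ τ)
    (h197 : ∀ X, ‖F191 adjC locX locY Yfix (mayerTermS Op V φ) X‖ ≤ c₁ * Real.exp (-(R * d X)))
    (h126 : Ineq126 (polys190 adjC locX locY Yfix) (fun X => X \ Yfix) d κ₀ K₀)
    (hvol : VolBound (polys190 adjC locX locY Yfix) (fun X => X \ Yfix) d cv)
    (hrate : κ₀ + τ * cv ≤ R) (hsmall : c₁ * Real.exp (τ * cv) * K₀ * ν ≤ τ) :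
    bracketS Op V φ
      = Complex.exp (∑ X ∈ (polys190 adjC locX locY Yfix).powerset.image (fun C => C.biUnion id),
          locR (pinc adjC Yfix) (polys190 adjC locX locY Yfix) id
            (F191 adjC locX locY Yfix (mayerTermS Op V φ)) X) := by
  rw [bracketS_eq_sum_mayerTermS]
  refine eq190_exp hrefl hsymm houtX houtY ?_ (termMul_mayerTermS hrefl hsymm houtX hOps hV hVl φ) hnbr hν hd hc₁
    hK₀ hτ h197 h126 hvol hrate hsmall
  simp [mayerTermS, hOps.empty]

end LocalityS

/-! ### I.4 (1.92) for the configuration-dependent terms; the second selector of p. 389 as a theorem -/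

/-- **(1.92) for the configuration-dependent Mayer terms** (Part H's `major192_mayerTerm`, family by family) under the
term-independent (1.68)-shaped majorant `‖V S Y‖ ≤ a(d(Y))` (print: rate d_{k,Z}(Y) with d_{k,Z′}(Y) = d_{k,Z}(Y) for Y ⊂ X′,
as read in `B16Ineq197`). [cite: Balaban1989LargeFieldII, (1.92) p.388] -/
theorem major192_mayerTermS [Fintype LF] [Fintype DomY] [DecidableEq LF] [DecidableEq DomY] (sz : Sizes LF DomY Cube)
    (K : B16Ineq197.Consts) {Op : Finset LF → (Φ → ℂ) →+ (Φ → ℂ)} {θ : LF → ℝ} (hOp : OpBound Op θ)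
    (hθ : ∀ j, 0 ≤ θ j ∧ θ j ≤ K.θ) (hα : 0 ≤ K.α) {V : Finset LF → DomY → Φ → ℂ}
    (h168 : ∀ S Y ψ, ‖V S Y ψ‖ ≤ K.a (sz.dY Y)) (φ : Φ) (X : Finset Cube) :
    (polymer191 adjC locX locY Yfix sz X).Major192 K (fun p => mayerTermS Op V φ p.1 p.2) :=
  fun p hp => major192_mayerTerm sz K hOp hθ hα (h168 p.1) φ X p hp

/-- **The second selector of p. 389, DERIVED** (*"or the domain X′ is disjoint with ⋃_{i=1}^m Y_i, and then the sum begins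
with q = 1"*): under `VSupp A`, a term WITHOUT operation domains whose localization domain misses the anchor set `A`
vanishes — each of its localization domains misses `A` and contains no operation domain of the (empty) family, so its `V`
is zero. [cite: Balaban1989LargeFieldII, (1.97) p.389] -/
theorem mayerTermS_eq_zero_of_empty {A : Finset Cube} {V : Finset LF → DomY → Φ → ℂ} (hVs : VSupp locX locY A V)
    {D : Finset DomY} {X : Finset Cube} (hdom : locDom locX locY (∅ : Finset LF) D = X) (hX : Disjoint X A)
    (hD : D.Nonempty) (Op : Finset LF → (Φ → ℂ) →+ (Φ → ℂ)) (φ : Φ) : mayerTermS Op V φ ∅ D = 0 := by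
  obtain ⟨Y, hY⟩ := hD
  have hYX : locY Y ⊆ X := by
    rw [← hdom]
    exact (Finset.subset_biUnion_of_mem locY hY).trans Finset.subset_union_right
  have hV0 : V ∅ Y = 0 := hVs ∅ Y (hX.mono_left hYX) fun j hj => absurd hj (Finset.notMem_empty j)
  have hfun : (fun ψ => ∏ Y' ∈ D, ∫ t in (0 : ℝ)..1, Complex.exp ((t : ℂ) * V ∅ Y' ψ) * V ∅ Y' ψ) = 0 := by
    funext ψ
    exact Finset.prod_eq_zero hY (by simp [hV0])
  unfold mayerTermS
  rw [hfun, map_zero, Pi.zero_apply]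

/-! ### I.5 (1.97) for the configuration-dependent gas with NO selector hypothesis; `B16.Ineq197` by name; (1.98) -/

/-- **(1.97) for the configuration-dependent gas, selector-free** (as Part H's `norm_F191_mayerTerm_le`): `|F(X′)| ≤
(e^{−p₀(g_k)} + α^{1/3}) exp(−(1+β)κ d_{k,∪Y_i}(X′))` for every polymer. [cite: Balaban1989LargeFieldII, (1.97) p.389] -/
theorem norm_F191_mayerTermS_le [Fintype LF] [Fintype DomY] [DecidableEq LF] [DecidableEq DomY]
    (sz : Sizes LF DomY Cube) (K : B16Ineq197.Consts) (hK : K.Small)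
    {Op : Finset LF → (Φ → ℂ) →+ (Φ → ℂ)} {θ : LF → ℝ} (hOp : OpBound Op θ) (hθ : ∀ j, 0 ≤ θ j ∧ θ j ≤ K.θ)
    {V : Finset LF → DomY → Φ → ℂ} (h168 : ∀ S Y ψ, ‖V S Y ψ‖ ≤ K.a (sz.dY Y)) (φ : Φ) {X : Finset Cube}
    (h193s : (polymer191 adjC locX locY Yfix sz X).Subadd193 K)
    (h193v : (polymer191 adjC locX locY Yfix sz X).Vol193 K)
    (hXB : (polymer191 adjC locX locY Yfix sz X).XBudget K)
    (h194 : (polymer191 adjC locX locY Yfix sz X).Anch194 K)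
    (h196 : (polymer191 adjC locX locY Yfix sz X).Count196 K) :
    ‖F191 adjC locX locY Yfix (mayerTermS Op V φ) X‖
      ≤ (Real.exp (-K.p0) + K.α ^ (1 / 3 : ℝ)) * Real.exp (-((1 + K.β) * K.κ) * sz.dX X) := by
  rw [F191_eq_sum_polymer191 sz]
  exact norm_sum_adm_le_of_nonempty _ K hK h193s h193v hXB h194 h196
    (major192_mayerTermS sz K hOp hθ hK.α_pos.le h168 φ X) (fun p hp => adm191_nonempty hp)

/-- **(1.97), case X′ ∩ A = ∅, for the configuration-dependent gas: `c₁ = exp(−p₀(g_k))` with the selector PROVED** —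
the admissible pairs without operation domains contribute zero (`mayerTermS_eq_zero_of_empty`), the others are the
sibling's case `norm_sum_le_of_not_meets`; with `A = Yfix` this is print's *"X′ does not intersect ⋃Y_i"*, with
`A = Yfix ∪ Z_k` print's "second group" of p. 390 ((1.100)). [cite: Balaban1989LargeFieldII, (1.97) p.389] -/
theorem norm_F191_mayerTermS_le_of_not_meets [Fintype LF] [Fintype DomY] [DecidableEq LF] [DecidableEq DomY]
    (sz : Sizes LF DomY Cube) (K : B16Ineq197.Consts) (hK : K.Small)
    {Op : Finset LF → (Φ → ℂ) →+ (Φ → ℂ)} {θ : LF → ℝ} (hOp : OpBound Op θ) (hθ : ∀ j, 0 ≤ θ j ∧ θ j ≤ K.θ)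
    {V : Finset LF → DomY → Φ → ℂ} (h168 : ∀ S Y ψ, ‖V S Y ψ‖ ≤ K.a (sz.dY Y)) {A : Finset Cube}
    (hVs : VSupp locX locY A V) (φ : Φ) {X : Finset Cube} (hXfix : Disjoint X A)
    (h193s : (polymer191 adjC locX locY Yfix sz X).Subadd193 K)
    (h193v : (polymer191 adjC locX locY Yfix sz X).Vol193 K)
    (hXB : (polymer191 adjC locX locY Yfix sz X).XBudget K)
    (h194 : (polymer191 adjC locX locY Yfix sz X).Anch194 K)
    (h196 : (polymer191 adjC locX locY Yfix sz X).Count196 K) :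
    ‖F191 adjC locX locY Yfix (mayerTermS Op V φ) X‖
      ≤ Real.exp (-K.p0) * Real.exp (-((1 + K.β) * K.κ) * sz.dX X) := by
  classical
  rw [F191_eq_sum_polymer191 sz]
  have hsplit : ∑ p ∈ (polymer191 adjC locX locY Yfix sz X).adm, mayerTermS Op V φ p.1 p.2
      = ∑ p ∈ (restrictAdm (polymer191 adjC locX locY Yfix sz X) (fun p => p.1.Nonempty)).adm,
          mayerTermS Op V φ p.1 p.2 := by
    symm
    refine Finset.sum_filter_of_ne fun p hp hne => ?_
    by_contra hS
    rw [Finset.not_nonempty_iff_eq_empty] at hS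
    obtain ⟨hconn, hdom⟩ := mem_adm191.1 hp
    have hD : p.2.Nonempty := by
      rcases isConnTerm_nonempty hconn with h | h
      · rw [hS] at h
        exact absurd h Finset.not_nonempty_empty
      · exact h
    apply hne
    rw [hS] at hdom ⊢
    exact mayerTermS_eq_zero_of_empty hVs hdom hXfix hD Op φ
  rw [hsplit]
  exact B16Ineq197.Polymer.norm_sum_le_of_not_meets
    (restrictAdm (polymer191 adjC locX locY Yfix sz X) (fun p => p.1.Nonempty)) K hK
    (fun p hp => h193s p (Finset.mem_filter.1 hp).1) (fun p hp => h193v p (Finset.mem_filter.1 hp).1) hXB h194 h196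
    (fun p hp => major192_mayerTermS sz K hOp hθ hK.α_pos.le h168 φ X p (Finset.mem_filter.1 hp).1)
    (fun p hp => (Finset.mem_filter.1 hp).2)

/-- **(1.97), case X′ ∩ ⋃Y_i ≠ ∅, for the configuration-dependent gas: `c₁ = α^{1/3}`** (first selector PROVED as in Part H:
the operation domains do not meet ⋃Y_i). [cite: Balaban1989LargeFieldII, (1.97) p.389] -/
theorem norm_F191_mayerTermS_le_of_meets [Fintype LF] [Fintype DomY] [DecidableEq LF] [DecidableEq DomY]
    (sz : Sizes LF DomY Cube) (K : B16Ineq197.Consts) (hK : K.Small)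
    {Op : Finset LF → (Φ → ℂ) →+ (Φ → ℂ)} {θ : LF → ℝ} (hOp : OpBound Op θ) (hθ : ∀ j, 0 ≤ θ j ∧ θ j ≤ K.θ)
    {V : Finset LF → DomY → Φ → ℂ} (h168 : ∀ S Y ψ, ‖V S Y ψ‖ ≤ K.a (sz.dY Y)) (φ : Φ)
    (hXY : ∀ j, Disjoint (locX j) Yfix) {X : Finset Cube} (hXfix : ¬ Disjoint X Yfix)
    (h193s : (polymer191 adjC locX locY Yfix sz X).Subadd193 K)
    (h193v : (polymer191 adjC locX locY Yfix sz X).Vol193 K)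
    (hXB : (polymer191 adjC locX locY Yfix sz X).XBudget K)
    (h194 : (polymer191 adjC locX locY Yfix sz X).Anch194 K)
    (h196 : (polymer191 adjC locX locY Yfix sz X).Count196 K) :
    ‖F191 adjC locX locY Yfix (mayerTermS Op V φ) X‖
      ≤ K.α ^ (1 / 3 : ℝ) * Real.exp (-((1 + K.β) * K.κ) * sz.dX X) := by
  rw [F191_eq_sum_polymer191 sz]
  exact B16Ineq197.Polymer.norm_sum_le_of_meets _ K hK h193s h193v hXB h194 h196
    (major192_mayerTermS sz K hOp hθ hK.α_pos.le h168 φ X)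
    (fun p hp => snd_nonempty_of_meets hXY (mem_adm191.1 hp).2 hXfix)

/-- **Unit b02's leaf `B16.Ineq197` INHABITED by the configuration-dependent gas with NO selector hypothesis**: both
printed cases of (1.97) from the sup-norm bound of the operations, the (1.68)-shaped majorant, the index condition with
the fixed regions as anchors (`VSupp … Yfix`: every localization term contains an operation domain of its family or meets
⋃Y_i — print's condition when the step's new region Z_k contributes no further anchors; otherwise the domains meeting only
Z_k form the middle class recorded in `B16.RelDomainSys`'s docstring, cell D-b02.11, for which `norm_F191_mayerTermS_le`
gives c₁ = e^{−p₀(g_k)} + α^{1/3}), the disjointness of the operation domains from ⋃Y_i, the geometric leaves of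
`B16Ineq197` and `Consts.Small`. [cite: Balaban1989LargeFieldII, (1.97) p.390] -/
theorem ineq197_gasS [Fintype LF] [Fintype DomY] [DecidableEq LF] [DecidableEq DomY]
    (sz : Sizes LF DomY Cube) (K : B16Ineq197.Consts) (hK : K.Small)
    {Op : Finset LF → (Φ → ℂ) →+ (Φ → ℂ)} {θ : LF → ℝ} (hOp : OpBound Op θ) (hθ : ∀ j, 0 ≤ θ j ∧ θ j ≤ K.θ)
    {V : Finset LF → DomY → Φ → ℂ} (h168 : ∀ S Y ψ, ‖V S Y ψ‖ ≤ K.a (sz.dY Y)) (hVs : VSupp locX locY Yfix V)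
    (hXY : ∀ j, Disjoint (locX j) Yfix)
    (h193s : ∀ X, (polymer191 adjC locX locY Yfix sz X).Subadd193 K)
    (h193v : ∀ X, (polymer191 adjC locX locY Yfix sz X).Vol193 K)
    (hXB : ∀ X, (polymer191 adjC locX locY Yfix sz X).XBudget K)
    (h194 : ∀ X, (polymer191 adjC locX locY Yfix sz X).Anch194 K)
    (h196 : ∀ X, (polymer191 adjC locX locY Yfix sz X).Count196 K)
    (S : B16.RelDomainSys) (cubesOf : S.Dom → Finset Cube) (hdRel : ∀ Z, S.dRel Z = sz.dX (cubesOf Z))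
    (hmeets : ∀ Z, S.MeetsLF Z ↔ ¬ Disjoint (cubesOf Z) Yfix) (dom : S.Dom → Set Φ) :
    B16.Ineq197 S dom (fun Z φ => F191 adjC locX locY Yfix (mayerTermS Op V φ) (cubesOf Z)) K.p0 K.α K.β K.κ := by
  refine ⟨fun Z hZ φ _ => ?_, fun Z hZ φ _ => ?_⟩
  · rw [hdRel]
    exact norm_F191_mayerTermS_le_of_not_meets sz K hK hOp hθ h168 hVs φ (not_not.1 ((hmeets Z).not.1 hZ))
      (h193s _) (h193v _) (hXB _) (h194 _) (h196 _)
  · rw [hdRel]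
    exact norm_F191_mayerTermS_le_of_meets sz K hK hOp hθ h168 φ hXY ((hmeets Z).1 hZ)
      (h193s _) (h193v _) (hXB _) (h194 _) (h196 _)

section KnittingS

open Literature.MathematicalPhysics.QuantumFieldTheory.Balaban1983to89.B13FamilySum (Ineq126 VolBound)
open Literature.MathematicalPhysics.QuantumFieldTheory.Balaban1983to89.B16Exp198 (locR)

variable {Var Sv : Type*} {site : Var → Cube}

/-- **(1.72) ⇒ (1.98) for the configuration-dependent curly bracket with (1.97) DISCHARGED**: `{⋯} = exp Σ_X 𝐑′^{(k)}(X)`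
with `c₁ = e^{−p₀(g_k)} + α^{1/3}`, `R = (1+β)κ` in the Kotecký–Preiss clauses, from the locality and sup-norm bound of the
operations, the localization / locality / (1.68)-majorant of the `V S Y`, the geometric leaves of `B16Ineq197` for every
polymer, the relative leaves of `B16Exp198`, and `Consts.Small`. [cite: Balaban1989LargeFieldII, (1.98) p.390] -/
theorem bracketS_eq_exp_sum_locR_of_leaves [Fintype LF] [Fintype DomY] [Fintype Cube] [DecidableEq LF]
    [DecidableEq DomY] [DecidableRel adjC] (hrefl : ∀ a, adjC a a) (hsymm : ∀ a b, adjC a b → adjC b a)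
    (houtX : ∀ j, (locX j \ Yfix).Nonempty) (houtY : ∀ Y, (locY Y \ Yfix).Nonempty)
    {Op : Finset LF → ((Var → Sv) → ℂ) →+ ((Var → Sv) → ℂ)} (hOps : LocalOps adjC locX Yfix site Op)
    {θ : LF → ℝ} (hOp : OpBound Op θ) (sz : Sizes LF DomY Cube) (K : B16Ineq197.Consts) (hK : K.Small)
    (hθ : ∀ j, 0 ≤ θ j ∧ θ j ≤ K.θ) {V : Finset LF → DomY → (Var → Sv) → ℂ}
    (hV : ∀ S Y, DepOn Yfix site (V S Y) (locY Y)) (hVl : VLocal locX locY V)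
    (h168 : ∀ S Y ψ, ‖V S Y ψ‖ ≤ K.a (sz.dY Y)) (φ : Var → Sv)
    (h193s : ∀ X, (polymer191 adjC locX locY Yfix sz X).Subadd193 K)
    (h193v : ∀ X, (polymer191 adjC locX locY Yfix sz X).Vol193 K)
    (hXB : ∀ X, (polymer191 adjC locX locY Yfix sz X).XBudget K)
    (h194 : ∀ X, (polymer191 adjC locX locY Yfix sz X).Anch194 K)
    (h196 : ∀ X, (polymer191 adjC locX locY Yfix sz X).Count196 K)
    {nbr : Cube → Finset Cube} (hnbr : ∀ a b, adjC a b → a ∈ nbr b) {ν : ℝ} (hν : ∀ b, ((nbr b).card : ℝ) ≤ ν)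
    {κ₀ K₀ cv τ : ℝ} (hdX : ∀ X, 0 ≤ sz.dX X) (hK₀ : 0 ≤ K₀) (hτ : 0 ≤ τ)
    (h126 : Ineq126 (polys190 adjC locX locY Yfix) (fun X => X \ Yfix) sz.dX κ₀ K₀)
    (hvol : VolBound (polys190 adjC locX locY Yfix) (fun X => X \ Yfix) sz.dX cv)
    (hrate : κ₀ + τ * cv ≤ (1 + K.β) * K.κ)
    (hsmall : (Real.exp (-K.p0) + K.α ^ (1 / 3 : ℝ)) * Real.exp (τ * cv) * K₀ * ν ≤ τ) :
    bracketS Op V φ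
      = Complex.exp (∑ X ∈ (polys190 adjC locX locY Yfix).powerset.image (fun C => C.biUnion id),
          locR (pinc adjC Yfix) (polys190 adjC locX locY Yfix) id
            (F191 adjC locX locY Yfix (mayerTermS Op V φ)) X) :=
  bracketS_eq_exp_sum_locR_of_localOps hrefl hsymm houtX houtY hOps hV hVl φ hnbr hν hdX
    (add_nonneg (Real.exp_pos _).le (Real.rpow_nonneg hK.α_pos.le _)) hK₀ hτ
    (fun X => by
      rw [← neg_mul]
      exact norm_F191_mayerTermS_le sz K hK hOp hθ h168 φ (h193s X) (h193v X) (hXB X) (h194 X) (h196 X))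
    h126 hvol hrate hsmall

end KnittingS

/-! ### I.6 Consistency of the structural hypotheses: a configuration-dependent model of `VLocal` ∧ `VSupp` -/

variable (locX locY) in
open Classical in
/-- The localization terms `W Y` switched on exactly when the family has an operation domain inside `Y` or `Y` meets the
anchor set `A` — a model of the p. 377 index condition from configuration-independent terms `W`.
[cite: Balaban1989LargeFieldII, (1.68) p.377] -/
noncomputable def switchOn (A : Finset Cube) (W : DomY → Φ → ℂ) : Finset LF → DomY → Φ → ℂ :=
  fun S Y => if (∃ j ∈ S, locX j ⊆ locY Y) ∨ ¬ Disjoint (locY Y) A then W Y else 0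

/-- `switchOn A W` satisfies `VLocal`. [cite: Balaban1989LargeFieldII, (1.72) p.379] -/
theorem vLocal_switchOn (A : Finset Cube) (W : DomY → Φ → ℂ) : VLocal locX locY (switchOn locX locY A W) := by
  intro S S' Y h
  have hiff : ((∃ j ∈ S, locX j ⊆ locY Y) ∨ ¬ Disjoint (locY Y) A)
      ↔ ((∃ j ∈ S', locX j ⊆ locY Y) ∨ ¬ Disjoint (locY Y) A) :=
    or_congr_left ⟨fun ⟨j, hj, hjY⟩ => ⟨j, (h j hjY).1 hj, hjY⟩, fun ⟨j, hj, hjY⟩ => ⟨j, (h j hjY).2 hj, hjY⟩⟩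
  unfold switchOn
  rw [if_congr hiff rfl rfl]

/-- `switchOn A W` satisfies `VSupp A`. [cite: Balaban1989LargeFieldII, (1.68) p.377] -/
theorem vSupp_switchOn (A : Finset Cube) (W : DomY → Φ → ℂ) : VSupp locX locY A (switchOn locX locY A W) := by
  intro S Y hY hS
  unfold switchOn
  rw [if_neg]
  rintro (⟨j, hj, hjY⟩ | h)
  · exact hS j hj hjY
  · exact h hY

/-- `switchOn W` inherits the (1.68)-shaped majorant of `W`. [cite: Balaban1989LargeFieldII, (1.68) p.377] -/
theorem norm_switchOn_le (A : Finset Cube) {W : DomY → Φ → ℂ} {a : DomY → ℝ} (ha : ∀ Y, 0 ≤ a Y)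
    (hW : ∀ Y ψ, ‖W Y ψ‖ ≤ a Y) (S : Finset LF) (Y : DomY) (ψ : Φ) : ‖switchOn locX locY A W S Y ψ‖ ≤ a Y := by
  unfold switchOn
  split_ifs
  · exact hW Y ψ
  · simpa using ha Y

section SwitchOnDep

variable {Var Sv : Type*} {site : Var → Cube}

/-- `switchOn W` inherits the localization of `W`. [cite: Balaban1989LargeFieldII, (1.72) p.379] -/
theorem depOn_switchOn (A : Finset Cube) {W : DomY → (Var → Sv) → ℂ} (hW : ∀ Y, DepOn Yfix site (W Y) (locY Y))
    (S : Finset LF) (Y : DomY) : DepOn Yfix site (switchOn locX locY A W S Y) (locY Y) := by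
  intro φ ψ h
  unfold switchOn
  split_ifs
  · exact hW Y φ ψ h
  · rfl

end SwitchOnDep

end ConfigDependent

end Literature.MathematicalPhysics.QuantumFieldTheory.Balaban1983to89.B16Eq190Resummation
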